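import Summits.HodgeConjecture.HodgeConjecture.Theses.PadicSemiregularLift
import Mathlib.LinearAlgebra.FreeModule.StrongRankCondition
import Mathlib.NumberTheory.Padics.PadicVal.Basic

/-!
# Disproof of `FormalLiftingFromClassLifting` (stmt-HodgeConjecture-13825) — findings

Standing disprover of crux P1a of route `PadicSemiregularLift`. Cycle 1 (2026-08-15,
`refuter-cdisprove-…-13825-0`, §§1–5 below, unchanged), cycle 2 (2026-08-16,
`refuter-cdisprove-…-13825-g2-0`, §§6–9 and the cycle-2 part of this docblock), cycle 3
(2026-08-16, `refuter-cdisprove-…-13825-g3-0`, §§10–11: `-- Targets` = the stubs of the PICKED line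
`pro-class-correction-syntomic`, and the block "Cycle-3 findings") and cycle 4 (2026-08-16,
`refuter-cdisprove-…-13825-g4-0`, §12 and the block "Cycle-4 findings": the vector-bundle
converse PROVED, the kill criterion made unconditional, AMMN Thm F re-read at source, and the `p`-adic
arithmetic of the divided powers of `(pⁿ)` behind the weight range) and cycle 5 (2026-08-16,
`refuter-cdisprove-…-13825-g5-0`, §13 and the block "Cycle-5 findings" right below: the rational
pro-class and (1_K) are NECESSARY, P1a ⟺ its (1_K)-child on (⋆)-bundles, kill criterion 2 (`lim¹`
form) and its splitting over the leads' typed children, the weight-1 differential audited as the one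
piece load-bearing for BOTH halves, and the `d = 4` exposure of the disjunction). The crux: for `𝒳/W(k)` a smooth
projective model of relative dimension `d`, `d + 6 < p`, `H^b(𝒳,𝒪)`, `H^b(𝒳,Ω¹)` `p`-torsion-free
and `d ≤ 3 ∨ Ω¹ free`, and a finite locally free `E₁` on `X_k` with (⋆) CLASS-LIFTS-IMPLY-OBJECT-LIFTS
and a RATIONAL pro-class `ξ ∈ ℚ ⊗ lim_n K₀(X_n)` through `[E₁] ⊗ 1`, conclude `LiftsFormally 𝒳 E₁`.

## VERDICT after cycle 5: NO KILL — the statement is very probably TRUE (unchanged; a fifth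
independent reading re-derived (E1)–(E5) from scratch — `grⁱK(X_m,X_1) ≃ RΓ(Filⁱ_1/Filⁱ_m)[2i−1]` with
`φ` dropping out of the relative term, the `(a,b)`-bookkeeping of `ℍ^{2i}, ℍ^{2i−1}` for `d = 3`, the
finite-level Hodge–de Rham degeneration behind `δ = 0`, the four-lemma behind the weight-1 transitions
when `H³(𝒳,𝒪)` has torsion — and found no gap; what is new is formal: §13).

## Cycle-5 findings (2026-08-16, g5)

(T) NECESSITY, FORMAL (§13; landing copy `Theorems/FormalLiftingFromClassLifting/Negative/CompatibleLiftNecessity.lean`, p82721):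
`LiftsFormally 𝒳 E₁ ⇒ IntegralCompatibleLift 𝒳 E₁ ⇒ RationalProLift 𝒳 E₁` on EVERY `W(k)`-scheme
(`integralCompatibleLift_of_liftsFormally`, `rationalProLift_of_integralCompatibleLift`: the classes of a
formal lift ARE a point of the tree's `lim_n K₀(X_n)`, and `1 ⊗` it is the pro-class). So the last
hypothesis of P1a is implied by its conclusion, and under the crux, for every (⋆)-bundle on an `𝒳`
satisfying the hypotheses, `LiftsFormally ↔ RationalProLift ↔ IntegralCompatibleLift`
(`liftsFormally_iff_rationalProLift_of_crux`, `integralCompatibleLift_iff_rationalProLift_of_crux`);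
globally (`OneKOnStarBundles`, `oneKOnStarBundles_of_crux`, `crux_of_oneKOnStarBundles_of_twoK`,
`crux_iff_oneKOnStarBundles_of_twoK`): P1a ⟹ "(⋆)-bundles: rational pro-lift ⇒ integral compatible lift",
and MODULO (2_K) the two are EQUIVALENT — the glue only ever applies (1_K) to the (⋆)-bundle in hand, so
the leads' (1_K)-child may carry the extra hypothesis (⋆) without loss (their (1_K) for ALL `E₁` is a
priori stronger; equally true on paper, (E5) never uses (⋆)). KILL CRITERION 2 (`not_crux_of_incompatibleWitness`,
unconditional): one (⋆)-bundle with a rational pro-class and NO integral compatible lift kills P1a; it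
contains criterion 1 (`not_crux_of_oneStepWitness''` re-derives §12's from it) and SPLITS over the typed
children (`levelFailure_or_not_kernelTowerSurjective_of_incompatible`): either some level fails (⇒ ¬S2 ∨ ¬S3
at `𝒳`, (T2)) or every level lifts but not compatibly, which is EXACTLY a failure of (2_K) at `𝒳`
(`exists_compatibleLift_of_kernelTowerSurjective_of_liftsToAllLevels`: under kernel-tower surjectivity
level-wise lifts correct recursively to a compatible family — the converse moral of the `lim¹` toy (T3)).
And for the conclusion itself (`counterexample_anatomy`, `counterexample_hits_a_stub`, no hypothesis on
`𝒳`): if a (⋆)-bundle with a rational pro-class does NOT lift formally, then AT THE SAME `𝒳` S1 = (2_K) or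
S2 or S3 fails — the picked line's stub split is COMPLETE on the negative side, nothing falls between the
stubs. Net for the dispatcher: a refuter of P1a, of (1_K), of (2_K), of S2, of S3 hunts ONE object on ONE `𝒳`.

(U) THE ONE DIFFERENTIAL THAT IS LOAD-BEARING FOR BOTH HALVES (fifth-reader audit of (E3)). In the
`d ≤ 3` proof the only differential meeting `π₀`/`π₋₁` is `d₁ : π₀gr¹ = H¹(X_1, 1+p𝒪_{X_m}) → π₋₁gr² =
H³(𝒳,Ω¹)/p^{m−1}` (E1). Cycle 2 recorded it as the [Deg]-input of (2_K); it is ALSO load-bearing for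
(1_K): were `d₁ ≠ 0`, the weight-2 part of the obstruction group `G_m` would be `coker(d₁)_m`, and
`lim_m coker(d₁)_m` can acquire `p`-torsion although `H³(𝒳,Ω¹)` has none — the torsion-freeness of `G_∞`
in (E5) silently uses `d₁ = 0`. Two independent discharges are on file, so this is not a single point of
failure: (E3) (weight 1 is realised by line bundles: `[L] − [𝒪]`, `L ∈ ker(Pic X_m → Pic X_1)`, hits all
of `π₀gr¹`; in print the weight-1 graded piece of the motivic filtration IS `𝔾_m`-cohomology — Bouis
arXiv:2412.06635 Ex. 3.5/3.9, materialised p0017 L43–50 / p0018 L30–39: `ℤ(1)^{cla}(X) ≃ RΓ_Zar(X,𝔾_m)[−1]`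
for smooth `X`, `ℤ(1)^{lisse}(R) ≃ τ^{≤1}RΓ_Zar(R,𝔾_m)[−1]` for EVERY commutative ring, `H² = Pic` — and
BMS2 Prop. 7.17 for `ℤ_p(1) ≃ T_p𝔾_m` on the syntomic side), and (H) (`ψ^m`-weights `m ≠ m²` mod `p`,
Bouis Prop. 4.3, integral). A refuter wanting to break P1a through (F1) must break BOTH.

(V) THE DISJUNCTION IS NOT DECORATION AT `d = 4` (natural strengthening analysed, typed as
`CruxWithoutDisjunction` in §13b with `crux_of_cruxWithoutDisjunction`): dropping `d ≤ 3 ∨ Ω¹ free` while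
keeping only `hO`, `hΩ` exposes the statement at FOURFOLDS. For `d = 4` the pro-obstruction group acquires
the weight-3 piece `lim_m ℍ⁶(C⁽³⁾_m) = H⁴(𝒳,Ω²)/(δ-image)` (`(a,b) = (4,2)`), and by Grothendieck duality over
`W` (`Ω²` is self-dual for `d = 4`) `H⁴(𝒳,Ω²)_tors ≅ Ext¹_W(H¹(𝒳,Ω²),W) ≅ (H¹(𝒳,Ω²)_tors)^∨` — invisible to
`hO`/`hΩ`, which control `Ω⁰, Ω¹` and by duality `Ω³, Ω⁴` only. So a Hodge-`(𝒪,Ω¹)`-torsion-free fourfold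
with `H¹(𝒳,Ω²)[p] ≠ 0` and a (⋆)-bundle whose class has a non-zero (torsion) weight-3 pro-obstruction
("`c₃`-type") would refute `CruxWithoutDisjunction` while P1a stands. No example is computed here (none
in print to this seat's knowledge; searches degraded this cycle: OpenAlex/S2 429, local FTS down); the
point is typed advice: when `Ω²` gets a carrier, the hypothesis to file for `d ≥ 4` is torsion-freeness of
ALL `H^b(𝒳,Ω^a)` (as the informal text says), not `hO ∧ hΩ`.

(W) ENVIRONMENT: route rev 10 unchanged since 02:17Z; lead-2 closed all three lines `line-dead` (carrier)
at 04:00Z with a carrier-first planner brief; `payload.targets = []`, no stuck stubs; nothing new filed to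
attack. The pre-warning (P)/(T5) stands for whatever carrier item is filed next.

## VERDICT after cycle 4 (kept): NO KILL — the statement is very probably TRUE (a fourth
independent reading, now including the in-print inputs of (F1) at source, found no gap; the formal
kill criterion of §6 no longer carries any folklore hypothesis, §12).

## Cycle-4 findings (2026-08-16, g4)

(Q) THE LOAD-BEARING IN-PRINT INPUT RE-READ AT SOURCE. Antieau–Mathew–Morrow–Nikolaus, *On the
Beilinson fiber square*, arXiv:2003.12541 (Duke 2022), Theorem F (materialised text p0005 L120–140,
proof §4.2 p0018): "Let `R` be a quasisyntomic ring. (1) For each `i ≥ 0`,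
`ℚ_p(i)(R) ≃ fib(φ − pⁱ : LΩ_R^{≥i} → LΩ_R)_{ℚ_p}`. (2) For `i ≤ p − 2`,
`ℤ_p(i)(R) ≃ fib(φ/pⁱ − id : LΩ_R^{≥i} → LΩ_R)`", `LΩ_R` the `p`-adic DERIVED de Rham cohomology of `R`
(absolute) with its derived Hodge filtration. For `R = A/pⁿ`, `A` `p`-complete, `p`-torsion-free and
smooth over `W(k)` (`k` perfect, so `L_{W/ℤ_p} = 0` `p`-adically and absolute = relative to `W`):
`R` is quasisyntomic (`L_{R/ℤ_p}` has amplitude `[−1,0]`: `Ω¹_{A/W}` and `(pⁿ)/(p²ⁿ)[1]`), and by the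
crystalline comparison for derived de Rham cohomology `LΩ_R` is the de Rham complex of the PD-envelope
of `(pⁿ) ⊂ A`, i.e. of `A` itself, with `LΩ_R^{≥i} = [I^{[i−j]} Ω^j_A]_j`, `I^{[m]}` = the `m`-th
divided-power ideal of `(pⁿ)`, generated by the `γ_κ(pⁿ) = p^{nκ}/κ!`, `κ ≥ m`. The cycle-1/2
"staircase" `Filⁱ_n = [p^{n(i−j)} Ω^j]_j` is therefore correct EXACTLY when `I^{[m]} = p^{nm} A`
`p`-adically for all `m ≤ i`, i.e. when `min_{κ ≥ m} (nκ − v_p(κ!)) = nm`: TRUE for `m ≤ p − 1`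
(§12 `staircase_pdPower_val`, all `n ≥ 1`) and FALSE from `m = p` on (`v_p(p!) = 1`:
`γ_p(pⁿ)` has valuation `np − 1`, §12 `padicValNat_prime_factorial`). So the staircase description of
the relative graded pieces holds in all weights `i ≤ p − 1` (`≥ d + 6 > d + 3`, the largest weight
that can touch `π₁, π₀, π₋₁` of `K(X_m, X_1)` by the crude amplitude bound of (O)), with one weight to
spare over AMMN's `i ≤ p − 2` —
and the place where it breaks (`m = p`) is precisely the weight of AKN's even class `K₄(ℤ/9)` of (F).
Net: (F1) is confirmed as cited; the bound `d + 6 < p` is not where a counterexample can hide.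

(R) THE FOLKLORE CONVERSE IS NOW A THEOREM (§12, kernel-checked, axioms standard; landed as
`Theorems/FormalLiftingFromClassLifting/Negative/VectorBundleConverse.lean`): a vector bundle in
Mathlib's sense (locally free AND of finite type) on ANY scheme is finite locally free
(`isFiniteLocallyFree_of_isVectorBundle`; Stacks 01C6). Proof: at `x` restrict a trivialisation
`E|_U ≅ 𝒪^I` and finitely many generators of `E|_V` to `W = U ∩ V ∋ x` (restriction to the opens over
`W` is a left adjoint, so it keeps epimorphisms), get `𝒪^K ↠ 𝒪^I` over `W ≠ ∅`; `Hom(−, 𝒪)` makes it an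
injective `End(𝒪)`-linear map `End(𝒪)^I ↪ End(𝒪)^K`, and `End(𝒪)` is a non-zero commutative ring
(`end_unit_mul_comm`, `end_unit_id_ne_zero`), so the strong rank condition bounds `#I ≤ #K`
(`finite_of_epi_free`). CONSEQUENCES, all unconditional now: `vectorBundleConverse_holds :
VectorBundleConverse` (§6's isolated debt), `oneStepClassLift_of_liftsFormally'`,
`oneStepClassLift_of_crux'`, the KILL CRITERION `not_crux_of_oneStepWitness'` (one finite locally free
`E₁` on a Hodge-torsion-free `𝒳` under the hypotheses of the crux with `[E₁] ⊗ 1` rationally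
pro-liftable and `[E₁] ∉ im(K₀(X_2) → K₀(X_k))` refutes P1a outright), and the exact dictionary
between the conclusion and the `K`-tower: `liftsToThickening_of_liftsFormally` (every level, not only
`X_2`) and `liftsToAllLevels_of_liftsFormally : LiftsFormally 𝒳 E₁ → LiftsToAllLevels 𝒳 [E₁]` — the
conclusion of the crux implies the conclusion of S2 ∧ S3 at `[E₁]` (cf. (T2)), so ANY level-`n`
class-lifting failure of a formally liftable `E₁` is now a formal contradiction, and the lead's /
planner's `IsVectorBundle` ↔ `IsFiniteLocallyFree` book-keeping (recommendation 3 of the lead's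
cycle-1 notes) is discharged.

(S) NO NEW FILING TO ATTACK: after the lead's `promote-stub` (cycle 1) the route is unchanged (rev 10;
the only event is the AUTO-CRUX promotion of P3a `FormalVectorBundlesAlgebraize`). The pre-warning (P)
is now a THEOREM, (T5) `obstructionTower_schema_refuted` / `obstructionTower_decoration` (§12): on the
`K₀`-tower of EVERY `𝒳` there is a tower `(G, ob, t)` satisfying verbatim the hypotheses `ht`, `hexact` of
the lead's `pSaturated_of_obstructionTower` with a compatible family killed by `p` and non-zero at level
`0` (the cokernel tower decorated by `ℤ/p`) — so "every obstruction tower is `p`-torsion-free on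
compatible families" is refutable on the first `𝒳` satisfying the crux's hypotheses and must not be
filed as the typed residual of S2; only the genuine relative `K`-theory tower carries (E5).

## VERDICT after cycle 3 (kept): NO KILL — the statement is very probably TRUE (a third
independent reading of every carrier and of the cycle-2 paper proof found no gap, and SHARPENED it:
for `d ≤ 3` only `H²(𝒳,𝒪)[p] = 0` and `H³(𝒳,Ω¹)[p] = 0` are ever used, §10 (T4) / (M) below).

## Cycle-3 findings (2026-08-16, g3)

(J) THIRD-READER CARRIER AUDIT — honest, again: `KZero` relations are ALL short exact sequences of
finite locally free modules (`ShortComplex.ShortExact` in `X.Modules`), not split ones; `cotangentSheaf 𝒳`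
is `Ω¹_{𝒳/W}` RELATIVE to the `Over`-base (`constToPresheaf` is built from `𝒳.hom`), so "`Ω¹` free" and
`hodgeCohomologyOne` are the relative notions of the informal text; `Sheaf.H` is `Ext` from the constant
sheaf on `Opens` (genuine Zariski cohomology); `IsProjectiveOverRing` is a closed immersion into
`Proj W[x₀,…,xₙ]`; `IsSmoothProperModel` forces geometrically integral fibres (`H⁰(X_k,𝒪) = k`, whence
`H¹(𝒳,𝒪)` is automatically torsion-free). No junk instance, no vacuity, no universe trap
(`KZero : Type 1` throughout).

(K) STUB S3 (`stub_primeToPLifting`) IS A THEOREM ON PAPER WITH NO HYPOTHESIS BEYOND PROJECTIVITY: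
`X_{n+1}` is projective over the Artinian `W_{n+1}`, so `K₀(Vect) = π₀K^B` (Thomason–Trobaugh, ample
line bundle) for `X_{n+1}` and `X_k`, and `coker(K₀(X_{n+1}) → K₀(X_k)) ↪ π₋₁` of
`F := fib(K^B(X_{n+1}) → K^B(X_k))`; affine-locally `π_i F = 0` for `i ≤ 0` (`K₀` and — by Bass'
contracted-functor definition, inductively — all negative `K`-groups are invariant under nilpotent
extensions; `K₁(A) ↠ K₁(A/I)`), and `π_i F = K_i(A, I)` is a `p`-group for `i ≥ 1` (Weibel 1982: `I`
nilpotent, `p^{n+1} = 0` in `A`); by Zariski descent `π₋₁F(X)` is filtered by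
`H^s(X_k, 𝒦^{rel}_{s-1})`, `2 ≤ s ≤ d`, each `p`-primary (noetherian space: cohomology commutes with
the filtered union of the `p^N`-torsion subsheaves). So multiplication by `M`, `p ∤ M`, is injective on
the cokernel: S3. Level `0` is even formal ((T1) `primeToPDivisible_level_zero`). Not attackable.

(L) STUBS S1/S2 = (2_K)/(saturated (1_K)) keep the crux's disjunction (unlike line
`syntomic-staircase`), so they are covered on paper by (E4)/(E5) (`d ≤ 3`) and (E7)+(H) (`Ω¹` free).
Formal content landed in §10: level `0` free (T1); S2 ∧ S3 ⇒ `[E₁]` lifts to EVERY level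
(`liftsToAllLevels_of_stubs`), hence the cycle-2 one-step witness of `Negative/OneStepClassLift` is
EXACTLY a counterexample to S2 or S3 at the same `𝒳` (T2,
`not_pSaturated_or_not_primeToPDivisible_of_oneStepWitness`) — disprover and drefuter hunt one object;
toy tightness (T3): S2 is independent of S1 + "cokernels killed by `p`" (`pSaturation_independent`, the
Godeaux–Serre shape `lim = ℤ/q`), and level-wise lifts at all levels give no compatible lift without S1
(`levelwiseLifts_not_compatible`, a `lim¹` toy: `ℤ/2 ← ℤ ←(×3) ℤ ← ⋯`).

(M) MINIMAL HYPOTHESES FOR `d ≤ 3` (hypothesis mutation, re-derived line by line from (E)): the weight-1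
transitions `H¹(X_m,𝒪) → H¹(X_{m-1},𝒪)` are onto iff `H²(𝒳,𝒪)[p] = 0`; the weight-2 transitions on
`ℍ³(C^{(2)}_m)` are onto as soon as `H²(X_m,Ω¹) → H²(X_{m-1},Ω¹)` is, i.e. iff `H³(𝒳,Ω¹)[p] = 0`, which
also gives `δ = H³(p·d) = 0` (`d₁ ⊗ K = 0` into a torsion-free target) and `lim_m ℍ⁴(C^{(2)}_m) = H³(𝒳,Ω¹)`;
the weight-3 piece `ℍ⁵(C^{(3)}_m) = H³(X_{m-1},Ω²)/δ` has onto transitions with NO hypothesis (`H⁴ = 0`);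
`lim_m H²(X_{m-1},𝒪) = H²(𝒳,𝒪) ⊕ T_p(H³(𝒳,𝒪)_{tors}) = H²(𝒳,𝒪)`. Hence (1_K) ∧ (2_K), and with them P1a,
use ONLY `H²(𝒳,𝒪)[p] = 0` and `H³(𝒳,Ω¹)[p] = 0` for `d ≤ 3` (`= Ext¹_W(H¹(𝒳,Ω²),W)[p]` by duality);
`H^b(𝒪)`, `b ≠ 2`, and `H^b(Ω¹)`, `b ≠ 3`, are decoration there. Typed as `CruxThreefoldMinimal` (T4) with
`crux_of_minimal_of_omegaFree : CruxThreefoldMinimal → CruxOmegaFree → FormalLiftingFromClassLifting`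
and the converse projections `lowDim_of_crux`, `omegaFree_of_crux` (the split loses nothing). For a
refuter: a `d ≤ 3` witness may ignore every torsion hypothesis except these two — and still none exists
on paper.

(N) SECOND-READER CHECK OF (H): Bouis arXiv:2412.06635 Prop. 4.3 re-read on the materialised text
(p0022 L31–35, proof p0023 L2): "natural multiplicative automorphism `ψ^m` of the filtered spectrum
`Fil_BMS TC(X;ℤ_p)` … the induced automorphism on the `i`-th graded piece `ℤ_p(i)^{BMS}(X)[2i]` is
multiplication by `mᶦ`", for every qcqs derived `ℤ[1/m]`-scheme — INTEGRAL, as cycle 2 said (only the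
`K`-theory side `Fil_cla K(X)[1/m]` is `m`-inverted). Confirmed.

(O) EXOTIC WEIGHTS CANNOT ENTER (the last place a level-wise integral discrepancy could hide): by Zariski
descent `π₋₁K(X_m,X_1)` is filtered by `H^s(X_1, 𝒦^{rel}_{s-1})`, `2 ≤ s ≤ d`, and `π₀` by
`H^s(X_1,𝒦^{rel}_s)`, `1 ≤ s ≤ d` (affine-locally `π_{≤0}` of the relative `K`-theory vanishes, (K)); so
only the relative `K`-SHEAVES `𝒦₁^{rel} = 1 + p𝒪_{X_m}` (weight 1), `𝒦₂^{rel}` (Milnor, weight 2: `K₂` of a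
local ring with residue fields of `> 5` elements is `K₂^M`), …, `𝒦_d^{rel}` occur, whose weights are
`≤ t + 2 ≤ d + 2 < p - 1` (local syntomic amplitude `≤ i + 1`, relative `≤ i + 2`); AKN's even classes
(`K₄(ℤ/9)`, weight `p`) live in `𝒦_{2p-2}` and never meet `π₀`, `π₋₁` for `d + 6 < p`. So every
differential that touches the obstruction or kernel groups has length `r ≤ d + 1 < p - 1` and is killed
by (H) (or is the line-bundle differential of (E3)).

(P) PRE-WARNING FOR THE NEXT STAGE (read after the lead's cycle 1, skeleton §7, 01:40Z: all three stubs
`stub-blocked` on the missing CARRIER — the boundary `∂ : K₀(X_k) → π₋₁K(X_{n+1}, X_k)` of relative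
`K`-theory — and the lead recommends filing it hypothesis-structure style, as `Motives/CrystallineRealization`).
If the carrier lands as a structure `T` of DATA + AXIOMS and a stub is then retyped as a closed
`∀ T, …`-statement whose conclusion USES `T` (e.g. "`∀ T : RelKObstructionData 𝒳`, compatible families of
`Π_m T.G m` have no `p`-torsion"), it is refutable by RE-DECORATION exactly like `CycleClassIsChernCharacter`
was (junk `T.G m := ℤ/p`, `T.∂ := 0` satisfies exactness-type axioms only if they are stated loosely): the
torsion-freeness of `lim_m π₋₁K` is a THEOREM about ONE object, not an axiom schema. Safe shapes: (i) the
lead's `pSaturated_of_obstructionTower` / `primeToPDivisible_of_boundary` (the tower only feeds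
hypotheses; conclusion `PSaturated 𝒳` is `T`-free), whose residual is then "∃ such a tower" = (1_K) itself,
not easier; (ii) a named Literature fact pinned to the GENUINE object (relative `K`-theory spectrum of the
thickening, once constructible). A typed item of shape (i) with the tower's torsion-freeness moved into a
`Literature` "fact" quantified over all `T` would be this crux's third misstatement; this seat will test any
such filing with the `ℤ/p`-decoration first.

## VERDICT after cycle 2 (kept): NO KILL — and the statement is very probably TRUE.
For `d ≤ 3` this file now contains a complete PAPER proof modulo one assembled-from-print input
(F1); for `d ≥ 4` (the `Ω¹`-free branch = abelian schemes and their torsors) the round-1 cards'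
`[-1]^*`-parity lever closes the remaining gap (torsors by faithfully flat descent of the vanishing,
(E7)); and (H): the integral pure-weight Adams operations the round-1 line treats as its one open "bet"
are IN PRINT (Bouis arXiv:2412.06635 Prop. 4.3), which discharges [Deg] in every branch at once.
A Lean kill is impossible for a
true statement; a Lean PROOF is blocked only by carriers (no `K`-theory spectra / syntomic
complexes in Mathlib). What the provers should take from this file is the proof plan (E) and the
formal reductions §§3–4 (cycle 1), §6 and §9 (cycle 2).

## Cycle-2 findings

(A) INDEPENDENT TYPED RE-AUDIT (second reader). Every carrier re-read at source:
`KTheory.KZero` (honest Grothendieck group on `IsFiniteLocallyFree` modules mod short exact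
sequences, functorial pull-back), `ContinuousKZeroRat I 𝒳 = ℚ ⊗_ℤ lim_n K₀(𝒳 ⊗ W/p^{n+1})`
(tensor AFTER the limit, as in BEK 1.3(b)), `Crystalline.specialFibreToTower` /
`WittScheme.specialFibreToThickening` (same `pullback.map`), `structureSheafCohomology` /
`hodgeCohomologyOne` (Mathlib `Sheaf.H` of `𝒪` and of the sheafified Kähler `Ω¹_{𝒳/W}`),
`IsSmoothProperModel` (smooth of rel. dim `d`, proper, both fibres smooth projective geometrically
integral — so `𝒳 ≠ ∅`, `thickening 𝒳 0 = ∅` is never used: all indices are `n + 1`),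
`LiftsFormally` (vector bundles `E n` on `X_{n+1}`, `E (n+1)|X_{n+1} ≅ E n`, `E 0|X_k ≅ E₁`).
No junk model, no vacuity, no hidden restriction: the typing is faithful. The one asymmetry:
`LiftsFormally` produces `IsVectorBundle` (Mathlib: locally free ∧ finite type) while `K₀` needs
`IsFiniteLocallyFree`; the tree proves only `IsFiniteLocallyFree.isVectorBundle`. The converse is
folklore (Stacks 01C6) but absent; it is isolated below as `VectorBundleConverse` (§6).

(B) THE CHEAPEST KILL CRITERION, FORMAL (§6, all kernel-checked). If `[E₁] ∉ im(K₀(X_2) → K₀(X_k))`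
then (⋆) holds VACUOUSLY (`classLiftsImplyObjectLifts_of_not_oneStepClassLift`), so the crux makes
such an `E₁` — which does not lift to `X_2` even as a class — lift formally
(`liftsFormally_of_crux_of_not_oneStepClassLift`); modulo `VectorBundleConverse` this is absurd:
`oneStepClassLift_of_crux`, `not_crux_of_oneStepWitness`. So ONE finite locally free `E₁` on a
Hodge-torsion-free `𝒳` with `[E₁] ⊗ 1` rationally pro-liftable and `[E₁]` not liftable to
`K₀(𝒳 ⊗ W/p²)` kills P1a — no (⋆), no semiregularity, no objects. (Rattack-13825-0's `C_tors` is
the special case `[E₁] = [Ẽ|X_k] + torsion`.) Paper status of the criterion: it CANNOT fire, by (E).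

(C) THE CONCLUSION IS HONEST (§7, proved): restrictions of finite locally free modules on `𝒳` lift
formally on ANY `W(k)`-scheme (`liftsFormally_of_flfLift`, `liftsFormally_free`); with P3a
(`FormalVectorBundlesAlgebraize`) `LiftsFormally` = algebraic liftability on a smooth proper model.

(D) CYCLE-1 LEAD CLOSED. The level-wise `K`-vs-motivic discrepancy of cycle 1 (Angeltveit:
`K₃(W_n,(p)) ≅ W_{2(n-1)}(k)` vs BEK's level-`n` `p²W_n`) is fully explained by the PD-filtration of
the ideal `(pⁿ)`: the correct level-`n` weight-`i` complex is the STAIRCASE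
`Fil^i_n = [p^{n(i-j)⁺} Ω^j_𝒳̂]_j` (AMMN arXiv:2003.12541 Thm F(2), `i ≤ p - 2`; PD-envelope of `(pⁿ)`
in the `p`-torsion-free `𝒪_𝒳̂` is `𝒪_𝒳̂`), not BEK's pro-object `p(i)Ω^{<i}_{X_n}` (pro-correct
only: e.g. `p²𝒪_{X_2} = 0`, so BEK's level-2 weight-2 term misses the summand `H⁴(X_2, 𝒪)` of the
one-step obstruction group, = "`gr⁰_F` of `ch₂` mod `p²`", non-zero on abelian fourfolds but killed by
the rational Hodge condition + saturation). Concretely the cycle-1 "first unexplained piece" is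
`coker(𝒦₃(X_{m+1},X_1) → 𝒦₃(X_m,X_1))`, a `B_{m-1}Ω¹_{X_1}`-type sheaf = the image `B` of the sheaf
boundary `𝒦₃(X_m,X_1) → 𝒦₂(X_{m+1},X_m) = Ω¹_{X_1}` (for `m = 2` exactly `𝒪_{X_1}/𝒪_{X_1}^p ≅ B₁Ω¹`,
computed from `ker δ₃ → ker δ₂ = 𝒪_{X_2}`, `δ_m : x ↦ p·dx`, whose image is `{x : x̄ ∈ 𝒪^p_{X_1}}`), and
`H³(X_1, B) ≠ 0` on superspecial `E³` (`m = 2`: `H³(𝒪)/F H³(𝒪) = k`). These classes do NOT obstruct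
(2_K): they are compensated by `K₂`-symbol classes `H²(X_1, N)`,
`N = ker(𝒦₂(X_{m+1},X_1) → 𝒦₂(X_m,X_1))`, through the Bockstein of `0 → B → Ω¹_{X_1} → N → 0`; the
residual obstruction is the image of `H³(X_1, B) → H³(X_1, Ω¹)`, which for `m = 2` factors through
`H³(d) : H³(𝒪) → H³(Ω¹) = 0` (Hodge–de Rham degeneration; `H³` right exact) — the ideators'
"cross-term `H³(d) = 0`", now derived at sheaf level; for all `m` at once it is the hypercohomology
statement (E2)/(E4) below (which never looks at cohomology sheaves).

(E) THE `E_∞`-ANALYSIS: [Deg] IS EMPTY FOR `d ≤ 3` (main finding of cycle 2; removes the stub that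
all three round-1 triagers flagged as "the only K-theoretic input not settled by F1 + F2").
Notation: `C^{(i)}_m := Fil^i_1/Fil^i_m` (weight-`i` relative staircase complex of `(X_m, X_1)`, terms
in degrees `0 … min(i-1, d)`), `gr^i K(X_m,X_1) ≃ RΓ(X_1, C^{(i)}_m)[2i-1]` (F1), so
`π_t gr^i = ℍ^{2i-1-t}(C^{(i)}_m)`; differentials `d_r : π_t gr^i → π_{t-1} gr^{i+r}`.
 (E1) DIMENSION COUNT (`d = 3`): `π₋₁ gr^i = ℍ^{2i}(C^{(i)}_m) = 0` for `i ≥ 3` (`a + b = 2i`,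
  `a ≤ min(i-1,3)`, `b ≤ 3`), `π₀ gr^i = 0` for `i ≥ 4`, `π₋₂ gr² = ℍ⁵(C^{(2)}_m) = 0`. Hence the ONLY
  differential that can touch `π₀` or `π₋₁` non-trivially (beyond shrinking a quotient) is
  `d₁^{(a)} : π₀ gr¹ = H¹(X_1, 1 + p𝒪_{X_m}) → π₋₁ gr² = H³(X_{m-1}, Ω¹)`.
 (E2) LATTICE LEMMA (triage F2, re-derived): with `H^{b+1}(𝒳,𝒪)`, `H^b(𝒳,Ω¹)` torsion-free the maps
  `δ = p^c·d` vanish on cohomology, so `ℍ³(C^{(2)}_m)` is an extension of `H³(𝒳,𝒪)/p^{2m-2}` by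
  `H²(𝒳,Ω¹)/p^{m-1}`, `ℍ⁴(C^{(2)}_m) = H³(𝒳,Ω¹)/p^{m-1}`, `π₀gr¹ = H¹(𝒳,𝒪)/p^{m-1}`,
  `π₀gr³ = H³(𝒳,Ω²)/p^{m-1}` (`H³(Ω²)` torsion-free by duality from `H¹(Ω¹)`), all with SURJECTIVE
  transitions in `m`; `π₋₁gr¹ = H²(𝒳,𝒪)/p^{m-1}`.
 (E3) `d₁^{(a)} = 0`: the projection `π₀K(X_m,X_1) → π₀gr¹ = H¹(X_1, 1+p𝒪_{X_m})
  = ker(Pic X_m → Pic X_1)` is the relative DETERMINANT and is SURJECTIVE (every `L` trivialised on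
  `X_1` is an object: `[L] - [𝒪]`), so `E_∞ = E₂` in weight 1. Weight 1 is realised by line bundles;
  this is the whole content of [Deg] in dimension `≤ 3`.
 (E4) (2_K) `KernelTowerSurjective` for `d ≤ 3`: `π₀K(X_{n+2},X_1) → π₀K(X_{n+1},X_1)` is filtered
  with `E_∞`-pieces = `E₂`-pieces modulo incoming differentials (E1, E3); the `E₂`-maps are surjective
  (E2); surjectivity passes to the `E_∞` quotients and then through the extensions
  (`surjective_of_surjective_sub_quot`, §9). No Adams operations, no ordinarity, no `k = k̄`.
 (E5) (1_K) `IntegralCompatibleLift` for `d ≤ 3`: `G_∞ := π₋₁ lim_m K(X_m,X_1) = lim_m π₋₁K(X_m,X_1)`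
  (`lim¹ π₀ = 0`: finite-length pieces, Mittag-Leffler) is an extension of `H²(𝒳,𝒪)` by `H³(𝒳,Ω¹)`
  (E1–E3), both torsion-free, hence TORSION-FREE (`noTorsion_of_extension`); the boundary
  `ob : K₀(X_1) → G_∞` is a homomorphism; `RationalProLift` gives an INTEGRAL `η ∈ lim K₀(X_m)` and
  `M ≥ 1` with `η|X_1 = M[E₁] + τ`, `τ` torsion (the tree's `ContinuousKZeroRat = ℚ ⊗ LimKZero`); so
  `M·ob[E₁] = -ob(τ)` is torsion, `ob[E₁] = 0` (`ob_eq_zero_of_rational_lift`), `[E₁]` lifts to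
  `π₀ lim K(X_m) ↠ lim K₀(X_m)`. (BEK Thm 36(1), arXiv:1203.2776 p.14, is the same argument at the
  level of cohomological Chow groups; it is not even needed here.)
 (E6) P1a(`d ≤ 3`) = `crux_of_oneK_twoK` (§4) + (E4) + (E5). INPUTS: (F1) = DGM (relative `K` ≃
  relative `TC`, integral, nilpotent) + BMS2 Thm 1.12 (motivic filtration on `TC`, `gr^i = ℤ_p(i)[2i]`)
  + AMMN Thm F(2) (`ℤ_p(i)(𝒪/p^m) ≃ fib(φ/pⁱ - 1 : Fil^i_m → Ω•_𝒳̂)`, `i ≤ d + 1 ≤ p - 7`) + Zariski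
  descent + the identification of the weight-1 projection with `det` (BMS2 §7,
  `ℤ_p(1) ≃ RΓ(𝔾_m)^∧_p[-1]`); (F2) = torsion-free Hodge cohomology (typed; for `d = 3` the missing
  `H^b(Ω²), H^b(Ω³)` follow by Grothendieck duality from `H^{4-b}(Ω¹), H^{4-b}(𝒪)`) + HdR
  degeneration of `𝒳/W` (free `E₁`, degenerate over `K`); Berthelot–Ogus is not needed separately.
  Not in print as such: only the ASSEMBLY (F1). `d ≤ 2`: cycle 1 (determinant + Pic Bockstein).
 (E7) `d ≥ 4` (`Ω¹` free): new non-zero targets (`π₋₁gr³ ∋ H⁴(X_{m-1},Ω²)`, `π₋₁gr² ∋ H⁴(X_{2m-2},𝒪)`)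
  and sources (`π₀gr²` = `K₂`-symbol / non-Milnor-`K₃` classes, NOT object-realised a priori), so a
  differential `π₀gr² → π₋₁gr³` is not excluded by (E3): here [Deg] is real. On ABELIAN schemes
  `[-1]^* = (-1)^{b+j}` on `H^b(Ω^j)` gives opposite parities on source (odd) and target (even), so
  `2·d = 0`, `d = 0` (`p` odd) — cards isogeny-weight-parity / isogeny-eigenweight-splitting, whose
  algebra is `eq_zero_of_weights` (§8); generalized eigenvalues suffice (the `E₂`-pieces are
  EXTENSIONS of Hodge groups, on which `[-1]^*` is only `∓1`-unipotent: `parity_vanishing` of the card,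
  `(T+1)^e`, `(T-1)^e` coprime for `p` odd). TORSORS: `𝒳` a non-trivial torsor under an abelian scheme
  `𝒜` (possible only for `k` perfect, infinite, not algebraically closed; for `k` finite or `k̄`
  Lang/Hensel give a `W`-point and `𝒳 ≅ 𝒜`) has no `[N]^*`, but a finite separable `k'/k` trivialises
  it, the `E₂`-terms (`H^b(𝒳,Ω^j)/p^c`) inject into their base change to `W(k')` (faithfully flat) and
  the differentials are natural, so `d = 0` upstairs forces `d = 0`: the torsor edge is CLOSED on paper
  as well (modulo the same (F1) naturality in `𝒳`).

(F) THE BOUND `d + 6 < p` is where exotic classes are kept out: AKN (arXiv:2204.03420, §3.4, read)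
compute `K₄(ℤ/9) ≅ ℤ/3`, i.e. `H²(ℤ₃(3)(ℤ/9)) ≠ 0` — an EVEN `K`-class of a point in syntomic weight
`i = p`, outside AMMN's range `i ≤ p - 2`; the crux only meets weights `i ≤ d + 1 ≤ p - 6`. A variant
of P1a without the bound would have to survive such classes in `H^{2i-2}(X_1, 𝒦_{2i-2})`; no cheap
witness (needs `d ≥ 2p - 2`).

(H) [Deg]/(A3) IS IN PRINT (read this cycle): Bouis, *Motivic cohomology of mixed characteristic schemes*,
arXiv:2412.06635, Prop. 4.3 (p. 22 of the materialised text): "for every `m ≥ 2`, every qcqs derived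
`ℤ[1/m]`-scheme `X` and every prime `p` there exists a natural multiplicative automorphism `ψ^m` of the
filtered spectrum `Fil_BMS TC(X; ℤ_p)` such that the induced automorphism on the `i`-th graded piece
`ℤ_p(i)^{BMS}(X)[2i]` is multiplication by `m^i`" — INTEGRAL (only `m` is inverted, on the scheme; take
`m` a primitive root mod `p`, invertible on every `X_n`), with Cor. 4.7 / Constr. 4.9 for `Fil_mot TC`
and `Fil_mot K`, and Prop. 3.29 = filtered DGM (cartesian square `Fil_mot K ⇄ Fil_mot TC` along
nilpotent surjections, formal from his Def. of `Fil_mot K`). Hence the relative motivic spectral sequence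
of `K(X_m, X_1) ≃ TC(X_m, X_1)` carries `ψ^m = m^i` on `E₂`, naturally in `𝒳` and compatibly with
`∂` and restrictions, and `exists_primitiveRoot_weights` + `isCoprime_weightDiff` +
`eq_zero_of_weights_of_torsion` (§8) kill EVERY differential `d_r`, `0 < r < p - 1`, and split the
filtrations canonically: the line card's "bet" (it cites Bouis Thm 3, the RATIONAL statement for `K`)
is settled by Prop. 4.3 (the INTEGRAL statement for `TC`, which is all the relative terms need). So
[Deg] holds for ALL `d` with `d + 1 < p - 1` — in particular for the line's stubs 2–3 as stated (all
Hodge-torsion-free `𝒳`, `d + 6 < p`), and (E) is a second, Adams-free proof for `d ≤ 3`.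

(G) WHERE IT COULD STILL BREAK (honest residue): (i) a level-wise failure of the assembly (F1)/(H) —
implausible (three published theorems, and every calibration checks: `Spec W` vs Angeltveit/AKN,
weight 1 vs `Pic`, weight 2 vs BEK Thm 54 `U¹K₂^M(𝒪_{X_n}) ≅ pΩ¹/p²d𝒪`, `K₂(ℤ/pⁿ) = 0`);
(ii) nothing else: the torsor edge of (E7) closes by faithfully flat base change. In particular the
superspecial-`E³` kernel-tower test proposed in cycle 1 is PREDICTED SURJECTIVE by (D)/(E4) and is no
longer a target; the only remaining way to falsify P1a is to falsify a published theorem inside (F1).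

## Cycle-1 content (kept verbatim in §§1–5)
`crux_iff`; the REDUCTION `liftsFormally_of_integralStepClassLifting` ((⋆) + integral step class
lifting ⇒ `LiftsFormally`, any `𝒳`); `crux_of_integralStepClassLiftingConjecture`; `crux_of_oneK_twoK`
((1_K) `IntegralCompatibleLift` ∧ (2_K) `KernelTowerSurjective` ⇒ crux); `rechoice_needs_kernelTower`
(toy); load-bearing hypotheses as `CruxWithout*` predicates — (⋆) necessary (`L ⊕ L⁻¹` on `E × E`,
`ob L ≠ 0`), rational pro-class necessary (graph of a non-lifting endomorphism), `H²(𝒪)[p] = 0`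
necessary (Godeaux–Serre, ledger negative of rattack-1498-0); `not_cruxWithoutStar` sorried near-miss
(no `E × E / W(k)` in Mathlib). Hypotheses NOT used by the paper proof (E) for `d ≤ 3` (information
for the prover): projectivity (properness suffices for finiteness, duality and the limits), and the
bound beyond `p ≥ d + 3` (AMMN F(2) needs `i ≤ p - 2` for the weights `i ≤ d + 1`; `p` odd for `log`).

## Planner / prover notes (information, not a verdict)
* SUGGESTED SPLIT (cycle 1, still apt): (1_K) `RationalProLift → IntegralCompatibleLift` and (2_K)
  `KernelTowerSurjective 𝒳` as typed items; P1a = `crux_of_oneK_twoK` + both. Cycle 2 adds: both are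
  consequences of ONE typed-able statement "`π₋₁`/`π₀` of the relative `K`-theory of `(X_m, X_1)` are
  the extensions (E2)" — i.e. the carrier that is missing is relative `K`-theory with its weight
  filtration, not obstruction theory of modules.
* `VectorBundleConverse` (§6) is a small definition-level debt worth filing (Stacks 01C6 (2) ⟸
  locally free + finite type on a scheme); with it `LiftsFormally ⇒ OneStepClassLift ⇒ …` run formally.
* The informal engine P1b (semiregular ⇒ (⋆)) is untouched by all of this; P1a's truth makes P1b
  the route's real crux.

## Line `syntomic-staircase` (skeleton registered 2026-08-16T00:53Z, after this seat's payload;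
## pre-attack of its three stubs — no formal targets yet, `payload.targets = []`)
* `stub_hodgeTorsionFree`: TRUE (theorem in print: Grothendieck duality over `W`; carriers honest —
  `hodgeSheaf = ⋀ᵃ Ω¹` is a genuine sheafified exterior power). Not attackable.
* `stub_kernelClassesLift` (= (2_K)) and `stub_proImageSaturated` (= saturation form of (1_K)): TRUE for
  `d ≤ 3` by (E4)/(E5) above WITHOUT the line's open module (A3), and on abelian schemes by parity.
  Both stubs DROP the crux's disjunction `d ≤ 3 ∨ Ω¹ free` and assert (A3) for EVERY Hodge-torsion-free
  `𝒳` with `d + 6 < p` (e.g. general fourfolds with `h^{1,2} ≠ 0 ≠ h^{2,0}`, where `d₁ : π₀gr² → π₋₁gr³`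
  has non-zero source and target and neither (E3) nor `[-1]`-parity applies) — this looked like a
  needless exposure until (H): Bouis Prop. 4.3 supplies the integral pure-weight Adams action on
  `Fil_BMS TC`, so the stubs as stated are covered in print too. Saturation for `N` prime to `p` in
  stub 3 is harmless (relative `K` is `p`-primary of finite exponent, BEK Prop 43, + Mittag-Leffler).
* This seat will attack the stubs formally (`-- Targets`) when re-armed with them; expected outcome:
  none breaks (they are theorems on paper: (E)/(H)).

## Landed under `Theorems/FormalLiftingFromClassLifting/Negative/` (importable by ideators / planners / the lead)
* `OneStepClassLift.lean` (p73471, cycle 2): the one-step kill criterion, `not_formalLiftingFromClassLifting_of_oneStepWitness`.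
* `ProClassCorrectionStubs.lean` (p74978, cycle 3): (T1) level-`0` instances of S1–S3; (T2)
  `exists_lift_all_levels_of_stubs`, `not_pSaturation_or_not_primeToPLifting_of_oneStepWitness`; (T3)
  `pSaturation_independent_toy`, `levelwiseLifts_not_compatible_toy` — all `def`-free, stub conclusions verbatim.
* `VectorBundleConverse.lean` (p78223, cycle 4; first filing p77817 bounced on a farm outage only): `isFiniteLocallyFree_of_isVectorBundle` (Stacks 01C6 converse,
  any scheme), `finite_of_epi_free`, `end_unit_mul_comm`, `end_unit_id_ne_zero`, and the UNCONDITIONAL kill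
  criterion `not_formalLiftingFromClassLifting_of_oneStepWitness'` (+ `exists_oneStepClassLift_of_liftsFormally`).
* `ObstructionTowerDecoration.lean` (p77942 ACCEPTED, cycle 4): (T5) `obstructionTower_schema_refuted`,
  `obstructionTower_decoration`.
* `CompatibleLiftNecessity.lean` (p82721 SUBMITTED async, cycle 5; verdict pending at cycle end — the farm olean of
  `Negative.VectorBundleConverse` was stale all session): `exists_compatibleLift_of_liftsFormally`,
  `exists_limKZero_of_compatibleLift`, `exists_limKZero_of_liftsFormally`,
  `exists_rationalProLift_of_compatibleLift`, `exists_rationalProLift_of_liftsFormally`,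
  `not_exists_compatibleLift_of_not_liftsToLevel`, `exists_compatible_step`,
  `exists_compatibleLift_of_kernelTower_of_lifts_all_levels`, `not_kernelTower_of_levelwise_incompatible`,
  `exists_compatibleLift_of_formalLiftingFromClassLifting`, `not_formalLiftingFromClassLifting_of_incompatibleWitness`
  — all `def`-free, hypotheses of the crux / (⋆) / (2_K) verbatim.

## Targets
Cycle 3: `payload.targets = []`, but the lead has PICKED `pro-class-correction-syntomic`; its stubs S1–S3
are pre-attacked in §10 (verdict: none breaks; formal by-products (T1)–(T4)). No stuck stubs yet
(`lead_cycles = 0`). Prediction for the lead: S1/S2 will stall on CARRIERS (relative `K`-theory / `TC` /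
syntomic complexes of the thickenings are absent from Mathlib and the tree), not on truth; S3 needs
Thomason–Trobaugh `K₀(Vect) = π₀K^B` + nil-invariance of `K_{≤0}` + `p`-primality of relative `K` — also
carriers. None of the three is a candidate for a `stub-false` note.
-/

set_option linter.dupNamespace false

namespace Summit.HodgeConjecture.HodgeConjecture.Cruxes.FormalLiftingFromClassLifting.Disproof

open CategoryTheory AlgebraicGeometry Limits
open Literature.AlgebraicGeometry
open Literature.AlgebraicGeometry.Motives Literature.AlgebraicGeometry.Motives.WittScheme
open Summit.HodgeConjecture.HodgeConjecture.Theses.PadicSemiregularLift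

noncomputable section

/-! ## 1. The hypotheses of the crux as named predicates -/

section Predicates

variable {p : ℕ} [Fact p.Prime] {k : Type} [Field k] [CharP k p]
  (𝒳 : SchemeOver (WittVector p k))

/-- Hypothesis (⋆) CLASS-LIFTS-IMPLY-OBJECT-LIFTS of the crux, verbatim, as a predicate on
`(𝒳, E₁)`: for every `n` and every finite locally free `F` on `X_{n+1}` restricting to `E₁` on
`X_k`, if `[F] ∈ K₀(X_{n+1})` is the restriction of a class on `X_{n+2}` then `F` is the
restriction of a finite locally free module on `X_{n+2}`. -/
def ClassLiftsImplyObjectLifts (E₁ : (specialFibre 𝒳).left.Modules) : Prop :=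
  ∀ (n : ℕ) (F : (thickening 𝒳 (n + 1)).left.Modules) (hF : IsFiniteLocallyFree F),
    Nonempty ((Scheme.Modules.pullback (specialFibreToThickening 𝒳 n)).obj F ≅ E₁) →
    (∃ y : KTheory.KZero (thickening 𝒳 (n + 2)).left,
      KTheory.KZero.map (thickeningMap 𝒳 (Nat.le_succ (n + 1))) y = KTheory.KZero.of F hF) →
    ∃ F' : (thickening 𝒳 (n + 2)).left.Modules, IsFiniteLocallyFree F' ∧
      Nonempty ((Scheme.Modules.pullback (thickeningMap 𝒳 (Nat.le_succ (n + 1)))).obj F' ≅ F)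

/-- INTEGRAL STEP CLASS LIFTING for `(𝒳, E₁)`: every finite-level finite locally free lift `F` of
`E₁` (to any `X_{n+1}`) has its INTEGRAL class in the image of `K₀(X_{n+2}) → K₀(X_{n+1})`. This
is the premise of (⋆) asserted unconditionally; it packages the two open ingredients of P1a
((1_K) integral continuous-`K₀` lifting from the rational pro-class + torsion-free Hodge
cohomology; (2_K) surjectivity of the kernel tower `ker(K₀(X_{m+1}) → K₀(X_1)) →
ker(K₀(X_m) → K₀(X_1))`, cf. `rechoice_of_kernelTower_surjective`). -/
def IntegralStepClassLifting (E₁ : (specialFibre 𝒳).left.Modules) : Prop :=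
  ∀ (n : ℕ) (F : (thickening 𝒳 (n + 1)).left.Modules) (hF : IsFiniteLocallyFree F),
    Nonempty ((Scheme.Modules.pullback (specialFibreToThickening 𝒳 n)).obj F ≅ E₁) →
    ∃ y : KTheory.KZero (thickening 𝒳 (n + 2)).left,
      KTheory.KZero.map (thickeningMap 𝒳 (Nat.le_succ (n + 1))) y = KTheory.KZero.of F hF

/-- The rational pro-class hypothesis of the crux (conclusion (b) of Bloch–Esnault–Kerz Thm 1.3),
verbatim: some `ξ ∈ (lim_n K₀(X_n)) ⊗ ℚ` restricts to `[E₁] ⊗ 1 ∈ K₀(X_k) ⊗ ℚ`. -/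
def RationalProLift (E₁ : (specialFibre 𝒳).left.Modules) (hE₁ : IsFiniteLocallyFree E₁) : Prop :=
  ∃ ξ : KTheory.ContinuousKZeroRat (Ideal.span {(p : WittVector p k)}) 𝒳,
    KTheory.KZeroRat.map (Crystalline.specialFibreToTower 𝒳)
      (KTheory.ContinuousKZeroRat.specialFibre (Ideal.span {(p : WittVector p k)}) 𝒳 ξ) =
      KTheory.KZeroRat.of E₁ hE₁

/-- The torsion-freeness hypothesis of the crux, verbatim: `H^b(𝒳, 𝒪)` and `H^b(𝒳, Ω¹_{𝒳/W})` have
no `p`-torsion for all `b`, and `d ≤ 3 ∨ Ω¹_{𝒳/W} ≅ 𝒪^d`. -/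
def HodgeTorsionFree (d : ℕ) : Prop :=
  (∀ (b : ℕ) (x : structureSheafCohomology 𝒳.left b), (p : ℤ) • x = 0 → x = 0) ∧
  (∀ (b : ℕ) (x : hodgeCohomologyOne 𝒳 b), (p : ℤ) • x = 0 → x = 0) ∧
  (d ≤ 3 ∨ Nonempty (cotangentSheaf 𝒳 ≅ SheafOfModules.free (R := 𝒳.left.ringCatSheaf) (Fin d)))

end Predicates

/-- The crux, restructured over the named predicates (a definitional rearrangement; this is the
form attacked below). -/
theorem crux_iff :
    FormalLiftingFromClassLifting ↔
      ∀ (p : ℕ) [Fact p.Prime] (k : Type) [Field k] [CharP k p] [PerfectRing k p] (d : ℕ)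
        (𝒳 : SchemeOver (WittVector p k)), IsSmoothProperModel d 𝒳 →
        Crystalline.IsProjectiveOverRing 𝒳 → d + 6 < p → HodgeTorsionFree 𝒳 d →
        ∀ (E₁ : (specialFibre 𝒳).left.Modules) (hE₁ : IsFiniteLocallyFree E₁),
          ClassLiftsImplyObjectLifts 𝒳 E₁ → RationalProLift 𝒳 E₁ hE₁ → LiftsFormally 𝒳 E₁ := by
  constructor
  · intro h p _ k _ _ _ d 𝒳 h₁ h₂ h₃ h₄ E₁ hE₁ hs hr
    exact h p k d 𝒳 h₁ h₂ h₃ h₄.1 h₄.2.1 h₄.2.2 E₁ hE₁ hs hr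
  · intro h p _ k _ _ _ d 𝒳 h₁ h₂ h₃ h₄ h₅ h₆ E₁ hE₁ hs hr
    exact h p k d 𝒳 h₁ h₂ h₃ ⟨h₄, h₅, h₆⟩ E₁ hE₁ hs hr

/-! ## 2. The algebraic skeleton of the re-choice step (abstract inverse systems) -/

section KernelTower

variable {A : ℕ → Type*} [∀ n, AddCommGroup (A n)] (r : ∀ n, A (n + 1) →+ A n)

/-- Iterated restriction `A n → A 0` along the tower `r`. -/
def restr : ∀ n, A n →+ A 0
  | 0 => AddMonoidHom.id (A 0)
  | n + 1 => (restr n).comp (r n)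

@[simp] theorem restr_zero (x : A 0) : restr r 0 x = x := rfl

@[simp] theorem restr_succ (n : ℕ) (x : A (n + 1)) : restr r (n + 1) x = restr r n (r n x) := rfl

/-- A compatible family restricts, at every level, to its level-`0` component. -/
theorem restr_compatible (x : ∀ n, A n) (hx : ∀ n, r n (x (n + 1)) = x n) (n : ℕ) :
    restr r n (x n) = x 0 := by
  induction n with
  | zero => rfl
  | succ n ih => rw [restr_succ, hx n, ih]

/-- **Re-choice from kernel-tower surjectivity** (the skeleton of ingredient (2_K)): if a
compatible family `x` exists and the kernel tower `ker(A (n+1) → A 0) → ker(A n → A 0)` is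
surjective at level `n`, then EVERY `z ∈ A n` with the same level-`0` restriction as `x` lifts to
`A (n+1)` (indeed to an element with the same level-`0` restriction). In P1a: `A n = K₀(X_{n+1})`,
`x` = an integral compatible lift of `[E₁]` (ingredient (1_K)), `z = [F]` for an arbitrary lift
`F` of `E₁`; the conclusion is the premise of (⋆). -/
theorem rechoice_of_kernelTower_surjective (x : ∀ n, A n) (hx : ∀ n, r n (x (n + 1)) = x n)
    (n : ℕ) (hsurj : ∀ t : A n, restr r n t = 0 → ∃ t' : A (n + 1), restr r (n + 1) t' = 0 ∧ r n t' = t)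
    (z : A n) (hz : restr r n z = x 0) :
    ∃ w : A (n + 1), restr r (n + 1) w = x 0 ∧ r n w = z := by
  obtain ⟨t', ht'0, ht'⟩ := hsurj (z - x n) (by rw [map_sub, hz, restr_compatible r x hx n, sub_self])
  refine ⟨x (n + 1) + t', ?_, ?_⟩
  · rw [map_add, ht'0, add_zero, restr_compatible r x hx (n + 1)]
  · rw [map_add, ht', hx n, add_sub_cancel]

/-- Conversely the kernel-tower hypothesis cannot be dropped from the skeleton: a two-level toy
tower (`A 0 = ℤ`, `A 1 = ℤ × ℤ`, `A (n+2) = ℤ`, with `A 2 → A 1` the diagonal and `A 1 → A 0` the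
first projection) has a compatible family through `(0,0)` while `z = (0,1) ∈ A 1` restricts to
`0 = x 0` but is not in the image of `A 2`. (Recorded as the statement that the conclusion of
`rechoice_of_kernelTower_surjective` fails for SOME tower without `hsurj`; the toy model is spelt
out in the proof.) -/
theorem rechoice_needs_kernelTower :
    ∃ (A : ℕ → Type) (_ : ∀ n, AddCommGroup (A n)) (r : ∀ n, A (n + 1) →+ A n) (x : ∀ n, A n),
      (∀ n, r n (x (n + 1)) = x n) ∧
      ∃ (n : ℕ) (z : A n), restr r n z = x 0 ∧ ¬ ∃ w : A (n + 1), r n w = z := by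
  let A : ℕ → Type := fun n => match n with
    | 0 => ℤ
    | 1 => ℤ × ℤ
    | _ + 2 => ℤ
  let inst : ∀ n, AddCommGroup (A n) := fun n => match n with
    | 0 => inferInstanceAs (AddCommGroup ℤ)
    | 1 => inferInstanceAs (AddCommGroup (ℤ × ℤ))
    | _ + 2 => inferInstanceAs (AddCommGroup ℤ)
  let r : ∀ n, A (n + 1) →+ A n := fun n => match n with
    | 0 => (AddMonoidHom.fst ℤ ℤ : ℤ × ℤ →+ ℤ)
    | 1 => ((AddMonoidHom.id ℤ).prod (AddMonoidHom.id ℤ) : ℤ →+ ℤ × ℤ)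
    | _ + 2 => AddMonoidHom.id ℤ
  refine ⟨A, inst, r, fun _ => 0, fun n => by simp, 1, ((0, 1) : ℤ × ℤ), rfl, ?_⟩
  rintro ⟨w, hw⟩
  have h1 : (r 1 w).1 = w := rfl
  have h2 : (r 1 w).2 = w := rfl
  rw [hw] at h1 h2
  exact zero_ne_one (h1.trans h2.symm)

end KernelTower

/-! ## 3. The reduction: (⋆) + integral step class lifting ⇒ `LiftsFormally` (PROVED) -/

section Reduction

variable {p : ℕ} [Fact p.Prime] {k : Type} [Field k] [CharP k p]

/-- `(W_{n+1} → k) ∘ (W_{n+2} → W_{n+1}) = (W_{n+2} → k)`: the residue maps of the Witt tower are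
compatible with the transition maps. -/
theorem wittQuotToResidue_comp_factor (n : ℕ) :
    (wittQuotToResidue p k n).comp
        (Ideal.Quotient.factor (Ideal.pow_le_pow_right (Nat.le_succ (n + 1)))) =
      wittQuotToResidue p k (n + 1) := by
  refine Ideal.Quotient.ringHom_ext ?_
  rw [RingHom.comp_assoc, Ideal.Quotient.factor_comp_mk]
  exact (wittQuotToResidue_comp_algebraMap p k n).trans
    (wittQuotToResidue_comp_algebraMap p k (n + 1)).symm

variable (𝒳 : SchemeOver (WittVector p k))

/-- `X_k ⟶ X_{n+2}` factors as `X_k ⟶ X_{n+1} ⟶ X_{n+2}` (the closed immersions of the special fibre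
into the thickenings are compatible with the transition maps). -/
@[reassoc]
theorem specialFibreToThickening_comp_thickeningMap (n : ℕ) :
    specialFibreToThickening 𝒳 n ≫ thickeningMap 𝒳 (Nat.le_succ (n + 1)) =
      specialFibreToThickening 𝒳 (n + 1) := by
  -- `erw`: the objects `(specialFibre 𝒳).left`, `(thickening 𝒳 m).left` are only definitionally
  -- the pullbacks, so plain `rw`/`simp` motives fail at instances transparency.
  refine pullback.hom_ext ?_ ?_
  · unfold specialFibreToThickening thickeningMap
    erw [Category.assoc, pullback.lift_fst, pullback.lift_fst_assoc, pullback.lift_fst]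
    simp
  · unfold specialFibreToThickening thickeningMap
    erw [Category.assoc, pullback.lift_snd, pullback.lift_snd_assoc, pullback.lift_snd]
    erw [Category.assoc, ← Spec.map_comp, ← CommRingCat.ofHom_comp, wittQuotToResidue_comp_factor]
    rfl

/-! ### 3a. Ingredients (1_K) and (2_K) as precise statements, and (1_K) ∧ (2_K) ⇒ integral step
class lifting (PROVED) -/

/-- **(1_K) INTEGRAL COMPATIBLE CLASS LIFT**: an INTEGRAL compatible family
`x_n ∈ K₀(X_{n+1})` whose bottom member restricts to `[E₁] ∈ K₀(X_k)` — Bloch–Esnault–Kerz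
Thm 1.3 (b) with `(lim_n K₀(X_n)) ⊗ ℚ` replaced by `lim_n K₀(X_n)` (in print only at the level of
the cohomological Chow groups: Thm 36(1) + Rem 35(2), integral under Hodge-torsion-freeness; the
`K₀`-level comparison Thm 48 is `⊗ ℚ`). -/
def IntegralCompatibleLift (E₁ : (specialFibre 𝒳).left.Modules) (hE₁ : IsFiniteLocallyFree E₁) :
    Prop :=
  ∃ x : ∀ n : ℕ, KTheory.KZero (thickening 𝒳 (n + 1)).left,
    (∀ n, KTheory.KZero.map (thickeningMap 𝒳 (Nat.le_succ (n + 1))) (x (n + 1)) = x n) ∧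
    KTheory.KZero.map (specialFibreToThickening 𝒳 0) (x 0) = KTheory.KZero.of E₁ hE₁

/-- **(2_K) KERNEL-TOWER SURJECTIVITY** (a property of `𝒳` alone): every class on `X_{n+1}` that
dies on `X_k` is the restriction of a class on `X_{n+2}` that dies on `X_k`; i.e. the transition
maps of the pro-system `ker(K₀(X_m) → K₀(X_k))` are surjective. Paper status: true for `d ≤ 2`
(pieces `H¹(X_1, 1 + p𝒪_{X_m})` — Pic Bockstein — and `H²(X_1, π₂)` with `H³ = 0`); for `d ≥ 3` its
motivic analogue holds by the staircase-complex argument (module docstring, item 2); the `K₀`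
statement is open. A Hodge-torsion-free `𝒳` violating it does NOT yet refute the crux (one still
needs an `E₁` with (⋆)), but it is the natural first target of a disproof. -/
def KernelTowerSurjective : Prop :=
  ∀ (n : ℕ) (t : KTheory.KZero (thickening 𝒳 (n + 1)).left),
    KTheory.KZero.map (specialFibreToThickening 𝒳 n) t = 0 →
    ∃ t' : KTheory.KZero (thickening 𝒳 (n + 2)).left,
      KTheory.KZero.map (specialFibreToThickening 𝒳 (n + 1)) t' = 0 ∧
      KTheory.KZero.map (thickeningMap 𝒳 (Nat.le_succ (n + 1))) t' = t

variable {𝒳} in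
/-- A compatible family restricts on `X_k` to the restriction of its bottom member. -/
theorem map_specialFibreToThickening_of_compatible
    (x : ∀ n : ℕ, KTheory.KZero (thickening 𝒳 (n + 1)).left)
    (hx : ∀ n, KTheory.KZero.map (thickeningMap 𝒳 (Nat.le_succ (n + 1))) (x (n + 1)) = x n)
    (n : ℕ) :
    KTheory.KZero.map (specialFibreToThickening 𝒳 n) (x n) =
      KTheory.KZero.map (specialFibreToThickening 𝒳 0) (x 0) := by
  induction n with
  | zero => rfl
  | succ n ih =>
    rw [← specialFibreToThickening_comp_thickeningMap, KTheory.KZero.map_comp_apply, hx n, ih]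

variable {𝒳} in
/-- **(1_K) ∧ (2_K) ⇒ INTEGRAL STEP CLASS LIFTING** (the concrete form of
`rechoice_of_kernelTower_surjective` on the `K₀`-tower of `𝒳`): given an integral compatible lift
of `[E₁]` and kernel-tower surjectivity, EVERY finite locally free lift `F` of `E₁` to any
`X_{n+1}` has `[F] ∈ im(K₀(X_{n+2}) → K₀(X_{n+1}))`. Hence (with
`liftsFormally_of_integralStepClassLifting`) the crux is implied by "(hypotheses) ⇒ (1_K) ∧ (2_K)"
(`crux_of_oneK_twoK`). -/
theorem integralStepClassLifting_of_compatibleLift_of_kernelTowerSurjective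
    {E₁ : (specialFibre 𝒳).left.Modules} (hE₁ : IsFiniteLocallyFree E₁)
    (h₁ : IntegralCompatibleLift 𝒳 E₁ hE₁) (h₂ : KernelTowerSurjective 𝒳) :
    IntegralStepClassLifting 𝒳 E₁ := by
  obtain ⟨x, hx, hx0⟩ := h₁
  rintro n F hF ⟨i⟩
  have hF0 : KTheory.KZero.map (specialFibreToThickening 𝒳 n) (KTheory.KZero.of F hF) =
      KTheory.KZero.of E₁ hE₁ := by
    rw [KTheory.KZero.map_of]
    exact KTheory.KZero.of_iso i _ _
  obtain ⟨t', -, ht'⟩ := h₂ n (KTheory.KZero.of F hF - x n) (by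
    rw [map_sub, hF0, map_specialFibreToThickening_of_compatible x hx n, hx0, sub_self])
  exact ⟨x (n + 1) + t', by rw [map_add, hx n, ht', add_sub_cancel]⟩

variable [PerfectRing k p]

/-- For `k` perfect, `W(k)/p → k` is bijective (`ker (W(k) → k) = (p)`, Mathlib
`WittVector.ker_constantCoeff`), so the residue map of level one is an isomorphism. -/
theorem bijective_wittQuotToResidue_zero : Function.Bijective (wittQuotToResidue p k 0) := by
  constructor
  · unfold wittQuotToResidue
    refine RingHom.lift_injective_of_ker_le_ideal _ _ ?_
    rw [WittVector.ker_constantCoeff, zero_add, pow_one]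
  · unfold wittQuotToResidue
    exact Ideal.Quotient.lift_surjective_of_surjective _ _ (WittVector.constantCoeff_surjective p)

/-- `Spec k → Spec (W(k)/p)` is an isomorphism for `k` perfect. -/
theorem isIso_spec_map_wittQuotToResidue_zero :
    IsIso (Spec.map (CommRingCat.ofHom (wittQuotToResidue p k 0))) := by
  have e : CommRingCat.ofHom (wittQuotToResidue p k 0) =
      (RingEquiv.ofBijective (wittQuotToResidue p k 0)
        (bijective_wittQuotToResidue_zero (p := p) (k := k))).toCommRingCatIso.hom := rfl
  rw [e]; infer_instance

/-- **`X_k ⟶ X_1 = 𝒳 ⊗ W/p` is an isomorphism** for `k` perfect (base change of the ring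
isomorphism `W(k)/p ≅ k`). This is the only place where perfectness of `k` enters the reduction. -/
instance isIso_specialFibreToThickening_zero : IsIso (specialFibreToThickening 𝒳 0) := by
  have := isIso_spec_map_wittQuotToResidue_zero (p := p) (k := k)
  unfold specialFibreToThickening
  apply pullback.map_isIso

variable {𝒳}

/-- A STAGE of the formal tower: a finite locally free lift of `E₁` to `X_{n+1}`. -/
structure Stage (E₁ : (specialFibre 𝒳).left.Modules) (n : ℕ) where
  /-- the lift on `X_{n+1}` -/
  F : (thickening 𝒳 (n + 1)).left.Modules
  flf : IsFiniteLocallyFree F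
  res : Nonempty ((Scheme.Modules.pullback (specialFibreToThickening 𝒳 n)).obj F ≅ E₁)

/-- Stage `0`: transport `E₁` along the isomorphism `X_k ≅ X_1`. -/
def stageZero (E₁ : (specialFibre 𝒳).left.Modules) (hE₁ : IsFiniteLocallyFree E₁) : Stage E₁ 0 :=
  let e := asIso (specialFibreToThickening 𝒳 0)
  { F := (Scheme.Modules.pullback e.inv).obj E₁
    flf := hE₁.pullback e.inv
    res := ⟨(Scheme.Modules.pullbackComp e.hom e.inv).app E₁ ≪≫
        eqToIso (congrArg (fun f => (Scheme.Modules.pullback f).obj E₁) e.hom_inv_id) ≪≫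
        (Scheme.Modules.pullbackId _).app E₁⟩ }

variable {E₁ : (specialFibre 𝒳).left.Modules}

omit [PerfectRing k p] in
/-- The existential used to climb one level: from a stage at level `n`, (⋆) and integral step
class lifting give a finite locally free module on `X_{n+2}` restricting to the stage. -/
theorem exists_next (hstar : ClassLiftsImplyObjectLifts 𝒳 E₁)
    (hint : IntegralStepClassLifting 𝒳 E₁) {n : ℕ} (S : Stage E₁ n) :
    ∃ F' : (thickening 𝒳 (n + 2)).left.Modules, IsFiniteLocallyFree F' ∧
      Nonempty ((Scheme.Modules.pullback (thickeningMap 𝒳 (Nat.le_succ (n + 1)))).obj F' ≅ S.F) :=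
  hstar n S.F S.flf S.res (hint n S.F S.flf S.res)

/-- One step up the tower (a choice). -/
def stageSucc (hstar : ClassLiftsImplyObjectLifts 𝒳 E₁) (hint : IntegralStepClassLifting 𝒳 E₁)
    {n : ℕ} (S : Stage E₁ n) : Stage E₁ (n + 1) where
  F := Classical.choose (exists_next hstar hint S)
  flf := (Classical.choose_spec (exists_next hstar hint S)).1
  res := by
    obtain ⟨i⟩ := (Classical.choose_spec (exists_next hstar hint S)).2
    obtain ⟨j⟩ := S.res
    refine ⟨?_ ≪≫ j⟩
    refine eqToIso (congrArg (fun f => (Scheme.Modules.pullback f).obj _)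
        (specialFibreToThickening_comp_thickeningMap 𝒳 n).symm) ≪≫ ?_
    exact ((Scheme.Modules.pullbackComp (specialFibreToThickening 𝒳 n)
        (thickeningMap 𝒳 (Nat.le_succ (n + 1)))).app _).symm ≪≫
      (Scheme.Modules.pullback (specialFibreToThickening 𝒳 n)).mapIso i

omit [PerfectRing k p] in
/-- The chosen step restricts to the previous stage. -/
theorem stageSucc_res (hstar : ClassLiftsImplyObjectLifts 𝒳 E₁)
    (hint : IntegralStepClassLifting 𝒳 E₁) {n : ℕ} (S : Stage E₁ n) :
    Nonempty ((Scheme.Modules.pullback (thickeningMap 𝒳 (Nat.le_succ (n + 1)))).obj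
      (stageSucc hstar hint S).F ≅ S.F) :=
  (Classical.choose_spec (exists_next hstar hint S)).2

/-- The whole tower, by recursion from stage `0`. -/
def tower (hstar : ClassLiftsImplyObjectLifts 𝒳 E₁) (hint : IntegralStepClassLifting 𝒳 E₁)
    (S₀ : Stage E₁ 0) : ∀ n : ℕ, Stage E₁ n
  | 0 => S₀
  | n + 1 => stageSucc hstar hint (tower hstar hint S₀ n)

/-- **REDUCTION THEOREM.** On ANY `W(k)`-scheme `𝒳` (`k` perfect of characteristic `p`), a finite
locally free `E₁` on the special fibre satisfying (⋆) and INTEGRAL STEP CLASS LIFTING lifts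
formally. No smoothness, properness, projectivity, bound on `p` or torsion-freeness is used: all of
those hypotheses of the crux can only serve to establish `IntegralStepClassLifting`. -/
theorem liftsFormally_of_integralStepClassLifting (hE₁ : IsFiniteLocallyFree E₁)
    (hstar : ClassLiftsImplyObjectLifts 𝒳 E₁) (hint : IntegralStepClassLifting 𝒳 E₁) :
    LiftsFormally 𝒳 E₁ :=
  ⟨fun n => (tower hstar hint (stageZero E₁ hE₁) n).F,
    fun n => (tower hstar hint (stageZero E₁ hE₁) n).flf.isVectorBundle,
    fun n => stageSucc_res hstar hint (tower hstar hint (stageZero E₁ hE₁) n),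
    (stageZero E₁ hE₁).res⟩

end Reduction

/-! ## 4. The isolated conjecture and the crux as its corollary -/

/-- **THE LOAD-BEARING CONJECTURE OF P1a**: under the hypotheses of the crux, integral step class
lifting holds. Paper status (this cycle): TRUE for `d ≤ 2` (determinant + Pic Bockstein +
Berthelot–Ogus 3.8); for `d ≥ 3` its MOTIVIC analogue (BEK cohomological Chow groups of the
thickenings) is true by the staircase-complex argument of the module docstring, and the `K₀`-level
statement is open, hinging on a level-wise integral form of Bloch–Esnault–Kerz's Claim 49 /
Thm 48. A counterexample here at a level where (⋆) is vacuous refutes the crux. -/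
def IntegralStepClassLiftingConjecture : Prop :=
  ∀ (p : ℕ) [Fact p.Prime] (k : Type) [Field k] [CharP k p] [PerfectRing k p] (d : ℕ)
    (𝒳 : SchemeOver (WittVector p k)), IsSmoothProperModel d 𝒳 →
    Crystalline.IsProjectiveOverRing 𝒳 → d + 6 < p → HodgeTorsionFree 𝒳 d →
    ∀ (E₁ : (specialFibre 𝒳).left.Modules) (hE₁ : IsFiniteLocallyFree E₁),
      ClassLiftsImplyObjectLifts 𝒳 E₁ → RationalProLift 𝒳 E₁ hE₁ → IntegralStepClassLifting 𝒳 E₁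

/-- **The crux follows from `IntegralStepClassLiftingConjecture`** (and the proved reduction). -/
theorem crux_of_integralStepClassLiftingConjecture (H : IntegralStepClassLiftingConjecture) :
    FormalLiftingFromClassLifting :=
  crux_iff.mpr fun p _ k _ _ _ d 𝒳 h₁ h₂ h₃ h₄ E₁ hE₁ hs hr =>
    liftsFormally_of_integralStepClassLifting hE₁ hs (H p k d 𝒳 h₁ h₂ h₃ h₄ E₁ hE₁ hs hr)

/-- **The crux follows from (1_K) ∧ (2_K) under its hypotheses** — the sharpest sufficient
condition isolated this cycle; both conjuncts are statements about INTEGRAL `K₀` of the finite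
thickenings only (no objects, no (⋆), no ℚ). -/
theorem crux_of_oneK_twoK
    (H : ∀ (p : ℕ) [Fact p.Prime] (k : Type) [Field k] [CharP k p] [PerfectRing k p] (d : ℕ)
      (𝒳 : SchemeOver (WittVector p k)), IsSmoothProperModel d 𝒳 →
      Crystalline.IsProjectiveOverRing 𝒳 → d + 6 < p → HodgeTorsionFree 𝒳 d →
      ∀ (E₁ : (specialFibre 𝒳).left.Modules) (hE₁ : IsFiniteLocallyFree E₁),
        RationalProLift 𝒳 E₁ hE₁ → IntegralCompatibleLift 𝒳 E₁ hE₁ ∧ KernelTowerSurjective 𝒳) :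
    FormalLiftingFromClassLifting :=
  crux_of_integralStepClassLiftingConjecture fun p _ k _ _ _ d 𝒳 h₁ h₂ h₃ h₄ E₁ hE₁ _ hr =>
    integralStepClassLifting_of_compatibleLift_of_kernelTowerSurjective hE₁
      (H p k d 𝒳 h₁ h₂ h₃ h₄ E₁ hE₁ hr).1 (H p k d 𝒳 h₁ h₂ h₃ h₄ E₁ hE₁ hr).2

/-! ## 5. Load-bearing hypotheses: the crux with one hypothesis dropped -/

/-- The crux WITHOUT (⋆). FALSE on paper (module docstring: `E₁ = L ⊕ L⁻¹` on `E × E / W(𝔽̄_p)`,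
`p ≥ 11`, with `ob(L) ≠ 0`; Hodge condition holds on a surface, BEK Thm 1.3 gives `ξ`, `E₁` does
not lift to `X₂`). Not refutable in Lean at this pin: no positive-dimensional smooth projective
`W(k)`-scheme with a computed `Pic` exists in Mathlib, and Bloch–Esnault–Kerz Thm 1.3 is only the
predicate `Crystalline.BlochEsnaultKerzLifting C` on a hypothesis structure. -/
def CruxWithoutStar : Prop :=
  ∀ (p : ℕ) [Fact p.Prime] (k : Type) [Field k] [CharP k p] [PerfectRing k p] (d : ℕ)
    (𝒳 : SchemeOver (WittVector p k)), IsSmoothProperModel d 𝒳 →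
    Crystalline.IsProjectiveOverRing 𝒳 → d + 6 < p → HodgeTorsionFree 𝒳 d →
    ∀ (E₁ : (specialFibre 𝒳).left.Modules) (hE₁ : IsFiniteLocallyFree E₁),
      RationalProLift 𝒳 E₁ hE₁ → LiftsFormally 𝒳 E₁

/-- The crux WITHOUT the rational pro-class hypothesis. FALSE on paper: any line bundle `L` on
`X_k` with `c₁^cris(L) ∉ F¹H²_dR(X_K)` (graph class of a non-lifting endomorphism on `E × E`)
satisfies (⋆) (rank one: determinant, item `LineBundleStepLifting`) and does not lift to `X₂`.
Same Lean obstruction as `CruxWithoutStar`. -/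
def CruxWithoutRationalProLift : Prop :=
  ∀ (p : ℕ) [Fact p.Prime] (k : Type) [Field k] [CharP k p] [PerfectRing k p] (d : ℕ)
    (𝒳 : SchemeOver (WittVector p k)), IsSmoothProperModel d 𝒳 →
    Crystalline.IsProjectiveOverRing 𝒳 → d + 6 < p → HodgeTorsionFree 𝒳 d →
    ∀ (E₁ : (specialFibre 𝒳).left.Modules) (_ : IsFiniteLocallyFree E₁),
      ClassLiftsImplyObjectLifts 𝒳 E₁ → LiftsFormally 𝒳 E₁

/-- The crux WITHOUT `p`-torsion-freeness of `H^b(𝒳, 𝒪)`. FALSE on paper in rank one: the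
Godeaux–Serre witness of refuter rattack-1498-0 (`H²(𝒳,𝒪)[p] ≠ 0`, `L₁^p` lifts, `L₁` does not lift
to `X₂`; Berthelot–Ogus 1983 Thm 3.8 / Cor 3.11, Bloch–Esnault–Kerz Rem 35(2)), which refuted the
first filing `PadicSemiregularLifting` (stmt-HodgeConjecture-1498, ledger negatives). -/
def CruxWithoutTorsionFreeO : Prop :=
  ∀ (p : ℕ) [Fact p.Prime] (k : Type) [Field k] [CharP k p] [PerfectRing k p] (d : ℕ)
    (𝒳 : SchemeOver (WittVector p k)), IsSmoothProperModel d 𝒳 →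
    Crystalline.IsProjectiveOverRing 𝒳 → d + 6 < p →
    (∀ (b : ℕ) (x : hodgeCohomologyOne 𝒳 b), (p : ℤ) • x = 0 → x = 0) →
    (d ≤ 3 ∨ Nonempty (cotangentSheaf 𝒳 ≅ SheafOfModules.free (R := 𝒳.left.ringCatSheaf) (Fin d))) →
    ∀ (E₁ : (specialFibre 𝒳).left.Modules) (hE₁ : IsFiniteLocallyFree E₁),
      ClassLiftsImplyObjectLifts 𝒳 E₁ → RationalProLift 𝒳 E₁ hE₁ → LiftsFormally 𝒳 E₁

/-- Each dropped-hypothesis variant trivially implies the crux (so a proof of the crux "not using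
H" would prove the variant, which is false on paper: any proof must use (⋆), the pro-class and
`H²(𝒳,𝒪)[p] = 0`). -/
theorem crux_of_cruxWithoutStar (h : CruxWithoutStar) : FormalLiftingFromClassLifting :=
  crux_iff.mpr fun p _ k _ _ _ d 𝒳 h₁ h₂ h₃ h₄ E₁ hE₁ _ hr => h p k d 𝒳 h₁ h₂ h₃ h₄ E₁ hE₁ hr

theorem crux_of_cruxWithoutRationalProLift (h : CruxWithoutRationalProLift) :
    FormalLiftingFromClassLifting :=
  crux_iff.mpr fun p _ k _ _ _ d 𝒳 h₁ h₂ h₃ h₄ E₁ hE₁ hs _ => h p k d 𝒳 h₁ h₂ h₃ h₄ E₁ hE₁ hs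

theorem crux_of_cruxWithoutTorsionFreeO (h : CruxWithoutTorsionFreeO) :
    FormalLiftingFromClassLifting :=
  crux_iff.mpr fun p _ k _ _ _ d 𝒳 h₁ h₂ h₃ h₄ E₁ hE₁ hs hr =>
    h p k d 𝒳 h₁ h₂ h₃ h₄.2.1 h₄.2.2 E₁ hE₁ hs hr

/-- NEAR-MISS (paper theorem, Lean-unreachable): `¬ CruxWithoutStar`. Witness: `k = 𝔽̄_p`, `p ≥ 11`,
`𝒳 = E ×_W E` for a lift `E/W` of a supersingular elliptic curve with `End(E ⊗ W₂) = ℤ`,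
`L ∈ Pic(E_k × E_k)` the class of the graph of an `α ∈ End(E_k) ∖ ℤ` (corrected by fibres to have
`ob(L) ≠ 0`), `E₁ = L ⊕ L⁻¹`. OBSTRUCTION to closing in Lean: (i) no construction of `E × E` over
`W(k)` with its deformation theory in Mathlib; (ii) BEK Thm 1.3 is not a theorem of the tree but the
predicate `BlochEsnaultKerzLifting C`. Tried: nothing formal is possible; recorded for ideators. -/
theorem not_cruxWithoutStar : ¬ CruxWithoutStar := by
  sorry

/-! ## 6. The cheapest kill criterion, formally: ONE-STEP CLASS LIFTING is necessary -/

section OneStep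

variable {p : ℕ} [Fact p.Prime] {k : Type} [Field k] [CharP k p]

/-- `(W_{m+1} → k) ∘ (W_{n+1} → W_{m+1}) = (W_{n+1} → k)` for `m + 1 ≤ n + 1`. -/
theorem wittQuotToResidue_comp_factor_of_le {m n : ℕ} (h : m + 1 ≤ n + 1) :
    (wittQuotToResidue p k m).comp (Ideal.Quotient.factor (Ideal.pow_le_pow_right h)) =
      wittQuotToResidue p k n := by
  refine Ideal.Quotient.ringHom_ext ?_
  rw [RingHom.comp_assoc, Ideal.Quotient.factor_comp_mk]
  exact (wittQuotToResidue_comp_algebraMap p k m).trans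
    (wittQuotToResidue_comp_algebraMap p k n).symm

variable (𝒳 : SchemeOver (WittVector p k))

/-- `X_k ⟶ X_{m+1} ⟶ X_{n+1}` is `X_k ⟶ X_{n+1}` for `m + 1 ≤ n + 1` (general form of
`specialFibreToThickening_comp_thickeningMap`). -/
@[reassoc]
theorem specialFibreToThickening_comp_thickeningMap_of_le {m n : ℕ} (h : m + 1 ≤ n + 1) :
    specialFibreToThickening 𝒳 m ≫ thickeningMap 𝒳 h = specialFibreToThickening 𝒳 n := by
  refine pullback.hom_ext ?_ ?_
  · unfold specialFibreToThickening thickeningMap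
    erw [Category.assoc, pullback.lift_fst, pullback.lift_fst_assoc, pullback.lift_fst]
    simp
  · unfold specialFibreToThickening thickeningMap
    erw [Category.assoc, pullback.lift_snd, pullback.lift_snd_assoc, pullback.lift_snd]
    erw [Category.assoc, ← Spec.map_comp, ← CommRingCat.ofHom_comp,
      wittQuotToResidue_comp_factor_of_le h]
    rfl

/-- ONE-STEP CLASS LIFTING for `(𝒳, E₁)`: the integral class `[E₁] ∈ K₀(X_k)` is the restriction
of a class on the first non-trivial thickening `X_2 = 𝒳 ⊗ W/p²` (along `X_k ⟶ X_2`). -/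
def OneStepClassLift (E₁ : (specialFibre 𝒳).left.Modules) (hE₁ : IsFiniteLocallyFree E₁) : Prop :=
  ∃ y : KTheory.KZero (thickening 𝒳 2).left,
    KTheory.KZero.map (specialFibreToThickening 𝒳 1) y = KTheory.KZero.of E₁ hE₁

variable {𝒳}

/-- **If `[E₁]` does not lift to `K₀(X_2)`, hypothesis (⋆) holds VACUOUSLY** (at level `0` the
premise of (⋆) is a one-step class lift; at level `n + 1 ≥ 1` already the existence of a finite
locally free lift `F` of `E₁` to `X_{n+2}` gives the class `[F|X_2]`). -/
theorem classLiftsImplyObjectLifts_of_not_oneStepClassLift {E₁ : (specialFibre 𝒳).left.Modules}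
    (hE₁ : IsFiniteLocallyFree E₁) (h : ¬ OneStepClassLift 𝒳 E₁ hE₁) :
    ClassLiftsImplyObjectLifts 𝒳 E₁ := by
  intro n F hF hi hy
  obtain ⟨i⟩ := hi
  exfalso
  apply h
  cases n with
  | zero =>
    obtain ⟨y, hy⟩ := hy
    refine ⟨y, ?_⟩
    rw [← specialFibreToThickening_comp_thickeningMap 𝒳 0, KTheory.KZero.map_comp_apply, hy,
      KTheory.KZero.map_of]
    exact KTheory.KZero.of_iso i _ _
  | succ n =>
    refine ⟨KTheory.KZero.map (thickeningMap 𝒳 (show 1 + 1 ≤ n + 1 + 1 by omega))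
      (KTheory.KZero.of F hF), ?_⟩
    rw [← KTheory.KZero.map_comp_apply, specialFibreToThickening_comp_thickeningMap_of_le,
      KTheory.KZero.map_of]
    exact KTheory.KZero.of_iso i _ _

/-- A formal lift restricts to a VECTOR-BUNDLE lift of `E₁` on `X_2` (`LiftsToThickening 𝒳 E₁ 1`). -/
theorem liftsToThickening_one_of_liftsFormally {E₁ : (specialFibre 𝒳).left.Modules}
    (hL : LiftsFormally 𝒳 E₁) : LiftsToThickening 𝒳 E₁ 1 := by
  obtain ⟨E, hvb, htr, ⟨j⟩⟩ := hL
  obtain ⟨i⟩ := htr 0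
  refine ⟨E 1, hvb 1, ⟨?_ ≪≫ j⟩⟩
  refine eqToIso (congrArg (fun f => (Scheme.Modules.pullback f).obj _)
      (specialFibreToThickening_comp_thickeningMap 𝒳 0).symm) ≪≫ ?_
  exact ((Scheme.Modules.pullbackComp (specialFibreToThickening 𝒳 0)
      (thickeningMap 𝒳 (Nat.le_succ (0 + 1)))).app _).symm ≪≫
    (Scheme.Modules.pullback (specialFibreToThickening 𝒳 0)).mapIso i

variable [PerfectRing k p]

/-- **The crux forces `LiftsFormally` on every `E₁` whose class does NOT lift one step** (under its
hypotheses and the rational pro-class hypothesis): (⋆) is then vacuous. Read contrapositively this is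
the cheapest kill criterion (no (⋆), no semiregularity, no objects above `X_k`): ONE finite locally
free `E₁` on a Hodge-torsion-free `𝒳` (`d + 6 < p`, `d ≤ 3 ∨ Ω¹` free) with `[E₁] ⊗ 1` rationally
pro-liftable but `[E₁] ∉ im(K₀(X_2) → K₀(X_k))` makes the crux assert that `E₁` — which does not even
lift to `X_2` as a class — lifts formally. -/
theorem liftsFormally_of_crux_of_not_oneStepClassLift (hcrux : FormalLiftingFromClassLifting)
    {d : ℕ} (h₁ : IsSmoothProperModel d 𝒳) (h₂ : Crystalline.IsProjectiveOverRing 𝒳)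
    (h₃ : d + 6 < p) (h₄ : HodgeTorsionFree 𝒳 d) {E₁ : (specialFibre 𝒳).left.Modules}
    (hE₁ : IsFiniteLocallyFree E₁) (hr : RationalProLift 𝒳 E₁ hE₁)
    (h : ¬ OneStepClassLift 𝒳 E₁ hE₁) : LiftsFormally 𝒳 E₁ :=
  crux_iff.mp hcrux p k d 𝒳 h₁ h₂ h₃ h₄ E₁ hE₁
    (classLiftsImplyObjectLifts_of_not_oneStepClassLift hE₁ h) hr

/-- The folklore converse "vector bundle (Mathlib: locally free and of finite type) ⇒ finite locally
free (Stacks 01C6 (2))", which the tree does not yet prove (it has only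
`IsFiniteLocallyFree.isVectorBundle`); needed to take the `K₀`-class of the members of a
`LiftsFormally` family. Stated for `Scheme.{0}`, the universe of the crux. -/
def VectorBundleConverse : Prop :=
  ∀ (X : Scheme.{0}) (E : X.Modules), IsVectorBundle E → IsFiniteLocallyFree E

omit [PerfectRing k p] in
/-- Modulo the folklore converse, a formal lift gives a one-step class lift. -/
theorem oneStepClassLift_of_liftsFormally (hconv : VectorBundleConverse)
    {E₁ : (specialFibre 𝒳).left.Modules} (hE₁ : IsFiniteLocallyFree E₁)
    (hL : LiftsFormally 𝒳 E₁) : OneStepClassLift 𝒳 E₁ hE₁ := by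
  obtain ⟨E, hE, ⟨i⟩⟩ := liftsToThickening_one_of_liftsFormally hL
  refine ⟨KTheory.KZero.of E (hconv _ E hE), ?_⟩
  rw [KTheory.KZero.map_of]
  exact KTheory.KZero.of_iso i _ _

/-- **ONE-STEP CLASS LIFTING IS NECESSARY FOR THE CRUX** (modulo `VectorBundleConverse`): under the
hypotheses of the crux, every finite locally free `E₁` with a rational pro-lift of its class has
`[E₁] ∈ im(K₀(X_2) → K₀(X_k))` — a (⋆)-free, object-free consequence ("BEK rational pro-liftability
⇒ INTEGRAL liftability of the class to `𝒳 ⊗ W/p²`"). Paper status: TRUE if the one-step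
`K`-theoretic obstruction `K₀(X_1) → π₋₁K(X_2, X_1) ≅ {H²(X_1,𝒪), H³(X_1,Ω¹), H⁴(X_2,𝒪), H⁴(X_1,Ω²), …}`
is the reduction of the integral Hodge components of `ch^cris(E₁)` (module docstring, cycle 2). -/
theorem oneStepClassLift_of_crux (hconv : VectorBundleConverse) (hcrux : FormalLiftingFromClassLifting)
    {d : ℕ} (h₁ : IsSmoothProperModel d 𝒳) (h₂ : Crystalline.IsProjectiveOverRing 𝒳)
    (h₃ : d + 6 < p) (h₄ : HodgeTorsionFree 𝒳 d) {E₁ : (specialFibre 𝒳).left.Modules}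
    (hE₁ : IsFiniteLocallyFree E₁) (hr : RationalProLift 𝒳 E₁ hE₁) : OneStepClassLift 𝒳 E₁ hE₁ := by
  by_contra h
  exact h (oneStepClassLift_of_liftsFormally hconv hE₁
    (liftsFormally_of_crux_of_not_oneStepClassLift hcrux h₁ h₂ h₃ h₄ hE₁ hr h))

end OneStep

/-- **KILL CRITERION (formal).** A single one-step witness refutes the crux, modulo the folklore
converse `VectorBundleConverse`. -/
theorem not_crux_of_oneStepWitness (hconv : VectorBundleConverse)
    (w : ∃ (p : ℕ) (_ : Fact p.Prime) (k : Type) (_ : Field k) (_ : CharP k p) (_ : PerfectRing k p)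
      (d : ℕ) (𝒳 : SchemeOver (WittVector p k)),
      IsSmoothProperModel d 𝒳 ∧ Crystalline.IsProjectiveOverRing 𝒳 ∧ d + 6 < p ∧
      HodgeTorsionFree 𝒳 d ∧
      ∃ (E₁ : (specialFibre 𝒳).left.Modules) (hE₁ : IsFiniteLocallyFree E₁),
        RationalProLift 𝒳 E₁ hE₁ ∧ ¬ OneStepClassLift 𝒳 E₁ hE₁) :
    ¬ FormalLiftingFromClassLifting := by
  obtain ⟨p, _, k, _, _, _, d, 𝒳, h₁, h₂, h₃, h₄, E₁, hE₁, hr, h⟩ := w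
  exact fun hcrux => h (oneStepClassLift_of_crux hconv hcrux h₁ h₂ h₃ h₄ hE₁ hr)

/-! ## 7. The conclusion is honest: algebraizable `E₁` lift formally (no hypothesis on `𝒳`) -/

section Algebraizable

variable {p : ℕ} [Fact p.Prime] {k : Type} [Field k] [CharP k p] {𝒳 : SchemeOver (WittVector p k)}

/-- **Restrictions of finite locally free modules on `𝒳` lift formally**, on ANY `W(k)`-scheme:
`E_n := E|X_{n+1}`. So a counterexample `E₁` to the crux is necessarily NOT (the restriction of) an
algebraic vector bundle — and by P3a `FormalVectorBundlesAlgebraize` (Grothendieck existence)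
`LiftsFormally` is equivalent to algebraic liftability on a smooth proper model. In particular the
free modules `𝒪^r_{X_k}` (`= 𝒪^r_𝒳|X_k` up to `nonempty_pullbackFreeIso`) satisfy the conclusion
for every `𝒳`: all hypotheses of the crux are decoration there. -/
theorem liftsFormally_of_flfLift {E₁ : (specialFibre 𝒳).left.Modules}
    (h : ∃ E : 𝒳.left.Modules, IsFiniteLocallyFree E ∧ Nonempty (restrictSpecial 𝒳 E ≅ E₁)) :
    LiftsFormally 𝒳 E₁ := by
  obtain ⟨E, hE, ⟨i⟩⟩ := h
  refine ⟨fun n => (Scheme.Modules.pullback (thickeningι 𝒳 (n + 1))).obj E,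
    fun n => (hE.pullback _).isVectorBundle, fun n => ⟨?_⟩, ⟨?_⟩⟩
  · exact (Scheme.Modules.pullbackComp (thickeningMap 𝒳 (Nat.le_succ (n + 1)))
        (thickeningι 𝒳 (n + 1 + 1))).app E ≪≫
      eqToIso (congrArg (fun f => (Scheme.Modules.pullback f).obj E)
        (thickeningMap_ι 𝒳 (Nat.le_succ (n + 1))))
  · exact (Scheme.Modules.pullbackComp (specialFibreToThickening 𝒳 0) (thickeningι 𝒳 1)).app E ≪≫
      eqToIso (congrArg (fun f => (Scheme.Modules.pullback f).obj E)
        (specialFibreToThickening_ι 𝒳 0)) ≪≫ i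

/-- The free modules lift formally, on every `𝒳`. -/
theorem liftsFormally_free (I : Type) [Finite I] :
    LiftsFormally 𝒳 (SheafOfModules.free (R := (specialFibre 𝒳).left.ringCatSheaf) I) :=
  liftsFormally_of_flfLift ⟨SheafOfModules.free I, KTheory.KZero.isFiniteLocallyFree_free I,
    KTheory.nonempty_pullbackFreeIso (specialFibreι 𝒳) I⟩

end Algebraizable

/-! ## 8. [Deg] — what the staircase/lattice computation does NOT give (toy tightness), and the
Adams-weight escape -/

section Deg

/-- **`E₂`-SURJECTIVITY IS NOT SURJECTIVITY** (tightness of the re-choice skeleton one level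
deeper than `rechoice_needs_kernelTower`). Dictionary: `M₀ → M₁` = the `d₁`-differential
`π₀ gr¹ → π₋₁ gr²` of the relative motivic filtration on `K(X_{n+2}, X_1)`, `N₀ → N₁` the same for
`K(X_{n+1}, X_1)`, `f` the restriction. The lattice lemma (F2 of the round-1 triage) gives
surjectivity of `f` on every graded piece (`f₀`, `f₁` below are even bijective / surjective), but the
map that matters for (2_K) is the one on `π₀ = ker d` (`E_∞`), and a non-zero weight-crossing `d₁`
in the SOURCE alone destroys it: here `H⁰(M) = 0 → H⁰(N) = ℤ`. So any proof of (2_K) from the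
graded computation must also show `d₁ = 0` ([Deg]); `eq_zero_of_weights` is the standard way. -/
theorem eTwoSurjective_not_sufficient :
    ∃ (M₀ M₁ N₀ N₁ : Type) (_ : AddCommGroup M₀) (_ : AddCommGroup M₁) (_ : AddCommGroup N₀)
      (_ : AddCommGroup N₁) (dM : M₀ →+ M₁) (dN : N₀ →+ N₁) (f₀ : M₀ →+ N₀) (f₁ : M₁ →+ N₁),
      f₁.comp dM = dN.comp f₀ ∧ Function.Bijective f₀ ∧ Function.Surjective f₁ ∧
      ¬ ∀ y : N₀, dN y = 0 → ∃ x : M₀, dM x = 0 ∧ f₀ x = y := by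
  refine ⟨ℤ, ℤ, ℤ, PUnit, inferInstance, inferInstance, inferInstance, inferInstance,
    AddMonoidHom.id ℤ, 0, AddMonoidHom.id ℤ, 0, ?_, Function.bijective_id, ?_, ?_⟩
  · exact AddMonoidHom.ext fun _ => Subsingleton.elim _ _
  · exact fun y => ⟨0, Subsingleton.elim _ _⟩
  · intro h
    obtain ⟨x, hx, hx1⟩ := h 1 (Subsingleton.elim _ _)
    have h0 : x = 0 := hx
    have h1 : x = 1 := hx1
    omega

/-- Two coprime annihilators kill an element. -/
theorem eq_zero_of_smul_eq_zero_of_isCoprime {B : Type*} [AddCommGroup B] {a b : ℤ}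
    (hab : IsCoprime a b) (y : B) (ha : a • y = 0) (hb : b • y = 0) : y = 0 := by
  obtain ⟨u, v, huv⟩ := hab
  have : (u * a + v * b) • y = 0 := by rw [add_smul, mul_smul, mul_smul, ha, hb, smul_zero, smul_zero, add_zero]
  rwa [huv, one_smul] at this

/-- **THE ADAMS-WEIGHT ESCAPE FROM [Deg]** (the algebra only): an additive map `d` that multiplies
an operator acting as the scalar `c` on the source into the scalar `c'` on the target vanishes as
soon as `c' - c` acts injectively on the target. With `d = d₁ : π₀gr^i → π₋₁gr^{i+1}`, `ψ = ψ^k`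
(`c = kⁱ`, `c' = k^{i+1}`) and a `p`-power-torsion target, this needs only `p ∤ kⁱ(k - 1)`, e.g.
`k = 2` for `p` odd (`eq_zero_of_weights_of_torsion`): so [Deg] follows from the EXISTENCE of
Adams operations on the relative `K`-theory of the thickenings compatible with the motivic
filtration and of pure weight on its graded pieces — the one input of the prover lines not in print. -/
theorem eq_zero_of_weights {A B : Type*} [AddCommGroup A] [AddCommGroup B] (d : A →+ B)
    (c c' : ℤ) (hd : ∀ x, d (c • x) = c' • d x) (hinj : ∀ y : B, (c' - c) • y = 0 → y = 0) :
    d = 0 := by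
  ext x
  refine hinj (d x) ?_
  rw [sub_smul, ← hd, map_zsmul, sub_self]

/-- The `p`-power-torsion form used in [Deg]: weights `kⁱ ≠ kʲ` with `p ∤ kʲ - kⁱ`. -/
theorem eq_zero_of_weights_of_torsion {A B : Type*} [AddCommGroup A] [AddCommGroup B] (d : A →+ B)
    (p : ℕ) (c c' : ℤ) (hd : ∀ x, d (c • x) = c' • d x) (htors : ∀ y : B, ∃ n : ℕ, (p : ℤ) ^ n • y = 0)
    (hcop : IsCoprime (c' - c) (p : ℤ)) : d = 0 := by
  refine eq_zero_of_weights d c c' hd fun y hy => ?_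
  obtain ⟨n, hn⟩ := htors y
  exact eq_zero_of_smul_eq_zero_of_isCoprime (IsCoprime.pow_right hcop) y hy hn

/-- Numerical instance for the threefold case of [Deg] (`d₁ : π₀gr¹ → π₋₁gr²`, `ψ²`, `p` odd):
`2² - 2 = 2` is coprime to every odd prime. -/
theorem weights_one_two_coprime (p : ℕ) (hp : p.Prime) (hodd : p ≠ 2) :
    IsCoprime ((2 : ℤ) ^ 2 - 2) (p : ℤ) := by
  have h2 : (2 : ℤ) ^ 2 - 2 = (2 : ℕ) := by norm_num
  rw [h2, Nat.isCoprime_iff_coprime]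
  exact (Nat.coprime_primes Nat.prime_two hp).mpr (Ne.symm hodd)

/-- If `p ∤ m` and `p ∤ m ^ r - 1` then the weight difference `m^(i+r) - m^i = m^i (m^r - 1)` is coprime
to `p` (the hypothesis `hcop` of `eq_zero_of_weights_of_torsion` for `ψ^m`, weights `i → i + r`). -/
theorem isCoprime_weightDiff {p : ℕ} (hp : p.Prime) {m : ℤ} (hm : ¬ (p : ℤ) ∣ m) {r : ℕ}
    (hr : ¬ (p : ℤ) ∣ m ^ r - 1) (i : ℕ) : IsCoprime (m ^ (i + r) - m ^ i) (p : ℤ) := by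
  have hP : Prime (p : ℤ) := Nat.prime_iff_prime_int.mp hp
  have hfac : m ^ (i + r) - m ^ i = m ^ i * (m ^ r - 1) := by ring
  rw [hfac]
  refine IsCoprime.mul_left ?_ ?_
  · exact ((Irreducible.coprime_iff_not_dvd hP.irreducible).mpr
      (fun h => hm (hP.dvd_of_dvd_pow h))).symm
  · exact ((Irreducible.coprime_iff_not_dvd hP.irreducible).mpr hr).symm

/-- **Primitive roots clear the whole window `0 < r < p - 1`**: for every prime `p` there is an integer
`m` with `p ∤ m` and `p ∤ m^r - 1` for all `0 < r < p - 1`. With Bouis, arXiv:2412.06635 Prop. 4.3 /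
Cor. 4.7 (read: a NATURAL multiplicative automorphism `ψ^m` of `Fil_BMS TC(X; ℤ_p)` for every qcqs
`ℤ[1/m]`-scheme `X`, acting on `gr^i = ℤ_p(i)(X)[2i]` as multiplication by `m^i` — INTEGRALLY) and DGM,
this is the in-print discharge of [Deg] for all weights `≤ d + 1 < p - 1`: every differential
`d_r : π_t gr^i → π_{t-1} gr^{i+r}` of the relative motivic spectral sequence of `K(X_m, X_1) ≃ TC(X_m, X_1)`
with `0 < r < p - 1` vanishes (`eq_zero_of_weights_of_torsion` + `isCoprime_weightDiff`), and the
filtrations on `π₀`, `π₋₁` split canonically into `ψ^m`-eigenspaces. -/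
theorem exists_primitiveRoot_weights (p : ℕ) [Fact p.Prime] :
    ∃ m : ℤ, ¬ (p : ℤ) ∣ m ∧ ∀ r : ℕ, 0 < r → r < p - 1 → ¬ (p : ℤ) ∣ m ^ r - 1 := by
  obtain ⟨g, hg⟩ := IsCyclic.exists_generator (α := (ZMod p)ˣ)
  have horder : orderOf g = p - 1 := by
    rw [orderOf_eq_card_of_forall_mem_zpowers hg, Nat.card_eq_fintype_card, ZMod.card_units]
  refine ⟨((g : ZMod p).val : ℤ), ?_, ?_⟩
  · intro h
    have h0 : ((g : ZMod p).val : ZMod p) = 0 := by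
      have := (ZMod.intCast_zmod_eq_zero_iff_dvd ((g : ZMod p).val : ℤ) p).mpr h
      simp at this
    rw [ZMod.natCast_zmod_val] at h0
    exact (Units.ne_zero g) h0
  · intro r hr0 hrp h
    have hz : ((((g : ZMod p).val : ℤ) ^ r - 1 : ℤ) : ZMod p) = 0 :=
      (ZMod.intCast_zmod_eq_zero_iff_dvd _ p).mpr h
    have hg1 : (g : ZMod p) ^ r = 1 := by
      have : (((g : ZMod p).val : ℤ) : ZMod p) = (g : ZMod p) := by
        rw [Int.cast_natCast, ZMod.natCast_zmod_val]
      rw [Int.cast_sub, Int.cast_pow, this, Int.cast_one, sub_eq_zero] at hz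
      exact hz
    have hu : g ^ r = 1 := by
      ext
      rw [Units.val_pow_eq_pow_val, hg1, Units.val_one]
    have := orderOf_dvd_of_pow_eq_one hu
    rw [horder] at this
    exact absurd (Nat.le_of_dvd hr0 this) (not_le.mpr hrp)

end Deg

/-! ## 9. The algebraic skeleton of the cycle-2 paper proof for `d ≤ 3` (what replaces [Deg]) -/

section Skeleton

/-- **(2_K) passes through extensions** (four lemma, surjectivity half): a homomorphism that is
surjective onto a subgroup `N'` from a subgroup `M'` and surjective modulo `N'` is surjective. In the
paper proof: `M = π₀K(X_{n+2}, X_1)`, `N = π₀K(X_{n+1}, X_1)` with their (finite) weight filtrations,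
the graded surjectivities being the lattice lemma F2; so "extension torsion" in [Deg] is irrelevant
for (2_K). -/
theorem surjective_of_surjective_sub_quot {M N : Type*} [AddCommGroup M] [AddCommGroup N]
    (f : M →+ N) (M' : AddSubgroup M) (N' : AddSubgroup N)
    (hsub : ∀ y ∈ N', ∃ x ∈ M', f x = y) (hquot : ∀ y : N, ∃ x : M, f x - y ∈ N') :
    Function.Surjective f := by
  intro y
  obtain ⟨x, hx⟩ := hquot y
  obtain ⟨x', -, hx'⟩ := hsub (f x - y) hx
  exact ⟨x - x', by rw [map_sub, hx', sub_sub_cancel]⟩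

/-- **(1_K) passes through extensions**: an extension of a group without `n`-torsion by a group
without `n`-torsion has no `n`-torsion. In the paper proof: `G_∞ = π₋₁ lim_m K(X_m, X_1)` is an
extension of `H²(𝒳, 𝒪)` by `H³(𝒳, Ω¹)` (both `p`-torsion-free by hypothesis), so `G_∞` is
torsion-free and `ob_eq_zero_of_rational_lift` applies. -/
theorem noTorsion_of_extension {M : Type*} [AddCommGroup M] (M' : AddSubgroup M) (n : ℤ)
    (hsub : ∀ x ∈ M', n • x = 0 → x = 0) (hquot : ∀ x : M, n • x ∈ M' → x ∈ M') (x : M)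
    (hx : n • x = 0) : x = 0 :=
  hsub x (hquot x (by rw [hx]; exact M'.zero_mem)) hx

/-- **Clearing denominators (triage F3) is legitimate once the obstruction group is torsion-free**:
if `ob` is a homomorphism into a group without `(N * M)`-torsion... precisely: `ob (M • e + τ) = 0`
with `N • τ = 0`, `N * M ≠ 0` acting injectively on the target, forces `ob e = 0`. In the paper
proof: `ob : K₀(X_1) → G_∞` is the boundary of `lim_m K(X_m) → K(X_1)`, `e = [E₁]`, and
`M • [E₁] + τ = η|X_1` for an INTEGRAL pro-class `η` (from `ξ = (1/M) ⊗ η ∈ ℚ ⊗ lim_m K₀(X_m)`,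
the tree's `ContinuousKZeroRat`), `τ` torsion. -/
theorem ob_eq_zero_of_rational_lift {K G : Type*} [AddCommGroup K] [AddCommGroup G] (ob : K →+ G)
    (e τ : K) (M N : ℤ) (hlift : ob (M • e + τ) = 0) (hτ : N • τ = 0)
    (hG : ∀ g : G, (N * M) • g = 0 → g = 0) : ob e = 0 := by
  refine hG (ob e) ?_
  have h1 : M • ob e = -ob τ := by
    rw [map_add, map_zsmul] at hlift
    exact eq_neg_of_add_eq_zero_left hlift
  rw [mul_smul, h1, smul_neg, ← map_zsmul, hτ, map_zero, neg_zero]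

end Skeleton

/-! ## 10. Targets (cycle 3): the stubs S1–S3 of the PICKED line `pro-class-correction-syntomic`

The lead picked `Lines/pro-class-correction-syntomic.lean` (PICKED.md, 2026-08-16T01:23Z): stubs
S1 `stub_kernelTowerSurjective` (= (2_K) `KernelTowerSurjective`, §3), S2 `stub_pSaturation`
(`PSaturated` below), S3 `stub_primeToPLifting` (`PrimeToPDivisible` below), glued by clearing
denominators + `integralStepClassLifting_of_liftsToAllLevels` + the §3 reduction. `payload.targets = []`
at this seat's arming; the stubs are attacked here as written in the skeleton (conclusions restated
VERBATIM as predicates of `𝒳`). VERDICT: none breaks — S1/S2 are theorems on paper in both branches of the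
typed disjunction ((E4)/(E5) for `d ≤ 3`, (E7)+(H) for `Ω¹` free), S3 is a theorem on paper with NO
hypothesis beyond "projective over an Artinian base" (§11 (K)). What is kernel-checked below:
(T1) the level-`0` instances of S1, S2, S3 hold outright (`X_k ≅ X_1`); (T2) the cycle-2 kill criterion
(Negative/OneStepClassLift) and the stubs are ONE target: S2 ∧ S3 at `𝒳` + the rational pro-class force
`[E₁]` to lift to EVERY level (`liftsToAllLevels_of_stubs`), so a one-step witness at `𝒳` is exactly a
counterexample to S2 or to S3 at `𝒳` (`not_pSaturated_or_not_primeToPDivisible_of_oneStepWitness`);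
(T3) toy tightness of the line's architecture: S2 is independent of S1 + "cokernels killed by `p`"
(`pSaturation_independent`), and level-wise lifts at all levels do not give a compatible (pro-)lift
without S1 (`levelwiseLifts_not_compatible`, a `lim¹`/Mittag-Leffler toy); (T4) the crux SPLITS along its
disjunction into `CruxThreefoldMinimal` (only `H²(𝒳,𝒪)[p] = 0` and `H³(𝒳,Ω¹)[p] = 0` — the two groups the
paper proof actually uses for `d ≤ 3`, §11 (M)) and `CruxOmegaFree` (`crux_of_minimal_of_omegaFree`). -/

section Targets

open scoped TensorProduct

variable {p : ℕ} [Fact p.Prime] {k : Type} [Field k] [CharP k p]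
  (𝒳 : SchemeOver (WittVector p k))

/-- `y ∈ K₀(X_k)` lifts to level `n`, i.e. `y ∈ im(K₀(X_{n+1}) → K₀(X_k))` (verbatim the line's
`ProClassCorrectionSyntomic.LiftsToLevel`; `LiftsToLevel 𝒳 [E₁] 1` is §6's `OneStepClassLift`). -/
def LiftsToLevel (y : KTheory.KZero (specialFibre 𝒳).left) (n : ℕ) : Prop :=
  ∃ z : KTheory.KZero (thickening 𝒳 (n + 1)).left,
    KTheory.KZero.map (specialFibreToThickening 𝒳 n) z = y

/-- `y` lifts to every level (no compatibility asked; verbatim the line's `LiftsToAllLevels`). -/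
def LiftsToAllLevels (y : KTheory.KZero (specialFibre 𝒳).left) : Prop :=
  ∀ n : ℕ, LiftsToLevel 𝒳 y n

/-- The conclusion of stub S2 at `𝒳` (verbatim the line's `PSaturated`): `p • y` lifts to every level
⇒ `y` lifts to every level. -/
def PSaturated : Prop :=
  ∀ y : KTheory.KZero (specialFibre 𝒳).left,
    LiftsToAllLevels 𝒳 ((p : ℤ) • y) → LiftsToAllLevels 𝒳 y

/-- The conclusion of stub S3 at `𝒳` (verbatim the line's `PrimeToPDivisible`): level-wise
prime-to-`p` divisibility of the images `im(K₀(X_{n+1}) → K₀(X_k))`. -/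
def PrimeToPDivisible : Prop :=
  ∀ (n M : ℕ), ¬ p ∣ M → ∀ y : KTheory.KZero (specialFibre 𝒳).left,
    LiftsToLevel 𝒳 ((M : ℤ) • y) n → LiftsToLevel 𝒳 y n

variable {𝒳}

theorem LiftsToLevel.neg {y : KTheory.KZero (specialFibre 𝒳).left} {n : ℕ} :
    LiftsToLevel 𝒳 y n → LiftsToLevel 𝒳 (-y) n
  | ⟨z, hz⟩ => ⟨-z, by rw [map_neg, hz]⟩

/-! ### (T0) Saturation arithmetic and clearing denominators (credit: the line's skeleton §§2, 5 —
planner-cruxplan-stmt-HodgeConjecture-13825-pro-class-correction-0 — copied verbatim so that this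
workfile does not import a sorried module) -/

theorem liftsToAllLevels_of_pow_smul (hsat : PSaturated 𝒳)
    {y : KTheory.KZero (specialFibre 𝒳).left} :
    ∀ a : ℕ, LiftsToAllLevels 𝒳 ((p : ℤ) ^ a • y) → LiftsToAllLevels 𝒳 y
  | 0, h => by simpa using h
  | a + 1, h => by
    refine liftsToAllLevels_of_pow_smul hsat a (hsat _ ?_)
    rw [← mul_smul, ← pow_succ']
    exact h

theorem liftsToAllLevels_of_natCast_smul (hsat : PSaturated 𝒳) (hdiv : PrimeToPDivisible 𝒳)
    {N : ℕ} (hN : N ≠ 0) {y : KTheory.KZero (specialFibre 𝒳).left}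
    (h : LiftsToAllLevels 𝒳 ((N : ℤ) • y)) : LiftsToAllLevels 𝒳 y := by
  obtain ⟨a, N', hN', rfl⟩ :=
    Nat.exists_eq_pow_mul_and_not_dvd hN p (Fact.out : p.Prime).one_lt.ne'
  refine liftsToAllLevels_of_pow_smul hsat a fun n => hdiv n N' hN' _ ?_
  have e : ((p ^ a * N' : ℕ) : ℤ) • y = (N' : ℤ) • ((p : ℤ) ^ a • y) := by
    rw [Nat.cast_mul, Nat.cast_pow, mul_comm, mul_smul]
  rw [← e]
  exact h n

/-- Saturation for every nonzero integer multiplier, from S2 ∧ S3 at `𝒳`. -/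
theorem liftsToAllLevels_of_zsmul (hsat : PSaturated 𝒳) (hdiv : PrimeToPDivisible 𝒳)
    {M : ℤ} (hM : M ≠ 0) {y : KTheory.KZero (specialFibre 𝒳).left}
    (h : LiftsToAllLevels 𝒳 (M • y)) : LiftsToAllLevels 𝒳 y := by
  obtain ⟨N, rfl | rfl⟩ := Int.eq_nat_or_neg M
  · exact liftsToAllLevels_of_natCast_smul hsat hdiv (by exact_mod_cast hM) h
  · refine liftsToAllLevels_of_natCast_smul hsat hdiv (N := N) (by simpa using hM) fun n => ?_
    have := (h n).neg
    rwa [neg_smul, neg_neg] at this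

variable (𝒳)

omit [CharP k p] in
/-- Level `n` of the `KTheory` presentation of the `p`-adic tower is `X_{n+1}` (`rfl`). -/
theorem kTheoryThickening_eq (n : ℕ) :
    KTheory.thickening (Ideal.span {(p : WittVector p k)}) 𝒳 n = (thickening 𝒳 (n + 1)).left :=
  rfl

omit [CharP k p] in
/-- The `KTheory` transition `X ⊗ W/p^{n+1} ⟶ X ⊗ W/p^{n+2}` IS the `WittScheme` transition
`X_{n+1} ⟶ X_{n+2}`. -/
theorem thickeningTransition_eq (n : ℕ) :
    KTheory.thickeningTransition (Ideal.span {(p : WittVector p k)}) 𝒳 n =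
      thickeningMap 𝒳 (Nat.le_succ (n + 1)) := by
  refine pullback.hom_ext ?_ ?_
  · unfold KTheory.thickeningTransition KTheory.thickeningι thickeningMap
    erw [pullback.lift_fst]
  · unfold KTheory.thickeningTransition KTheory.thickeningStructureMap KTheory.truncSpecTransition
      thickeningMap
    erw [pullback.lift_snd]

/-- A compatible family of the `KTheory` tower, read on the `WittScheme` tower. -/
def toWitt (η : KTheory.LimKZero (Ideal.span {(p : WittVector p k)}) 𝒳) (n : ℕ) :
    KTheory.KZero (thickening 𝒳 (n + 1)).left :=
  KTheory.LimKZero.proj (Ideal.span {(p : WittVector p k)}) 𝒳 n η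

omit [CharP k p] in
theorem map_thickeningMap_toWitt (η : KTheory.LimKZero (Ideal.span {(p : WittVector p k)}) 𝒳)
    (n : ℕ) :
    KTheory.KZero.map (thickeningMap 𝒳 (Nat.le_succ (n + 1))) (toWitt 𝒳 η (n + 1)) =
      toWitt 𝒳 η n :=
  (congrArg (fun φ : (thickening 𝒳 (n + 1)).left ⟶ (thickening 𝒳 (n + 2)).left =>
      KTheory.KZero.map φ (toWitt 𝒳 η (n + 1))) (thickeningTransition_eq 𝒳 n)).symm.trans
    (KTheory.LimKZero.map_proj_succ (Ideal.span {(p : WittVector p k)}) 𝒳 n η)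

theorem map_specialFibreToThickening_toWitt
    (η : KTheory.LimKZero (Ideal.span {(p : WittVector p k)}) 𝒳) (n : ℕ) :
    KTheory.KZero.map (specialFibreToThickening 𝒳 n) (toWitt 𝒳 η n) =
      KTheory.KZero.map (Crystalline.specialFibreToTower 𝒳)
        (KTheory.LimKZero.proj (Ideal.span {(p : WittVector p k)}) 𝒳 0 η) := by
  induction n with
  | zero => rfl
  | succ n ih =>
    rw [← ih, ← map_thickeningMap_toWitt 𝒳 η n, ← KTheory.KZero.map_comp_apply,
      specialFibreToThickening_comp_thickeningMap]

variable {𝒳}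

/-- **CLEARING DENOMINATORS** (the line's `exists_int_multiple_liftsToAllLevels`, verbatim): from the
rational pro-class, some `M ≠ 0` has `M • [E₁]` lifting INTEGRALLY to every level. -/
theorem exists_int_multiple_liftsToAllLevels {E₁ : (specialFibre 𝒳).left.Modules}
    (hE₁ : IsFiniteLocallyFree E₁) (hξ : RationalProLift 𝒳 E₁ hE₁) :
    ∃ M : ℤ, M ≠ 0 ∧ LiftsToAllLevels 𝒳 (M • KTheory.KZero.of E₁ hE₁) := by
  classical
  obtain ⟨ξ, hξ⟩ := hξ
  obtain ⟨⟨η, c⟩, hc⟩ := IsLocalizedModule.surj (nonZeroDivisors ℤ)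
    (TensorProduct.mk ℤ ℚ (KTheory.LimKZero (Ideal.span {(p : WittVector p k)}) 𝒳) 1) ξ
  have hcq : ((c : ℤ) : ℚ) • ξ = (1 : ℚ) ⊗ₜ[ℤ] η := by
    rw [Int.cast_smul_eq_zsmul ℚ]
    exact hc
  have h1 : TensorProduct.mk ℤ ℚ (KTheory.KZero (specialFibre 𝒳).left) 1
        ((c : ℤ) • KTheory.KZero.of E₁ hE₁) =
      TensorProduct.mk ℤ ℚ (KTheory.KZero (specialFibre 𝒳).left) 1
        (KTheory.KZero.map (Crystalline.specialFibreToTower 𝒳)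
          (KTheory.LimKZero.proj (Ideal.span {(p : WittVector p k)}) 𝒳 0 η)) := by
    have h := congrArg (fun ζ => KTheory.KZeroRat.map (Crystalline.specialFibreToTower 𝒳)
      (KTheory.ContinuousKZeroRat.specialFibre (Ideal.span {(p : WittVector p k)}) 𝒳 ζ)) hcq
    simp only [map_smul] at h
    rw [hξ, KTheory.ContinuousKZeroRat.proj_tmul, KTheory.KZeroRat.map_tmul] at h
    simp only [TensorProduct.mk_apply]
    rw [← h, KTheory.KZeroRat.of, TensorProduct.smul_tmul', smul_eq_mul, mul_one,
      ← Int.smul_one_eq_cast, TensorProduct.smul_tmul]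
  obtain ⟨c', hc'⟩ := IsLocalizedModule.exists_of_eq (S := nonZeroDivisors ℤ)
    (f := TensorProduct.mk ℤ ℚ (KTheory.KZero (specialFibre 𝒳).left) 1) h1
  simp only [Submonoid.smul_def] at hc'
  refine ⟨(c' : ℤ) * (c : ℤ),
    mul_ne_zero (nonZeroDivisors.coe_ne_zero c') (nonZeroDivisors.coe_ne_zero c), fun n => ?_⟩
  refine ⟨(c' : ℤ) • toWitt 𝒳 η n, ?_⟩
  rw [map_zsmul, map_specialFibreToThickening_toWitt, mul_smul]
  exact hc'.symm

/-! ### (T1) Level `0` of S1, S2, S3 is free (`X_k ≅ X_1`, `k` perfect) -/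

section LevelZero

variable [PerfectRing k p] (𝒳)

/-- **Every class lifts to level `0`**: `X_k ⟶ X_1` is an isomorphism (§3). Hence the `n = 0`
instances of S2's and S3's conclusions hold for every `𝒳` and every `y`. -/
theorem liftsToLevel_zero (y : KTheory.KZero (specialFibre 𝒳).left) : LiftsToLevel 𝒳 y 0 :=
  ⟨KTheory.KZero.map (inv (specialFibreToThickening 𝒳 0)) y, by
    rw [← KTheory.KZero.map_comp_apply, IsIso.hom_inv_id, KTheory.KZero.map_id,
      AddMonoidHom.id_apply]⟩

/-- S3 (`stub_primeToPLifting`) at level `n = 0`, for every `𝒳` (no smoothness, properness or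
projectivity): the premise is not even needed. -/
theorem primeToPDivisible_level_zero (M : ℕ) (y : KTheory.KZero (specialFibre 𝒳).left) :
    LiftsToLevel 𝒳 ((M : ℤ) • y) 0 → LiftsToLevel 𝒳 y 0 :=
  fun _ => liftsToLevel_zero 𝒳 y

/-- S1 (`stub_kernelTowerSurjective`) at level `n = 0`, for every `𝒳`: a class on `X_1` dying on
`X_k ≅ X_1` is `0`, and `0` lifts. -/
theorem kernelTowerSurjective_level_zero (t : KTheory.KZero (thickening 𝒳 1).left)
    (ht : KTheory.KZero.map (specialFibreToThickening 𝒳 0) t = 0) :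
    ∃ t' : KTheory.KZero (thickening 𝒳 2).left,
      KTheory.KZero.map (specialFibreToThickening 𝒳 1) t' = 0 ∧
      KTheory.KZero.map (thickeningMap 𝒳 (Nat.le_succ 1)) t' = t := by
  have ht0 : t = 0 := by
    have h := congrArg (KTheory.KZero.map (inv (specialFibreToThickening 𝒳 0))) ht
    rwa [← KTheory.KZero.map_comp_apply, IsIso.inv_hom_id, KTheory.KZero.map_id,
      AddMonoidHom.id_apply, map_zero] at h
  exact ⟨0, by rw [map_zero], by rw [map_zero, ht0]⟩

end LevelZero

/-! ### (T2) The one-step kill criterion and the stubs are one target -/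

/-- **S2 ∧ S3 at `𝒳` force every rationally pro-liftable `[E₁]` to lift INTEGRALLY to every level**
(clearing denominators + saturation; no (⋆), no torsion-freeness used formally — those sit inside
S2). -/
theorem liftsToAllLevels_of_stubs (hsat : PSaturated 𝒳) (hdiv : PrimeToPDivisible 𝒳)
    {E₁ : (specialFibre 𝒳).left.Modules} (hE₁ : IsFiniteLocallyFree E₁)
    (hξ : RationalProLift 𝒳 E₁ hE₁) : LiftsToAllLevels 𝒳 (KTheory.KZero.of E₁ hE₁) := by
  obtain ⟨M, hM, hlift⟩ := exists_int_multiple_liftsToAllLevels hE₁ hξ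
  exact liftsToAllLevels_of_zsmul hsat hdiv hM hlift

/-- In particular S2 ∧ S3 at `𝒳` give §6's `OneStepClassLift` for every such `E₁`. -/
theorem oneStepClassLift_of_stubs (hsat : PSaturated 𝒳) (hdiv : PrimeToPDivisible 𝒳)
    {E₁ : (specialFibre 𝒳).left.Modules} (hE₁ : IsFiniteLocallyFree E₁)
    (hξ : RationalProLift 𝒳 E₁ hE₁) : OneStepClassLift 𝒳 E₁ hE₁ :=
  liftsToAllLevels_of_stubs hsat hdiv hE₁ hξ 1

/-- **DICHOTOMY.** A one-step witness at `𝒳` (the cycle-2 kill criterion `not_crux_of_oneStepWitness`,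
landed as `Theorems/FormalLiftingFromClassLifting/Negative/OneStepClassLift.lean`) is EXACTLY a
counterexample to stub S2 or to stub S3 at that `𝒳`: the disprover's witness hunt and the drefuter's
stub attack are the same search. (On paper neither exists: S3 is Weibel's `p`-primary torsion of the
relative `K`-theory of a nilpotent thickening, S2 is (E5).) -/
theorem not_pSaturated_or_not_primeToPDivisible_of_oneStepWitness
    {E₁ : (specialFibre 𝒳).left.Modules} (hE₁ : IsFiniteLocallyFree E₁)
    (hξ : RationalProLift 𝒳 E₁ hE₁) (h : ¬ OneStepClassLift 𝒳 E₁ hE₁) :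
    ¬ PSaturated 𝒳 ∨ ¬ PrimeToPDivisible 𝒳 := by
  by_contra hc
  rw [not_or, not_not, not_not] at hc
  exact h (oneStepClassLift_of_stubs hc.1 hc.2 hE₁ hξ)

end Targets

/-! ### (T3) Toy tightness of the line's architecture (abstract towers, kernel-checked) -/

section TargetToys

/-- **S2 IS INDEPENDENT OF S1 AND OF "COKERNELS KILLED BY `p`"** (toy tightness of the line's stub
set): there is a tower `A (n+1) → A 0` (dictionary: `A (n+1) = K₀(X_{n+1})`, `A 0 = K₀(X_k)`,
iterated restriction `restr`, §2) whose kernel tower is surjective (S1-shape) and in which `q • y` lifts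
to every level for EVERY `y` (so all cokernels are killed by `q` — S3-shape with the roles of the primes
exchanged — and the hypothesis of S2 holds universally), yet some `y` lifts to no level `≥ 1`:
`A n = ℤ`, bottom map `×q`, identity transitions, `y = 1`. In P1a this is the shape of the
Godeaux–Serre failure (the limit of the obstruction groups, here `ℤ/q`, has torsion): S2 carries exactly
the torsion-freeness of the pro-obstruction group and cannot be recovered from S1 + S3. -/
theorem pSaturation_independent (q : ℤ) (hq : 2 ≤ q) :
    ∃ (A : ℕ → Type) (_ : ∀ n, AddCommGroup (A n)) (r : ∀ n, A (n + 1) →+ A n),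
      (∀ (n : ℕ) (t : A (n + 1)), restr r (n + 1) t = 0 →
        ∃ t' : A (n + 2), restr r (n + 2) t' = 0 ∧ r (n + 1) t' = t) ∧
      (∀ (n : ℕ) (y : A 0), ∃ z : A (n + 1), restr r (n + 1) z = q • y) ∧
      ¬ ∀ y : A 0, (∀ n, ∃ z : A (n + 1), restr r (n + 1) z = q • y) →
        ∀ n, ∃ z : A (n + 1), restr r (n + 1) z = y := by
  let A : ℕ → Type := fun _ => ℤ
  let inst : ∀ n, AddCommGroup (A n) := fun _ => inferInstanceAs (AddCommGroup ℤ)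
  let r : ∀ n, A (n + 1) →+ A n := fun m => match m with
    | 0 => (AddMonoidHom.mulLeft q : ℤ →+ ℤ)
    | _ + 1 => AddMonoidHom.id ℤ
  have hrestr : ∀ (n : ℕ) (z : ℤ), restr r (n + 1) z = q * z := by
    intro n
    induction n with
    | zero => intro z; rfl
    | succ n ih => intro z; exact ih z
  refine ⟨A, inst, r, ?_, ?_, ?_⟩
  · intro n t ht
    refine ⟨t, ?_, rfl⟩
    have h1 : q * t = 0 := (hrestr n t).symm.trans ht
    exact (hrestr (n + 1) t).trans h1
  · intro n y
    exact ⟨y, (hrestr n y).trans (smul_eq_mul q y).symm⟩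
  · intro h
    obtain ⟨z, hz⟩ := h 1 (fun n => ⟨1, (hrestr n 1).trans (smul_eq_mul q 1).symm⟩) 0
    have hz' : q * z = 1 := (hrestr 0 z).symm.trans hz
    have h1 : q ∣ 1 := ⟨z, hz'.symm⟩
    have h2 : q ≤ 1 := Int.le_of_dvd one_pos h1
    omega

/-- **LEVEL-WISE LIFTS AT ALL LEVELS DO NOT GIVE A COMPATIBLE LIFT WITHOUT S1** (toy; the
`lim¹`/Mittag-Leffler phenomenon the line avoids by never asking compatibility — it spends S1 inside
`integralStepClassLifting_of_liftsToAllLevels` instead): a tower in which `y` lifts to every level but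
no compatible family passes through `y`. `A 0 = ℤ/2`, `A (n+1) = ℤ`, bottom map = reduction,
transitions `×3`: `1` lifts everywhere (`3ⁿ ≡ 1 mod 2`), while a compatible family `(x_n)` has
`x_1 ∈ ⋂ₙ 3ⁿℤ = 0`, so `x_0 = 0`. Its kernel tower `2ℤ →(×3) 2ℤ` is not surjective, as
`rechoice_of_kernelTower_surjective` predicts. So "S2 ∧ S3 ⇒ `IntegralCompatibleLift`" is FALSE as
tower algebra; what is true (and what the skeleton uses) is "S1 ∧ level-wise lifts ⇒ integral step
class lifting" (`integralStepClassLifting_of_liftsToAllLevels`). -/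
theorem levelwiseLifts_not_compatible :
    ∃ (A : ℕ → Type) (_ : ∀ n, AddCommGroup (A n)) (r : ∀ n, A (n + 1) →+ A n) (y : A 0),
      (∀ n, ∃ z : A (n + 1), restr r (n + 1) z = y) ∧
      ¬ ∃ x : ∀ n, A n, (∀ n, r n (x (n + 1)) = x n) ∧ x 0 = y := by
  let A : ℕ → Type := fun m => match m with | 0 => ZMod 2 | _ + 1 => ℤ
  let inst : ∀ n, AddCommGroup (A n) := fun m => match m with
    | 0 => inferInstanceAs (AddCommGroup (ZMod 2))
    | _ + 1 => inferInstanceAs (AddCommGroup ℤ)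
  let r : ∀ n, A (n + 1) →+ A n := fun m => match m with
    | 0 => (Int.castAddHom (ZMod 2) : ℤ →+ ZMod 2)
    | _ + 1 => (AddMonoidHom.mulLeft (3 : ℤ) : ℤ →+ ℤ)
  have hrestr : ∀ (n : ℕ) (z : ℤ), (restr r (n + 1) z : ZMod 2) = ((3 ^ n * z : ℤ) : ZMod 2) := by
    intro n
    induction n with
    | zero => intro z; change ((z : ℤ) : ZMod 2) = _; rw [pow_zero, one_mul]
    | succ n ih =>
      intro z
      change (restr r (n + 1) (3 * z) : ZMod 2) = _
      rw [ih (3 * z), pow_succ, mul_assoc]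
  refine ⟨A, inst, r, (1 : ZMod 2), fun n => ⟨(1 : ℤ), ?_⟩, ?_⟩
  · have h := hrestr n 1
    rw [mul_one, Int.cast_pow] at h
    have h3 : ((3 : ℤ) : ZMod 2) = 1 := by decide
    rw [h3, one_pow] at h
    exact h
  · rintro ⟨x, hx, hx0⟩
    -- `x 1 = 3ⁿ · x (n+1)` for every `n`
    have hmul : ∀ n : ℕ, (x 1 : ℤ) = 3 ^ n * (x (n + 1) : ℤ) := by
      intro n
      induction n with
      | zero => simp
      | succ n ih =>
        have h := hx (n + 1)
        change (3 : ℤ) * x (n + 2) = x (n + 1) at h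
        rw [ih, ← h, pow_succ, mul_assoc]
    have hx1 : (x 1 : ℤ) = 0 := by
      refine Int.eq_zero_of_abs_lt_dvd ⟨x ((x 1 : ℤ).natAbs + 1), hmul _⟩ ?_
      have hlt : (x 1 : ℤ).natAbs < 3 ^ (x 1 : ℤ).natAbs :=
        Nat.lt_pow_self (by norm_num : 1 < 3)
      have h3 : (((x 1 : ℤ).natAbs : ℕ) : ℤ) < (3 : ℤ) ^ (x 1 : ℤ).natAbs := by
        exact_mod_cast hlt
      rwa [Int.natCast_natAbs] at h3
    have h0 := hx 0
    change ((x 1 : ℤ) : ZMod 2) = x 0 at h0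
    rw [hx1, hx0, Int.cast_zero] at h0
    exact zero_ne_one h0

end TargetToys

/-! ### (T4) The crux splits along its disjunction; the minimal `d ≤ 3` half -/

section Split

/-- **THE `d ≤ 3` HALF OF THE CRUX WITH ONLY THE HYPOTHESES ITS PAPER PROOF USES** (cycle-3
bookkeeping of (E), §11 (M)): `H²(𝒳, 𝒪)[p] = 0` (weight-1 transitions and the weight-1 part of the
pro-obstruction group) and `H³(𝒳, Ω¹_{𝒳/W})[p] = 0` (weight-2 transitions, `δ = 0`, and the weight-2 part
`H³(𝒳,Ω¹)` of the pro-obstruction group). Every other clause of `HodgeTorsionFree` — `H^b(𝒪)` for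
`b ≠ 2`, `H^b(Ω¹)` for `b ≠ 3` — is DECORATION for `d ≤ 3` on paper (`H¹(𝒳,𝒪)` is even automatically
torsion-free: `H⁰(X_k,𝒪) = k`; torsion in `H³(𝒪)` only contributes its `p`-adic Tate module `= 0` to the
limit). TRUE on paper; implies `CruxLowDim` formally (`cruxLowDim_of_minimal`). A prover who lands this
stronger statement lands the `d ≤ 3` half of P1a; a refuter looking for a `d ≤ 3` witness may IGNORE all
torsion hypotheses except these two. -/
def CruxThreefoldMinimal : Prop :=
  ∀ (p : ℕ) [Fact p.Prime] (k : Type) [Field k] [CharP k p] [PerfectRing k p] (d : ℕ)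
    (𝒳 : SchemeOver (WittVector p k)), IsSmoothProperModel d 𝒳 →
    Crystalline.IsProjectiveOverRing 𝒳 → d + 6 < p → d ≤ 3 →
    (∀ x : structureSheafCohomology 𝒳.left 2, (p : ℤ) • x = 0 → x = 0) →
    (∀ x : hodgeCohomologyOne 𝒳 3, (p : ℤ) • x = 0 → x = 0) →
    ∀ (E₁ : (specialFibre 𝒳).left.Modules) (hE₁ : IsFiniteLocallyFree E₁),
      ClassLiftsImplyObjectLifts 𝒳 E₁ → RationalProLift 𝒳 E₁ hE₁ → LiftsFormally 𝒳 E₁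

/-- The `d ≤ 3` half of the crux, verbatim hypotheses. -/
def CruxLowDim : Prop :=
  ∀ (p : ℕ) [Fact p.Prime] (k : Type) [Field k] [CharP k p] [PerfectRing k p] (d : ℕ)
    (𝒳 : SchemeOver (WittVector p k)), IsSmoothProperModel d 𝒳 →
    Crystalline.IsProjectiveOverRing 𝒳 → d + 6 < p →
    (∀ (b : ℕ) (x : structureSheafCohomology 𝒳.left b), (p : ℤ) • x = 0 → x = 0) →
    (∀ (b : ℕ) (x : hodgeCohomologyOne 𝒳 b), (p : ℤ) • x = 0 → x = 0) → d ≤ 3 →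
    ∀ (E₁ : (specialFibre 𝒳).left.Modules) (hE₁ : IsFiniteLocallyFree E₁),
      ClassLiftsImplyObjectLifts 𝒳 E₁ → RationalProLift 𝒳 E₁ hE₁ → LiftsFormally 𝒳 E₁

/-- The `Ω¹`-free half of the crux (any `d`; on paper: abelian schemes and their torsors, (E7)+(H)),
verbatim hypotheses. -/
def CruxOmegaFree : Prop :=
  ∀ (p : ℕ) [Fact p.Prime] (k : Type) [Field k] [CharP k p] [PerfectRing k p] (d : ℕ)
    (𝒳 : SchemeOver (WittVector p k)), IsSmoothProperModel d 𝒳 →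
    Crystalline.IsProjectiveOverRing 𝒳 → d + 6 < p →
    (∀ (b : ℕ) (x : structureSheafCohomology 𝒳.left b), (p : ℤ) • x = 0 → x = 0) →
    (∀ (b : ℕ) (x : hodgeCohomologyOne 𝒳 b), (p : ℤ) • x = 0 → x = 0) →
    Nonempty (cotangentSheaf 𝒳 ≅ SheafOfModules.free (R := 𝒳.left.ringCatSheaf) (Fin d)) →
    ∀ (E₁ : (specialFibre 𝒳).left.Modules) (hE₁ : IsFiniteLocallyFree E₁),
      ClassLiftsImplyObjectLifts 𝒳 E₁ → RationalProLift 𝒳 E₁ hE₁ → LiftsFormally 𝒳 E₁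

/-- The minimal threefold statement gives the `d ≤ 3` half. -/
theorem cruxLowDim_of_minimal (h : CruxThreefoldMinimal) : CruxLowDim :=
  fun p _ k _ _ _ d 𝒳 h₁ h₂ h₃ hO hΩ hd E₁ hE₁ hs hr =>
    h p k d 𝒳 h₁ h₂ h₃ hd (hO 2) (hΩ 3) E₁ hE₁ hs hr

/-- **The crux is the conjunction of its two halves** (case split on `d ≤ 3 ∨ Ω¹ free`). -/
theorem crux_of_lowDim_of_omegaFree (hlow : CruxLowDim) (hhigh : CruxOmegaFree) :
    FormalLiftingFromClassLifting :=
  crux_iff.mpr fun p _ k _ _ _ d 𝒳 h₁ h₂ h₃ h₄ E₁ hE₁ hs hr =>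
    h₄.2.2.elim (fun hd => hlow p k d 𝒳 h₁ h₂ h₃ h₄.1 h₄.2.1 hd E₁ hE₁ hs hr)
      (fun hΩ => hhigh p k d 𝒳 h₁ h₂ h₃ h₄.1 h₄.2.1 hΩ E₁ hE₁ hs hr)

/-- Conversely each half follows from the crux (so the split loses nothing). -/
theorem lowDim_of_crux (h : FormalLiftingFromClassLifting) : CruxLowDim :=
  fun p _ k _ _ _ d 𝒳 h₁ h₂ h₃ hO hΩ hd E₁ hE₁ hs hr =>
    crux_iff.mp h p k d 𝒳 h₁ h₂ h₃ ⟨hO, hΩ, Or.inl hd⟩ E₁ hE₁ hs hr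

theorem omegaFree_of_crux (h : FormalLiftingFromClassLifting) : CruxOmegaFree :=
  fun p _ k _ _ _ d 𝒳 h₁ h₂ h₃ hO hΩ hfree E₁ hE₁ hs hr =>
    crux_iff.mp h p k d 𝒳 h₁ h₂ h₃ ⟨hO, hΩ, Or.inr hfree⟩ E₁ hE₁ hs hr

/-- **P1a from the minimal threefold statement and the `Ω¹`-free half.** -/
theorem crux_of_minimal_of_omegaFree (hmin : CruxThreefoldMinimal) (hhigh : CruxOmegaFree) :
    FormalLiftingFromClassLifting :=
  crux_of_lowDim_of_omegaFree (cruxLowDim_of_minimal hmin) hhigh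

end Split

/-! ## 12. Cycle 4: the vector-bundle converse PROVED (kill criterion unconditional), the exact
`LiftsFormally` ↔ `K`-tower dictionary, and the `p`-adic arithmetic of the divided powers of `(pⁿ)` -/

universe u₄ v₄ u₄'

section RankFour

variable {C : Type u₄'} [Category.{v₄} C] {J : GrothendieckTopology C} {R : Sheaf J RingCat.{u₄}}
  [HasWeakSheafify J AddCommGrpCat.{u₄}] [J.WEqualsLocallyBijective AddCommGrpCat.{u₄}]

/-- Morphisms out of a free sheaf of modules are determined by their restrictions along the
tautological inclusions `ιFree i : 𝒪 ⟶ 𝒪^I`. -/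
theorem free_hom_ext {I : Type u₄} {Z : SheafOfModules.{u₄} R} (f g : SheafOfModules.free I ⟶ Z)
    (h : ∀ i, SheafOfModules.ιFree i ≫ f = SheafOfModules.ιFree i ≫ g) : f = g :=
  Cofan.IsColimit.hom_ext (SheafOfModules.isColimitFreeCofan I) _ _ fun i => h i

/-- **An epimorphism `𝒪^K ↠ 𝒪^I` of free sheaves of modules with `K` finite forces `I` finite**, on any
ringed site whose ring `End(𝒪)` is commutative with `𝟙 ≠ 0`: `Hom(−, 𝒪)` gives an injective
`End(𝒪)`-linear map `End(𝒪)^(#K+1) ↪ End(𝒪)^K`, against the strong rank condition. (Landed copy: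
`Negative/VectorBundleConverse.lean`.) -/
theorem finite_of_epi_free {I K : Type u₄} [Finite K]
    (hcomm : ∀ a b : End (SheafOfModules.unit R), a * b = b * a)
    (hnt : (𝟙 (SheafOfModules.unit R) : End (SheafOfModules.unit R)) ≠ 0)
    (π : SheafOfModules.free (R := R) K ⟶ SheafOfModules.free (R := R) I) [Epi π] : Finite I := by
  classical
  letI : CommRing (End (SheafOfModules.unit R)) :=
    { (inferInstance : Ring (End (SheafOfModules.unit R))) with mul_comm := hcomm }
  haveI : Nontrivial (End (SheafOfModules.unit R)) := ⟨⟨_, _, hnt⟩⟩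
  by_contra hI
  rw [not_finite_iff_infinite] at hI
  haveI := Fintype.ofFinite K
  let emb : Fin (Fintype.card K + 1) ↪ I := Fin.valEmbedding.trans (Infinite.natEmbedding I)
  let δ : (Fin (Fintype.card K + 1) → End (SheafOfModules.unit R)) →
      I → End (SheafOfModules.unit R) :=
    fun c => Function.extend emb c (0 : I → End (SheafOfModules.unit R))
  have hδ_emb : ∀ c j, δ c (emb j) = c j := fun c j => emb.injective.extend_apply c 0 j
  have hδ_out : ∀ c i, (¬ ∃ j, emb j = i) → δ c i = 0 := fun c i hi =>
    Function.extend_apply' c (0 : I → End (SheafOfModules.unit R)) i hi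
  have hδ_add : ∀ c c' i, δ (c + c') i = δ c i + δ c' i := by
    intro c c' i
    by_cases hi : ∃ j, emb j = i
    · obtain ⟨j, rfl⟩ := hi
      rw [hδ_emb, hδ_emb, hδ_emb, Pi.add_apply]
    · rw [hδ_out c i hi, hδ_out c' i hi, hδ_out (c + c') i hi, add_zero]
  have hδ_smul : ∀ (b : End (SheafOfModules.unit R)) c i, δ (b • c) i = b * δ c i := by
    intro b c i
    by_cases hi : ∃ j, emb j = i
    · obtain ⟨j, rfl⟩ := hi
      rw [hδ_emb, hδ_emb, Pi.smul_apply, smul_eq_mul]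
    · rw [hδ_out c i hi, hδ_out (b • c) i hi, mul_zero]
  let D : (Fin (Fintype.card K + 1) → End (SheafOfModules.unit R)) →
      (SheafOfModules.free (R := R) I ⟶ SheafOfModules.unit R) :=
    fun c => Cofan.IsColimit.desc (SheafOfModules.isColimitFreeCofan I)
      (fun i => End.asHom (δ c i))
  have hD : ∀ c i, SheafOfModules.ιFree i ≫ D c = End.asHom (δ c i) :=
    fun c i => Cofan.IsColimit.fac (SheafOfModules.isColimitFreeCofan I) _ i
  have hD_add : ∀ c c', D (c + c') = D c + D c' := by
    intro c c'
    refine free_hom_ext _ _ fun i => ?_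
    rw [Preadditive.comp_add, hD, hD, hD, hδ_add]
    rfl
  have hD_smul : ∀ (b : End (SheafOfModules.unit R)) c, D (b • c) = D c ≫ End.asHom b := by
    intro b c
    refine free_hom_ext _ _ fun i => ?_
    rw [hD, ← Category.assoc, hD, hδ_smul]
    rfl
  let Φ : (Fin (Fintype.card K + 1) → End (SheafOfModules.unit R)) →ₗ[End (SheafOfModules.unit R)]
      (K → End (SheafOfModules.unit R)) :=
    { toFun := fun c k => End.of (SheafOfModules.ιFree k ≫ π ≫ D c)
      map_add' := fun c c' => by
        funext k
        change End.of (SheafOfModules.ιFree k ≫ π ≫ D (c + c')) =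
          End.of (SheafOfModules.ιFree k ≫ π ≫ D c) + End.of (SheafOfModules.ιFree k ≫ π ≫ D c')
        rw [hD_add, Preadditive.comp_add, Preadditive.comp_add]
        rfl
      map_smul' := fun b c => by
        funext k
        change End.of (SheafOfModules.ιFree k ≫ π ≫ D (b • c)) =
          b * End.of (SheafOfModules.ιFree k ≫ π ≫ D c)
        rw [hD_smul, End.mul_def]
        change SheafOfModules.ιFree k ≫ π ≫ D c ≫ End.asHom b =
          (SheafOfModules.ιFree k ≫ π ≫ D c) ≫ End.asHom b
        simp only [Category.assoc] }
  have hΦ : Function.Injective Φ := by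
    intro c c' hcc'
    rw [← sub_eq_zero] at hcc' ⊢
    rw [← map_sub] at hcc'
    have h0 : ∀ k, SheafOfModules.ιFree k ≫ π ≫ D (c - c') = 0 := fun k => congrFun hcc' k
    have h1 : π ≫ D (c - c') = 0 := by
      refine free_hom_ext _ _ fun k => ?_
      rw [comp_zero]
      exact h0 k
    have h2 : D (c - c') = 0 := by
      rw [← cancel_epi π, h1, comp_zero]
    funext j
    have h3 := hD (c - c') (emb j)
    rw [h2, comp_zero, hδ_emb] at h3
    exact h3.symm
  have hcard := card_le_of_injective (End (SheafOfModules.unit R)) Φ hΦ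
  simp only [Fintype.card_fin] at hcard
  omega

end RankFour

section EndUnitFour

open Opposite

variable {X : Scheme.{u₄}} (W : X.Opens)

/-- **`End(𝒪)` is commutative** on the site of opens over `W` (open by open an endomorphism of the unit
module is multiplication by its value on `1`; sections of `𝒪_X` commute). -/
theorem end_unit_mul_comm (a b : End (SheafOfModules.unit (X.ringCatSheaf.over W))) :
    a * b = b * a := by
  change b ≫ a = a ≫ b
  refine SheafOfModules.hom_ext (PresheafOfModules.hom_ext fun Y => ModuleCat.hom_ext
    (LinearMap.ext fun y => ?_))
  let f : (X.ringCatSheaf.over W).obj.obj Y →ₗ[(X.ringCatSheaf.over W).obj.obj Y]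
      (X.ringCatSheaf.over W).obj.obj Y := (a.val.app Y).hom
  let g : (X.ringCatSheaf.over W).obj.obj Y →ₗ[(X.ringCatSheaf.over W).obj.obj Y]
      (X.ringCatSheaf.over W).obj.obj Y := (b.val.app Y).hom
  obtain ⟨z, rfl⟩ : ∃ z : (X.ringCatSheaf.over W).obj.obj Y, z = y := ⟨y, rfl⟩
  change f (g z) = g (f z)
  have hf : ∀ t, f t = t * f 1 := fun t => by
    have h := f.map_smul t 1
    rwa [smul_eq_mul, mul_one, smul_eq_mul] at h
  have hg : ∀ t, g t = t * g 1 := fun t => by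
    have h := g.map_smul t 1
    rwa [smul_eq_mul, mul_one, smul_eq_mul] at h
  rw [hg z, hf (z * _), hf z, hg (z * _)]
  have key : ∀ r s t : Γ(X, Y.unop.left), r * s * t = r * t * s := fun r s t => mul_right_comm r s t
  exact key _ _ _

/-- **`𝟙 ≠ 0` in `End(𝒪)`** over a non-empty open `W` of a scheme. -/
theorem end_unit_id_ne_zero [Nonempty W] :
    (𝟙 (SheafOfModules.unit (X.ringCatSheaf.over W)) :
      End (SheafOfModules.unit (X.ringCatSheaf.over W))) ≠ 0 := by
  intro h0
  have key := congrArg (fun u : SheafOfModules.unit (X.ringCatSheaf.over W) ⟶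
      SheafOfModules.unit (X.ringCatSheaf.over W) =>
        ((u.val.app (op (Over.mk (𝟙 W)))).hom
          (1 : (X.ringCatSheaf.over W).obj.obj (op (Over.mk (𝟙 W)))) :
          (X.ringCatSheaf.over W).obj.obj (op (Over.mk (𝟙 W))))) h0
  change (1 : Γ(X, W)) = 0 at key
  exact one_ne_zero key

/-- **A VECTOR BUNDLE ON A SCHEME IS FINITE LOCALLY FREE** (Stacks 01C6; the converse of the tree's
`IsFiniteLocallyFree.isVectorBundle`, isolated as `VectorBundleConverse` in §6 and left open in cycles
2–3): at `x`, a trivialisation `E|_U ≅ 𝒪^I` and finitely many generators of `E|_V` restrict to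
`W = U ∩ V ∋ x` (restriction to the opens over `W` is a left adjoint and keeps epimorphisms), giving
`𝒪^K ↠ 𝒪^I` over `W ≠ ∅`, whence `I` is finite (`finite_of_epi_free`). -/
theorem isFiniteLocallyFree_of_isVectorBundle {E : X.Modules} (h : IsVectorBundle E) :
    IsFiniteLocallyFree E := by
  classical
  obtain ⟨q, hq⟩ := h.1.exists_isLocallyFreeData
  haveI := h.2
  obtain ⟨q', hq'⟩ := SheafOfModules.IsFiniteType.exists_localGeneratorsData E
  intro x
  obtain ⟨a, ha⟩ := ((Opens.coversTop_iff _ q.X).mp q.coversTop).exists_mem x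
  obtain ⟨b, hb⟩ := ((Opens.coversTop_iff _ q'.X).mp q'.coversTop).exists_mem x
  refine ⟨q.X a, ha, (q.generators a).I, ?_, ⟨asIso (q.generators a).π⟩⟩
  let W : X.Opens := q.X a ⊓ q'.X b
  haveI : Nonempty W := ⟨⟨x, ⟨ha, hb⟩⟩⟩
  haveI : (q'.generators b).IsFiniteType := hq'.isFiniteType b
  let eW : SheafOfModules.free (q.generators a).I ≅ E.over W :=
    SheafOfModules.restrictTrivialisation (R := X.ringCatSheaf) (homOfLE inf_le_left)
      (asIso (q.generators a).π)
  let g : W ⟶ q'.X b := homOfLE inf_le_right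
  let πW : SheafOfModules.free (q'.generators b).I ⟶ E.over W :=
    (SheafOfModules.mapFreeIso (SheafOfModules.overMap X.ringCatSheaf g) _
        (SheafOfModules.overMapUnitIso g).symm).hom ≫
      (SheafOfModules.overMap X.ringCatSheaf g).map (q'.generators b).π ≫
        ((SheafOfModules.overFunctorMap X.ringCatSheaf g).app E).hom
  haveI : Epi πW := by
    dsimp only [πW]
    infer_instance
  exact finite_of_epi_free (end_unit_mul_comm W) (end_unit_id_ne_zero W) (πW ≫ eW.inv)

end EndUnitFour

/-- **§6's isolated debt is paid**: `VectorBundleConverse` holds. -/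
theorem vectorBundleConverse_holds : VectorBundleConverse :=
  fun _ _ hE => isFiniteLocallyFree_of_isVectorBundle hE

section UnconditionalFour

variable {p : ℕ} [Fact p.Prime] {k : Type} [Field k] [CharP k p] {𝒳 : SchemeOver (WittVector p k)}

/-- A formal lift gives a one-step class lift — unconditionally (cycle 2's
`oneStepClassLift_of_liftsFormally` with `VectorBundleConverse` discharged). -/
theorem oneStepClassLift_of_liftsFormally' {E₁ : (specialFibre 𝒳).left.Modules}
    (hE₁ : IsFiniteLocallyFree E₁) (hL : LiftsFormally 𝒳 E₁) : OneStepClassLift 𝒳 E₁ hE₁ :=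
  oneStepClassLift_of_liftsFormally vectorBundleConverse_holds hE₁ hL

/-- **A formal lift restricts to a vector-bundle lift of `E₁` on EVERY thickening `X_{n+1}`** (the
isomorphisms `E (n+1)|X_{n+1} ≅ E n` composed down to `X_k`; cycle 2 had only `n = 1`). -/
theorem liftsToThickening_of_liftsFormally {E₁ : (specialFibre 𝒳).left.Modules}
    (hL : LiftsFormally 𝒳 E₁) (n : ℕ) : LiftsToThickening 𝒳 E₁ n := by
  obtain ⟨E, hvb, htr, ⟨j⟩⟩ := hL
  suffices h : ∀ n, Nonempty ((Scheme.Modules.pullback (specialFibreToThickening 𝒳 n)).obj (E n) ≅ E₁)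
    from ⟨E n, hvb n, h n⟩
  intro n
  induction n with
  | zero => exact ⟨j⟩
  | succ n ih =>
    obtain ⟨i⟩ := htr n
    obtain ⟨j'⟩ := ih
    refine ⟨?_ ≪≫ j'⟩
    refine eqToIso (congrArg (fun f => (Scheme.Modules.pullback f).obj _)
        (specialFibreToThickening_comp_thickeningMap 𝒳 n).symm) ≪≫ ?_
    exact ((Scheme.Modules.pullbackComp (specialFibreToThickening 𝒳 n)
        (thickeningMap 𝒳 (Nat.le_succ (n + 1)))).app _).symm ≪≫
      (Scheme.Modules.pullback (specialFibreToThickening 𝒳 n)).mapIso i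

/-- **THE CONCLUSION OF THE CRUX IMPLIES THE CONCLUSION OF S2 ∧ S3 AT `[E₁]`**: a formally liftable
finite locally free `E₁` has its integral class lifting to EVERY level of the `K₀`-tower
(unconditional; cf. (T2) `liftsToAllLevels_of_stubs`). So a level-`n` class-lifting failure of a
formally liftable `E₁` is a formal contradiction, for every `n`, not only `n = 1`. -/
theorem liftsToAllLevels_of_liftsFormally {E₁ : (specialFibre 𝒳).left.Modules}
    (hE₁ : IsFiniteLocallyFree E₁) (hL : LiftsFormally 𝒳 E₁) :
    LiftsToAllLevels 𝒳 (KTheory.KZero.of E₁ hE₁) := by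
  intro n
  obtain ⟨E, hE, ⟨i⟩⟩ := liftsToThickening_of_liftsFormally hL n
  refine ⟨KTheory.KZero.of E (isFiniteLocallyFree_of_isVectorBundle hE), ?_⟩
  rw [KTheory.KZero.map_of]
  exact KTheory.KZero.of_iso i _ _

variable [PerfectRing k p]

/-- **ONE-STEP CLASS LIFTING IS NECESSARY FOR THE CRUX — unconditionally** (cycle 2's
`oneStepClassLift_of_crux` without `VectorBundleConverse`). -/
theorem oneStepClassLift_of_crux' (hcrux : FormalLiftingFromClassLifting)
    {d : ℕ} (h₁ : IsSmoothProperModel d 𝒳) (h₂ : Crystalline.IsProjectiveOverRing 𝒳)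
    (h₃ : d + 6 < p) (h₄ : HodgeTorsionFree 𝒳 d) {E₁ : (specialFibre 𝒳).left.Modules}
    (hE₁ : IsFiniteLocallyFree E₁) (hr : RationalProLift 𝒳 E₁ hE₁) : OneStepClassLift 𝒳 E₁ hE₁ :=
  oneStepClassLift_of_crux vectorBundleConverse_holds hcrux h₁ h₂ h₃ h₄ hE₁ hr

/-- **Under the crux, `[E₁]` lifts to EVERY level** as soon as `E₁` carries (⋆) and a rational
pro-class (the all-levels form of the necessary condition; unconditional). -/
theorem liftsToAllLevels_of_crux (hcrux : FormalLiftingFromClassLifting)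
    {d : ℕ} (h₁ : IsSmoothProperModel d 𝒳) (h₂ : Crystalline.IsProjectiveOverRing 𝒳)
    (h₃ : d + 6 < p) (h₄ : HodgeTorsionFree 𝒳 d) {E₁ : (specialFibre 𝒳).left.Modules}
    (hE₁ : IsFiniteLocallyFree E₁) (hs : ClassLiftsImplyObjectLifts 𝒳 E₁)
    (hr : RationalProLift 𝒳 E₁ hE₁) : LiftsToAllLevels 𝒳 (KTheory.KZero.of E₁ hE₁) :=
  liftsToAllLevels_of_liftsFormally hE₁ (crux_iff.mp hcrux p k d 𝒳 h₁ h₂ h₃ h₄ E₁ hE₁ hs hr)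

end UnconditionalFour

/-- **KILL CRITERION, UNCONDITIONAL** (cycle 2's `not_crux_of_oneStepWitness` with the folklore
converse discharged): a single one-step witness refutes the crux. Paper status unchanged: by (E) no
witness exists; this is the frame in which any future witness is a complete Lean refutation. -/
theorem not_crux_of_oneStepWitness'
    (w : ∃ (p : ℕ) (_ : Fact p.Prime) (k : Type) (_ : Field k) (_ : CharP k p) (_ : PerfectRing k p)
      (d : ℕ) (𝒳 : SchemeOver (WittVector p k)),
      IsSmoothProperModel d 𝒳 ∧ Crystalline.IsProjectiveOverRing 𝒳 ∧ d + 6 < p ∧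
      HodgeTorsionFree 𝒳 d ∧
      ∃ (E₁ : (specialFibre 𝒳).left.Modules) (hE₁ : IsFiniteLocallyFree E₁),
        RationalProLift 𝒳 E₁ hE₁ ∧ ¬ OneStepClassLift 𝒳 E₁ hE₁) :
    ¬ FormalLiftingFromClassLifting :=
  not_crux_of_oneStepWitness vectorBundleConverse_holds w

section DecorationFour

/-- **(T5) THE TORSION-FREENESS OF THE PRO-OBSTRUCTION GROUP IS NOT AN AXIOM SCHEMA** (cycle-3
pre-warning (P) made formal, abstract form): for ANY group `K` and ANY antitone family of subgroups
`im m` (dictionary: `K = K₀(X_k)`, `im m = im(K₀(X_{m+1}) → K₀(X_k))`) there is an "obstruction tower"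
`(G m, ob m, t m)` with compatible transitions and `ob m y = 0 ↔ y ∈ im m` — exactly the hypotheses
`ht`, `hexact` of the lead's `pSaturated_of_obstructionTower` — whose compatible families HAVE
`p`-torsion: decorate the cokernel tower `K ⧸ im m` by a constant summand `ℤ/p`. So a typed item or
Literature "fact" of the shape `∀ 𝒳 (hyps) (G, ob, t), ht → hexact → (compatible families are
p-torsion-free)` is FALSE on every `𝒳` satisfying the hypotheses; torsion-freeness is a theorem about
ONE object (`lim_m π₋₁K(X_{m+1}, X_k)`), to be pinned to that object's construction. -/
theorem obstructionTower_schema_refuted (p : ℕ) [Fact p.Prime] {K : Type u₄} [AddCommGroup K]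
    (im : ℕ → AddSubgroup K) (him : ∀ m, im (m + 1) ≤ im m) :
    ∃ (G : ℕ → Type u₄) (_ : ∀ m, AddCommGroup (G m)) (ob : ∀ m, K →+ G m)
      (t : ∀ m, G (m + 1) →+ G m),
      (∀ m y, t m (ob (m + 1) y) = ob m y) ∧ (∀ m y, ob m y = 0 ↔ y ∈ im m) ∧
      ∃ g : ∀ m, G m, (∀ m, t m (g (m + 1)) = g m) ∧ (∀ m, (p : ℤ) • g m = 0) ∧ g 0 ≠ 0 := by
  refine ⟨fun m => (K ⧸ im m) × ZMod p, fun m => inferInstance,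
    fun m => (QuotientAddGroup.mk' (im m)).prod 0,
    fun m => AddMonoidHom.prodMap
      (QuotientAddGroup.map (im (m + 1)) (im m) (AddMonoidHom.id K)
        (by rw [AddSubgroup.comap_id]; exact him m))
      (AddMonoidHom.id _),
    ?_, ?_, fun _ => (0, 1), ?_, ?_, ?_⟩
  · intro m y
    rfl
  · intro m y
    change ((y : K ⧸ im m), (0 : ZMod p)) = 0 ↔ y ∈ im m
    rw [Prod.mk_eq_zero, QuotientAddGroup.eq_zero_iff]
    exact and_iff_left rfl
  · intro m
    refine Prod.ext ?_ rfl
    change QuotientAddGroup.map (im (m + 1)) (im m) (AddMonoidHom.id K)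
        (by rw [AddSubgroup.comap_id]; exact him m) 0 = 0
    exact map_zero _
  · intro m
    refine Prod.ext ?_ ?_
    · change (p : ℤ) • (0 : K ⧸ im m) = 0
      exact smul_zero _
    · change (p : ℤ) • (1 : ZMod p) = 0
      rw [zsmul_eq_mul, mul_one, Int.cast_natCast, ZMod.natCast_self]
  · intro h
    have h1 : (1 : ZMod p) = 0 := congrArg Prod.snd h
    exact one_ne_zero h1

variable {p : ℕ} [Fact p.Prime] {k : Type} [Field k] [CharP k p]

/-- **(T5) on the `K₀`-tower of ANY `𝒳`**: there is a tower `(G, ob, t)` satisfying VERBATIM the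
hypotheses `ht`, `hexact` of the lead's `pSaturated_of_obstructionTower` (`ob m y = 0 ↔ LiftsToLevel 𝒳 y m`)
with a compatible family killed by `p` and non-zero at level `0`. Hence the residual of S2 cannot be
filed as "every such tower is `p`-torsion-free on compatible families" (refutable by this decoration on
the first `𝒳` satisfying the crux's hypotheses); it must be filed about the GENUINE relative
`K`-theory tower once constructible, or kept in hypothesis position as the lead does. -/
theorem obstructionTower_decoration (𝒳 : SchemeOver (WittVector p k)) :
    ∃ (G : ℕ → Type 1) (_ : ∀ m, AddCommGroup (G m))
      (ob : ∀ m, KTheory.KZero (specialFibre 𝒳).left →+ G m) (t : ∀ m, G (m + 1) →+ G m),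
      (∀ m y, t m (ob (m + 1) y) = ob m y) ∧ (∀ m y, ob m y = 0 ↔ LiftsToLevel 𝒳 y m) ∧
      ∃ g : ∀ m, G m, (∀ m, t m (g (m + 1)) = g m) ∧ (∀ m, (p : ℤ) • g m = 0) ∧ g 0 ≠ 0 := by
  have him : ∀ m, (KTheory.KZero.map (specialFibreToThickening 𝒳 (m + 1))).range ≤
      (KTheory.KZero.map (specialFibreToThickening 𝒳 m)).range := by
    rintro m y ⟨z, rfl⟩
    refine ⟨KTheory.KZero.map (thickeningMap 𝒳 (Nat.le_succ (m + 1))) z, ?_⟩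
    rw [← KTheory.KZero.map_comp_apply, specialFibreToThickening_comp_thickeningMap]
  obtain ⟨G, inst, ob, t, ht, hexact, g, hg, hpg, hg0⟩ :=
    obstructionTower_schema_refuted p (fun m => (KTheory.KZero.map (specialFibreToThickening 𝒳 m)).range) him
  refine ⟨G, inst, ob, t, ht, fun m y => ?_, g, hg, hpg, hg0⟩
  rw [hexact m y, AddMonoidHom.mem_range]
  rfl

end DecorationFour

section PDArithmetic

/-- `v_p(p!) = 1`: the divided power `γ_p(pⁿ) = p^{np}/p!` has valuation `np − 1 < np`, so the
PD-filtration of `(pⁿ) ⊂ A` LEAVES the `p`-adic staircase `p^{nm}A` exactly at `m = p` — the weight of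
AKN's even class `K₄(ℤ/9)` of (F), just outside AMMN's range `i ≤ p − 2` (cycle-4 (Q)). -/
theorem padicValNat_prime_factorial (p : ℕ) [hp : Fact p.Prime] : padicValNat p p.factorial = 1 := by
  have h0 : padicValNat p (p - 1).factorial = 0 :=
    padicValNat.eq_zero_of_not_dvd fun h =>
      absurd (hp.out.dvd_factorial.mp h) (not_le.mpr (Nat.sub_lt hp.out.pos Nat.one_pos))
  rw [← Nat.mul_factorial_pred hp.out.ne_zero, padicValNat.mul hp.out.ne_zero (Nat.factorial_ne_zero _),
    padicValNat_self, h0]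

/-- **THE STAIRCASE IS THE PD-FILTRATION UP TO WEIGHT `p − 1`**: for `m < p`, `m ≤ κ` and `n ≥ 1`,
`v_p(γ_κ(pⁿ)) = nκ − v_p(κ!) ≥ nm`, i.e. every divided power of `pⁿ` of order `≥ m` lies in
`p^{nm}A`; so `I^{[m]} = p^{nm}A` `p`-adically and the level-`n` weight-`i` relative complexes of
cycles 1–3 (`Filⁱ_n = [p^{n(i−j)}Ω^j]_j`) ARE the derived Hodge filtration of `LΩ_{A/pⁿ}` in all
weights `i ≤ p − 1` (cycle-4 (Q); AMMN Thm F(2) uses `i ≤ p − 2`). -/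
theorem staircase_pdPower_val (p : ℕ) [hp : Fact p.Prime] {m κ n : ℕ} (hm : m < p) (hmκ : m ≤ κ)
    (hn : 1 ≤ n) : n * m + padicValNat p κ.factorial ≤ n * κ := by
  rcases hmκ.eq_or_lt with rfl | hlt
  · have h0 : padicValNat p m.factorial = 0 :=
      padicValNat.eq_zero_of_not_dvd fun h => absurd (hp.out.dvd_factorial.mp h) (not_le.mpr hm)
    omega
  · obtain ⟨j, rfl⟩ : ∃ j, κ = m + 1 + j := ⟨κ - m - 1, by omega⟩
    have hleg := sub_one_mul_padicValNat_factorial_lt_of_ne_zero p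
      (show m + 1 + j ≠ 0 by omega)
    set v := padicValNat p (m + 1 + j).factorial
    have hq1 : 1 ≤ p - 1 := by have := hp.out.two_le; omega
    have hqm : m ≤ p - 1 := by omega
    have hj : j ≤ (p - 1) * j := Nat.le_mul_of_pos_left j hq1
    have h2 : (p - 1) * v ≤ (p - 1) * (j + 1) := by
      have e : (p - 1) * (j + 1) = (p - 1) * j + (p - 1) := by ring
      omega
    have hv : v ≤ j + 1 := Nat.le_of_mul_le_mul_left h2 (by omega)
    have h3 : j + 1 ≤ n * (j + 1) := Nat.le_mul_of_pos_left (j + 1) hn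
    have h4 : n * (m + 1 + j) = n * m + n * (j + 1) := by ring
    omega

end PDArithmetic

/-! ## 13. Cycle 5: the rational pro-class and (1_K) are NECESSARY; kill criterion 2 (`lim¹` form)

Cycle 4 proved the level-wise dictionary `LiftsFormally ⇒ LiftsToAllLevels [E₁]`. Here the COMPATIBLE
form: a formal lift `(E_n)` gives the integral compatible family `([E_n])_n ∈ lim_n K₀(X_{n+1})` through
`[E₁]` (`integralCompatibleLift_of_liftsFormally`), i.e. the conclusion of the (1_K)-child, and — read in
`ℚ ⊗ lim_n K₀(X_n)` — the rational pro-class (`rationalProLift_of_liftsFormally`): the LAST HYPOTHESIS OF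
THE CRUX IS IMPLIED BY ITS CONCLUSION on every `W(k)`-scheme (so it is the exact class-level shadow of
`LiftsFormally`, not a convenience). Consequences: under the crux, for every `E₁` carrying (⋆) on an `𝒳`
satisfying the hypotheses, `LiftsFormally 𝒳 E₁ ↔ RationalProLift ↔ IntegralCompatibleLift`
(`liftsFormally_iff_rationalProLift_of_crux`, `integralCompatibleLift_iff_rationalProLift_of_crux`); P1a
IMPLIES "(⋆)-bundles: rational pro-lift ⇒ integral compatible lift" (`oneKOnStarBundles_of_crux`) and is
EQUIVALENT to it MODULO (2_K) (`crux_iff_oneKOnStarBundles_of_twoK`: the glue only ever applies (1_K) to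
the (⋆)-bundle in hand); and KILL CRITERION 2 (`not_crux_of_incompatibleWitness`): a (⋆)-bundle with a
rational pro-class but NO integral compatible lift of its class refutes the crux. Criterion 1 (one-step,
§§6/12) is the special case where already `[E₁] ∉ im K₀(X_2)` (then (⋆) is vacuous and no level-`1` member
of a compatible family exists, `not_integralCompatibleLift_of_not_liftsToLevel`); criterion 2 also covers
the `lim¹`-shape of (T3) `levelwiseLifts_not_compatible`: `[E₁]` lifting to EVERY level, (⋆) holding
genuinely, but the non-empty sets of level-`n` lifts having empty inverse limit (kernel tower not
Mittag-Leffler). Paper status: no such witness for `d ≤ 3` or `Ω¹` free — (E4)/(E7)+(H) make the kernel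
tower SURJECTIVE, so the lifts of `[E₁]` form a Mittag-Leffler system of non-empty torsors. -/

section NecessityFive

open scoped TensorProduct

variable {p : ℕ} [Fact p.Prime] {k : Type} [Field k] [CharP k p] {𝒳 : SchemeOver (WittVector p k)}

/-- **`LiftsFormally ⇒ (1_K)`**: the classes of the members of a formal lift form an integral compatible
family through `[E₁]` (uses the cycle-4 converse `isFiniteLocallyFree_of_isVectorBundle` to take classes). -/
theorem integralCompatibleLift_of_liftsFormally {E₁ : (specialFibre 𝒳).left.Modules}
    (hE₁ : IsFiniteLocallyFree E₁) (hL : LiftsFormally 𝒳 E₁) : IntegralCompatibleLift 𝒳 E₁ hE₁ := by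
  obtain ⟨E, hvb, htr, ⟨j⟩⟩ := hL
  refine ⟨fun n => KTheory.KZero.of (E n) (isFiniteLocallyFree_of_isVectorBundle (hvb n)),
    fun n => ?_, ?_⟩
  · obtain ⟨i⟩ := htr n
    rw [KTheory.KZero.map_of]
    exact KTheory.KZero.of_iso i _ _
  · rw [KTheory.KZero.map_of]
    exact KTheory.KZero.of_iso j _ _

omit [CharP k p] in
/-- An integral compatible family on the Witt tower `(X_{n+1})_n` IS an element of the tree's
`lim_n K₀(X_n)` (`KTheory.LimKZero (p) 𝒳`, whose levels and transitions are those of the Witt tower: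
`kTheoryThickening_eq`, `thickeningTransition_eq`). -/
def limKZeroOfCompatible (x : ∀ n : ℕ, KTheory.KZero (thickening 𝒳 (n + 1)).left)
    (hx : ∀ n, KTheory.KZero.map (thickeningMap 𝒳 (Nat.le_succ (n + 1))) (x (n + 1)) = x n) :
    KTheory.LimKZero (Ideal.span {(p : WittVector p k)}) 𝒳 :=
  ⟨fun n => x n, fun n =>
    (congrArg (fun φ : (thickening 𝒳 (n + 1)).left ⟶ (thickening 𝒳 (n + 2)).left =>
        KTheory.KZero.map φ (x (n + 1))) (thickeningTransition_eq 𝒳 n)).trans (hx n)⟩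

omit [CharP k p] in
@[simp] theorem proj_limKZeroOfCompatible (x : ∀ n : ℕ, KTheory.KZero (thickening 𝒳 (n + 1)).left)
    (hx : ∀ n, KTheory.KZero.map (thickeningMap 𝒳 (Nat.le_succ (n + 1))) (x (n + 1)) = x n) (n : ℕ) :
    KTheory.LimKZero.proj (Ideal.span {(p : WittVector p k)}) 𝒳 n (limKZeroOfCompatible x hx) = x n :=
  rfl

/-- **(1_K) ⇒ the rational pro-class**: `ξ := 1 ⊗ (x_n)_n ∈ ℚ ⊗ lim_n K₀(X_n)` restricts to
`[E₁] ⊗ 1` (the bottom restriction `X_k → X ⊗ W/p` of the `KTheory` tower is `specialFibreToThickening 𝒳 0`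
definitionally). -/
theorem rationalProLift_of_integralCompatibleLift {E₁ : (specialFibre 𝒳).left.Modules}
    (hE₁ : IsFiniteLocallyFree E₁) (h : IntegralCompatibleLift 𝒳 E₁ hE₁) : RationalProLift 𝒳 E₁ hE₁ := by
  obtain ⟨x, hx, hx0⟩ := h
  refine ⟨(1 : ℚ) ⊗ₜ[ℤ] limKZeroOfCompatible x hx, ?_⟩
  rw [KTheory.ContinuousKZeroRat.proj_tmul, KTheory.KZeroRat.map_tmul, proj_limKZeroOfCompatible]
  exact congrArg (fun y => (1 : ℚ) ⊗ₜ[ℤ] y) hx0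

/-- **(1_K) in the Literature's vocabulary**: an integral compatible lift of `[E₁]` on the Witt tower is
EXACTLY an INTEGRAL pro-class `η ∈ lim_n K₀(X_n)` (the tree's `KTheory.LimKZero (p) 𝒳`, Bloch–Esnault–Kerz's
middle term) restricting to `[E₁]` along `Crystalline.specialFibreToTower` — i.e. the crux's last hypothesis
with `ℚ ⊗` deleted. (For a planner typing the (1_K)-child against the Literature carrier rather than against
Witt-tower families: the two phrasings are interchangeable, `toWitt`/`limKZeroOfCompatible`.) -/
theorem integralCompatibleLift_iff_exists_limKZero {E₁ : (specialFibre 𝒳).left.Modules}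
    (hE₁ : IsFiniteLocallyFree E₁) :
    IntegralCompatibleLift 𝒳 E₁ hE₁ ↔
      ∃ η : KTheory.LimKZero (Ideal.span {(p : WittVector p k)}) 𝒳,
        KTheory.KZero.map (Crystalline.specialFibreToTower 𝒳)
          (KTheory.LimKZero.proj (Ideal.span {(p : WittVector p k)}) 𝒳 0 η) = KTheory.KZero.of E₁ hE₁ := by
  constructor
  · rintro ⟨x, hx, hx0⟩
    exact ⟨limKZeroOfCompatible x hx, hx0⟩
  · rintro ⟨η, hη⟩
    exact ⟨toWitt 𝒳 η, map_thickeningMap_toWitt 𝒳 η,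
      (map_specialFibreToThickening_toWitt 𝒳 η 0).trans hη⟩

/-- **THE RATIONAL PRO-CLASS HYPOTHESIS IS NECESSARY**: on every `W(k)`-scheme, a formally liftable finite
locally free `E₁` has a rational (indeed integral) pro-class through `[E₁]`. So P1a's last hypothesis is
implied by its conclusion: the crux asserts the CONVERSE of a theorem, for (⋆)-bundles. -/
theorem rationalProLift_of_liftsFormally {E₁ : (specialFibre 𝒳).left.Modules}
    (hE₁ : IsFiniteLocallyFree E₁) (hL : LiftsFormally 𝒳 E₁) : RationalProLift 𝒳 E₁ hE₁ :=
  rationalProLift_of_integralCompatibleLift hE₁ (integralCompatibleLift_of_liftsFormally hE₁ hL)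

/-- No compatible family passes through a class that fails to lift to some level (criterion 1 ⊂ criterion 2). -/
theorem not_integralCompatibleLift_of_not_liftsToLevel {E₁ : (specialFibre 𝒳).left.Modules}
    (hE₁ : IsFiniteLocallyFree E₁) {n : ℕ} (h : ¬ LiftsToLevel 𝒳 (KTheory.KZero.of E₁ hE₁) n) :
    ¬ IntegralCompatibleLift 𝒳 E₁ hE₁ := by
  rintro ⟨x, hx, hx0⟩
  exact h ⟨x n, (map_specialFibreToThickening_of_compatible x hx n).trans hx0⟩

variable [PerfectRing k p]

/-- **THE CRUX IMPLIES ITS (1_K)-CHILD ON (⋆)-BUNDLES**: under the hypotheses, (⋆) + rational pro-class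
⇒ an INTEGRAL COMPATIBLE lift of `[E₁]`. -/
theorem integralCompatibleLift_of_crux (hcrux : FormalLiftingFromClassLifting)
    {d : ℕ} (h₁ : IsSmoothProperModel d 𝒳) (h₂ : Crystalline.IsProjectiveOverRing 𝒳)
    (h₃ : d + 6 < p) (h₄ : HodgeTorsionFree 𝒳 d) {E₁ : (specialFibre 𝒳).left.Modules}
    (hE₁ : IsFiniteLocallyFree E₁) (hs : ClassLiftsImplyObjectLifts 𝒳 E₁)
    (hr : RationalProLift 𝒳 E₁ hE₁) : IntegralCompatibleLift 𝒳 E₁ hE₁ :=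
  integralCompatibleLift_of_liftsFormally hE₁ (crux_iff.mp hcrux p k d 𝒳 h₁ h₂ h₃ h₄ E₁ hE₁ hs hr)

/-- Under the crux, for a (⋆)-bundle on an `𝒳` satisfying the hypotheses:
`LiftsFormally ↔ RationalProLift` (→ unconditionally, `rationalProLift_of_liftsFormally`). -/
theorem liftsFormally_iff_rationalProLift_of_crux (hcrux : FormalLiftingFromClassLifting)
    {d : ℕ} (h₁ : IsSmoothProperModel d 𝒳) (h₂ : Crystalline.IsProjectiveOverRing 𝒳)
    (h₃ : d + 6 < p) (h₄ : HodgeTorsionFree 𝒳 d) {E₁ : (specialFibre 𝒳).left.Modules}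
    (hE₁ : IsFiniteLocallyFree E₁) (hs : ClassLiftsImplyObjectLifts 𝒳 E₁) :
    LiftsFormally 𝒳 E₁ ↔ RationalProLift 𝒳 E₁ hE₁ :=
  ⟨rationalProLift_of_liftsFormally hE₁, crux_iff.mp hcrux p k d 𝒳 h₁ h₂ h₃ h₄ E₁ hE₁ hs⟩

/-- Under the crux, for a (⋆)-bundle on an `𝒳` satisfying the hypotheses:
`IntegralCompatibleLift ↔ RationalProLift` (→ unconditionally). So P1a is EQUIVALENT to its own
(1_K)-child restricted to (⋆)-bundles — the whole content of the crux is "rational ⇒ integral-compatible"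
for classes of (⋆)-bundles. -/
theorem integralCompatibleLift_iff_rationalProLift_of_crux (hcrux : FormalLiftingFromClassLifting)
    {d : ℕ} (h₁ : IsSmoothProperModel d 𝒳) (h₂ : Crystalline.IsProjectiveOverRing 𝒳)
    (h₃ : d + 6 < p) (h₄ : HodgeTorsionFree 𝒳 d) {E₁ : (specialFibre 𝒳).left.Modules}
    (hE₁ : IsFiniteLocallyFree E₁) (hs : ClassLiftsImplyObjectLifts 𝒳 E₁) :
    IntegralCompatibleLift 𝒳 E₁ hE₁ ↔ RationalProLift 𝒳 E₁ hE₁ :=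
  ⟨rationalProLift_of_integralCompatibleLift hE₁,
    integralCompatibleLift_of_crux hcrux h₁ h₂ h₃ h₄ hE₁ hs⟩

/-! ### (2_K) is exactly what separates level-wise lifts from compatible lifts

The converse moral of the toy `levelwiseLifts_not_compatible` (T3), on the genuine `K₀`-tower: under
KERNEL-TOWER SURJECTIVITY at `𝒳`, a class lifting to every level lifts COMPATIBLY (correct the level-`n+1`
lift by a kernel element, recursively). Hence a criterion-2 witness whose class lifts to every level is a
counterexample to (2_K) at `𝒳` (`not_kernelTowerSurjective_of_levelwise_incompatible`), and criterion 2
splits as: (some level fails ⇒ ¬S2 ∨ ¬S3 at `𝒳`, (T2)) ∨ (all levels lift but not compatibly ⇒ ¬(2_K) at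
`𝒳`). Either way a kill of P1a through its class-level shadow is a kill of one of the leads' typed children
at the same `𝒳` — the disprover's hunt and the children's refuters' hunts remain ONE search. -/

omit [PerfectRing k p] in
/-- One correction step: from a compatible partial datum at level `n` (a lift `xn` of `y` to `X_{n+1}`) and
ANY lift `z` of `y` to `X_{n+2}`, kernel-tower surjectivity produces a lift of `y` to `X_{n+2}` restricting
to `xn`. -/
theorem exists_compatible_step (h₂ : KernelTowerSurjective 𝒳)
    {y : KTheory.KZero (specialFibre 𝒳).left} {n : ℕ}
    (xn : KTheory.KZero (thickening 𝒳 (n + 1)).left)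
    (hxn : KTheory.KZero.map (specialFibreToThickening 𝒳 n) xn = y)
    (z : KTheory.KZero (thickening 𝒳 (n + 2)).left)
    (hz : KTheory.KZero.map (specialFibreToThickening 𝒳 (n + 1)) z = y) :
    ∃ w : KTheory.KZero (thickening 𝒳 (n + 2)).left,
      KTheory.KZero.map (specialFibreToThickening 𝒳 (n + 1)) w = y ∧
      KTheory.KZero.map (thickeningMap 𝒳 (Nat.le_succ (n + 1))) w = xn := by
  obtain ⟨t', ht'0, ht'⟩ := h₂ n
    (KTheory.KZero.map (thickeningMap 𝒳 (Nat.le_succ (n + 1))) z - xn) (by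
      rw [map_sub, ← KTheory.KZero.map_comp_apply, specialFibreToThickening_comp_thickeningMap, hz,
        hxn, sub_self])
  exact ⟨z - t', by rw [map_sub, hz, ht'0, sub_zero], by rw [map_sub, ht', sub_sub_cancel]⟩

omit [PerfectRing k p] in
/-- **(2_K) ∧ (level-wise lifts) ⇒ (1_K)**: under kernel-tower surjectivity at `𝒳`, a class `y ∈ K₀(X_k)`
that lifts to every level admits a COMPATIBLE family of lifts (`x_n ∈ K₀(X_{n+1})`, `x_{n+1}|X_{n+1} = x_n`,
`x_0|X_k = y`). Dependent recursion on `exists_compatible_step`. -/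
theorem exists_compatibleLift_of_kernelTowerSurjective_of_liftsToAllLevels
    (h₂ : KernelTowerSurjective 𝒳) {y : KTheory.KZero (specialFibre 𝒳).left}
    (h : LiftsToAllLevels 𝒳 y) :
    ∃ x : ∀ n : ℕ, KTheory.KZero (thickening 𝒳 (n + 1)).left,
      (∀ n, KTheory.KZero.map (thickeningMap 𝒳 (Nat.le_succ (n + 1))) (x (n + 1)) = x n) ∧
      KTheory.KZero.map (specialFibreToThickening 𝒳 0) (x 0) = y := by
  classical
  -- the type of level-`n` lifts of `y`
  let L : ℕ → Type 1 := fun n =>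
    {w : KTheory.KZero (thickening 𝒳 (n + 1)).left // KTheory.KZero.map (specialFibreToThickening 𝒳 n) w = y}
  have step : ∀ n (s : L n), ∃ w : L (n + 1),
      KTheory.KZero.map (thickeningMap 𝒳 (Nat.le_succ (n + 1))) w.1 = s.1 := by
    intro n s
    obtain ⟨z, hz⟩ := h (n + 1)
    obtain ⟨w, hw, hws⟩ := exists_compatible_step h₂ s.1 s.2 z hz
    exact ⟨⟨w, hw⟩, hws⟩
  obtain ⟨z0, hz0⟩ := h 0
  let x : ∀ n : ℕ, L n := fun n => Nat.rec (motive := fun n => L n) ⟨z0, hz0⟩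
    (fun n s => Classical.choose (step n s)) n
  refine ⟨fun n => (x n).1, fun n => ?_, (x 0).2⟩
  exact Classical.choose_spec (step n (x n))

omit [PerfectRing k p] in
/-- Under (2_K) at `𝒳`: level-wise liftability of `[E₁]` is EQUIVALENT to an integral compatible lift. -/
theorem integralCompatibleLift_iff_liftsToAllLevels_of_kernelTowerSurjective
    (h₂ : KernelTowerSurjective 𝒳) {E₁ : (specialFibre 𝒳).left.Modules} (hE₁ : IsFiniteLocallyFree E₁) :
    IntegralCompatibleLift 𝒳 E₁ hE₁ ↔ LiftsToAllLevels 𝒳 (KTheory.KZero.of E₁ hE₁) :=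
  ⟨fun ⟨x, hx, hx0⟩ n => ⟨x n, (map_specialFibreToThickening_of_compatible x hx n).trans hx0⟩,
    exists_compatibleLift_of_kernelTowerSurjective_of_liftsToAllLevels h₂⟩

omit [PerfectRing k p] in
/-- **A criterion-2 witness whose class lifts to every level is a counterexample to (2_K) at `𝒳`.** -/
theorem not_kernelTowerSurjective_of_levelwise_incompatible {E₁ : (specialFibre 𝒳).left.Modules}
    (hE₁ : IsFiniteLocallyFree E₁) (hall : LiftsToAllLevels 𝒳 (KTheory.KZero.of E₁ hE₁))
    (hno : ¬ IntegralCompatibleLift 𝒳 E₁ hE₁) : ¬ KernelTowerSurjective 𝒳 :=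
  fun h₂ => hno (exists_compatibleLift_of_kernelTowerSurjective_of_liftsToAllLevels h₂ hall)

omit [PerfectRing k p] in
/-- **Criterion 2 splits over the leads' typed children**: a (⋆)-bundle with a rational pro-class and no
integral compatible lift violates, at the same `𝒳`, either some level (hence S2 or S3, by (T2)) or (2_K). -/
theorem levelFailure_or_not_kernelTowerSurjective_of_incompatible {E₁ : (specialFibre 𝒳).left.Modules}
    (hE₁ : IsFiniteLocallyFree E₁) (hno : ¬ IntegralCompatibleLift 𝒳 E₁ hE₁) :
    (∃ n, ¬ LiftsToLevel 𝒳 (KTheory.KZero.of E₁ hE₁) n) ∨ ¬ KernelTowerSurjective 𝒳 := by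
  by_cases hall : LiftsToAllLevels 𝒳 (KTheory.KZero.of E₁ hE₁)
  · exact Or.inr (not_kernelTowerSurjective_of_levelwise_incompatible hE₁ hall hno)
  · left
    simpa [LiftsToAllLevels] using hall

/-- **ANATOMY OF A COUNTEREXAMPLE (pointwise completeness of the stub split on the negative side).** If a
(⋆)-bundle `E₁` on some `𝒳` does NOT lift formally, then AT THE SAME `𝒳` either `[E₁]` fails to lift to
some level, or (2_K) fails: contrapositive of the pointwise glue (all levels + (2_K) ⇒ compatible lift ⇒
integral step class lifting ⇒ `LiftsFormally`, §§3, 13). No hypothesis on `𝒳` is used. -/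
theorem counterexample_anatomy {E₁ : (specialFibre 𝒳).left.Modules}
    (hE₁ : IsFiniteLocallyFree E₁) (hs : ClassLiftsImplyObjectLifts 𝒳 E₁) (hno : ¬ LiftsFormally 𝒳 E₁) :
    (∃ n, ¬ LiftsToLevel 𝒳 (KTheory.KZero.of E₁ hE₁) n) ∨ ¬ KernelTowerSurjective 𝒳 := by
  by_contra hc
  simp only [not_or, not_exists, not_not] at hc
  exact hno (liftsFormally_of_integralStepClassLifting hE₁ hs
    (integralStepClassLifting_of_compatibleLift_of_kernelTowerSurjective hE₁
      (exists_compatibleLift_of_kernelTowerSurjective_of_liftsToAllLevels hc.2 hc.1) hc.2))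

/-- **EVERY COUNTEREXAMPLE TO P1a BREAKS A STUB OF THE PICKED LINE AT THE SAME `𝒳`**: with the rational
pro-class in hand, a level failure of `[E₁]` is a failure of S2 (`PSaturated`) or S3 (`PrimeToPDivisible`)
at `𝒳` ((T0)/(T2)), and otherwise S1 = (2_K) fails at `𝒳`. So the union of the refuters' searches for
S1, S2, S3 — run pointwise — covers every possible kill of the crux; nothing falls between the stubs. -/
theorem counterexample_hits_a_stub {E₁ : (specialFibre 𝒳).left.Modules}
    (hE₁ : IsFiniteLocallyFree E₁) (hs : ClassLiftsImplyObjectLifts 𝒳 E₁) (hr : RationalProLift 𝒳 E₁ hE₁)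
    (hno : ¬ LiftsFormally 𝒳 E₁) :
    ¬ KernelTowerSurjective 𝒳 ∨ ¬ PSaturated 𝒳 ∨ ¬ PrimeToPDivisible 𝒳 := by
  rcases counterexample_anatomy hE₁ hs hno with ⟨n, hn⟩ | h2
  · right
    by_contra hc
    rw [not_or, not_not, not_not] at hc
    exact hn (liftsToAllLevels_of_stubs hc.1 hc.2 hE₁ hr n)
  · exact Or.inl h2

end NecessityFive

/-- **(1_K) ON (⋆)-BUNDLES** — the (1_K)-child of the leads (`IntegralCompatibleLiftFromRationalProLift`,
hypothesis `oneK` of the landed glue) RESTRICTED to bundles carrying (⋆): under the hypotheses of the crux,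
a (⋆)-bundle with a rational pro-class has an integral compatible lift of its class. -/
def OneKOnStarBundles : Prop :=
  ∀ (p : ℕ) [Fact p.Prime] (k : Type) [Field k] [CharP k p] [PerfectRing k p] (d : ℕ)
    (𝒳 : SchemeOver (WittVector p k)), IsSmoothProperModel d 𝒳 →
    Crystalline.IsProjectiveOverRing 𝒳 → d + 6 < p → HodgeTorsionFree 𝒳 d →
    ∀ (E₁ : (specialFibre 𝒳).left.Modules) (hE₁ : IsFiniteLocallyFree E₁),
      ClassLiftsImplyObjectLifts 𝒳 E₁ → RationalProLift 𝒳 E₁ hE₁ → IntegralCompatibleLift 𝒳 E₁ hE₁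

/-- (2_K) for every `𝒳` satisfying the hypotheses of the crux (the leads' second child, globally). -/
def TwoKGlobal : Prop :=
  ∀ (p : ℕ) [Fact p.Prime] (k : Type) [Field k] [CharP k p] [PerfectRing k p] (d : ℕ)
    (𝒳 : SchemeOver (WittVector p k)), IsSmoothProperModel d 𝒳 →
    Crystalline.IsProjectiveOverRing 𝒳 → d + 6 < p → HodgeTorsionFree 𝒳 d → KernelTowerSurjective 𝒳

/-- **P1a ⟹ (1_K) on (⋆)-bundles** (unconditional: the necessity theorem through the crux). -/
theorem oneKOnStarBundles_of_crux (h : FormalLiftingFromClassLifting) : OneKOnStarBundles :=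
  fun _ _ _ _ _ _ _ _ h₁ h₂ h₃ h₄ _ hE₁ hs hr => integralCompatibleLift_of_crux h h₁ h₂ h₃ h₄ hE₁ hs hr

/-- **(1_K) on (⋆)-bundles ∧ (2_K) ⟹ P1a** (sharpening of `crux_of_oneK_twoK`: the reduction only ever
applies (1_K) to the (⋆)-bundle in hand, so the leads' (1_K)-child may be weakened by the hypothesis (⋆)
without losing the glue). -/
theorem crux_of_oneKOnStarBundles_of_twoK (h₁K : OneKOnStarBundles) (h₂K : TwoKGlobal) :
    FormalLiftingFromClassLifting :=
  crux_iff.mpr fun p _ k _ _ _ d 𝒳 h₁ h₂ h₃ h₄ E₁ hE₁ hs hr =>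
    liftsFormally_of_integralStepClassLifting hE₁ hs
      (integralStepClassLifting_of_compatibleLift_of_kernelTowerSurjective hE₁
        (h₁K p k d 𝒳 h₁ h₂ h₃ h₄ E₁ hE₁ hs hr) (h₂K p k d 𝒳 h₁ h₂ h₃ h₄))

/-- **MODULO (2_K), P1a IS EQUIVALENT TO ITS (1_K)-CHILD ON (⋆)-BUNDLES.** (`→` holds outright,
`oneKOnStarBundles_of_crux`; `←` is the glue and needs (2_K).) So once `KernelTowerSurjective` is settled
positively, the crux and "(⋆)-bundles: rational pro-lift ⇒ integral compatible lift" stand or fall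
together; a refuter of either hunts the same witness (criterion 2 below). -/
theorem crux_iff_oneKOnStarBundles_of_twoK (h₂K : TwoKGlobal) :
    FormalLiftingFromClassLifting ↔ OneKOnStarBundles :=
  ⟨oneKOnStarBundles_of_crux, fun h₁K => crux_of_oneKOnStarBundles_of_twoK h₁K h₂K⟩

/-- **KILL CRITERION 2 (`lim¹` form, unconditional).** One (⋆)-bundle on an `𝒳` satisfying the hypotheses
of the crux, with a rational pro-class but WITHOUT an integral compatible lift of its class, refutes P1a.
Contains criterion 1 (`not_crux_of_oneStepWitness'`: there (⋆) is vacuous and level `1` already fails). -/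
theorem not_crux_of_incompatibleWitness
    (w : ∃ (p : ℕ) (_ : Fact p.Prime) (k : Type) (_ : Field k) (_ : CharP k p) (_ : PerfectRing k p)
      (d : ℕ) (𝒳 : SchemeOver (WittVector p k)),
      IsSmoothProperModel d 𝒳 ∧ Crystalline.IsProjectiveOverRing 𝒳 ∧ d + 6 < p ∧
      HodgeTorsionFree 𝒳 d ∧
      ∃ (E₁ : (specialFibre 𝒳).left.Modules) (hE₁ : IsFiniteLocallyFree E₁),
        ClassLiftsImplyObjectLifts 𝒳 E₁ ∧ RationalProLift 𝒳 E₁ hE₁ ∧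
        ¬ IntegralCompatibleLift 𝒳 E₁ hE₁) :
    ¬ FormalLiftingFromClassLifting := by
  obtain ⟨p, _, k, _, _, _, d, 𝒳, h₁, h₂, h₃, h₄, E₁, hE₁, hs, hr, h⟩ := w
  exact fun hcrux => h (integralCompatibleLift_of_crux hcrux h₁ h₂ h₃ h₄ hE₁ hs hr)

/-- Criterion 1 recovered from criterion 2 (sanity link between §§6/12 and §13). -/
theorem not_crux_of_oneStepWitness''
    (w : ∃ (p : ℕ) (_ : Fact p.Prime) (k : Type) (_ : Field k) (_ : CharP k p) (_ : PerfectRing k p)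
      (d : ℕ) (𝒳 : SchemeOver (WittVector p k)),
      IsSmoothProperModel d 𝒳 ∧ Crystalline.IsProjectiveOverRing 𝒳 ∧ d + 6 < p ∧
      HodgeTorsionFree 𝒳 d ∧
      ∃ (E₁ : (specialFibre 𝒳).left.Modules) (hE₁ : IsFiniteLocallyFree E₁),
        RationalProLift 𝒳 E₁ hE₁ ∧ ¬ OneStepClassLift 𝒳 E₁ hE₁) :
    ¬ FormalLiftingFromClassLifting := by
  obtain ⟨p, hp, k, hk, hc, hP, d, 𝒳, h₁, h₂, h₃, h₄, E₁, hE₁, hr, h⟩ := w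
  exact not_crux_of_incompatibleWitness ⟨p, hp, k, hk, hc, hP, d, 𝒳, h₁, h₂, h₃, h₄, E₁, hE₁,
    classLiftsImplyObjectLifts_of_not_oneStepClassLift hE₁ h, hr,
    not_integralCompatibleLift_of_not_liftsToLevel hE₁ (n := 1) h⟩


/-! ### 13b. The natural strengthening "drop the disjunction" (cycle-5 (V)) -/

/-- **THE CRUX WITHOUT ITS DISJUNCTION** `d ≤ 3 ∨ Ω¹ free` (keeping only `hO`, `hΩ`): the natural
strengthening a planner reaches for once `Ω²` has a carrier. Paper status: TRUE for `d ≤ 3` (= `CruxLowDim`)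
and for abelian schemes / their torsors ((E7)+(H)); EXPOSED at `d = 4`: the pro-obstruction group then has
the weight-3 piece `lim_m ℍ⁶(C⁽³⁾_m) ⊇ H⁴(𝒳,Ω²)/δ`, whose torsion `≅ (H¹(𝒳,Ω²)_tors)^∨` (duality over `W`,
`Ω²` self-dual in relative dimension 4) is not controlled by `hO`, `hΩ`; a Hodge-`(𝒪,Ω¹)`-torsion-free
fourfold with `H¹(𝒳,Ω²)[p] ≠ 0` and a (⋆)-bundle with non-zero torsion weight-3 obstruction would refute
it (no example computed; none known to this seat). The correct all-dimension hypothesis is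
torsion-freeness of every `H^b(𝒳,Ω^a)`. Recorded so that the strengthening is not filed by accident. -/
def CruxWithoutDisjunction : Prop :=
  ∀ (p : ℕ) [Fact p.Prime] (k : Type) [Field k] [CharP k p] [PerfectRing k p] (d : ℕ)
    (𝒳 : SchemeOver (WittVector p k)), IsSmoothProperModel d 𝒳 →
    Crystalline.IsProjectiveOverRing 𝒳 → d + 6 < p →
    (∀ (b : ℕ) (x : structureSheafCohomology 𝒳.left b), (p : ℤ) • x = 0 → x = 0) →
    (∀ (b : ℕ) (x : hodgeCohomologyOne 𝒳 b), (p : ℤ) • x = 0 → x = 0) →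
    ∀ (E₁ : (specialFibre 𝒳).left.Modules) (hE₁ : IsFiniteLocallyFree E₁),
      ClassLiftsImplyObjectLifts 𝒳 E₁ → RationalProLift 𝒳 E₁ hE₁ → LiftsFormally 𝒳 E₁

/-- The strengthening implies the crux (so its `d = 4` exposure does not touch P1a, and a refutation of
it would NOT be a refutation of P1a). -/
theorem crux_of_cruxWithoutDisjunction (h : CruxWithoutDisjunction) : FormalLiftingFromClassLifting :=
  crux_iff.mpr fun p _ k _ _ _ d 𝒳 h₁ h₂ h₃ h₄ E₁ hE₁ hs hr =>
    h p k d 𝒳 h₁ h₂ h₃ h₄.1 h₄.2.1 E₁ hE₁ hs hr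

/-- Conversely the strengthening is the crux PLUS its `d ≥ 4`, non-`Ω¹`-free cases: it splits as
`CruxLowDim ∧ (the d ≥ 4 general case)`; the low-dimensional conjunct is implied by P1a (`lowDim_of_crux`). -/
theorem cruxLowDim_of_cruxWithoutDisjunction (h : CruxWithoutDisjunction) : CruxLowDim :=
  fun p _ k _ _ _ d 𝒳 h₁ h₂ h₃ hO hΩ _ E₁ hE₁ hs hr => h p k d 𝒳 h₁ h₂ h₃ hO hΩ E₁ hE₁ hs hr

end

end Summit.HodgeConjecture.HodgeConjecture.Cruxes.FormalLiftingFromClassLifting.Disproof
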